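import Summits.FinalStateConjecture.FinalStateConjecture.Theses.PhotonSphereChannels
import Literature.Geometry.Lorentzian.ModelData
import Literature.Geometry.Lorentzian.ModelDataProofs
import Literature.Geometry.Lorentzian.ModelDataCompletenessProofs
import Literature.Geometry.Lorentzian.MinkowskiCauchyDevelopment
import Literature.Geometry.Lorentzian.TrivialDataAdmissible
import Literature.Geometry.Lorentzian.KerrSchildDivergence
import Literature.Geometry.Lorentzian.CausalityClosedProofs
import Literature.Geometry.Lorentzian.Hypersurface
import Literature.Geometry.Lorentzian.TameBreathingCurve
import Literature.Geometry.Lorentzian.TameGenericityLocal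
import Literature.Geometry.Lorentzian.AFEndChartEmbedding
import Literature.Geometry.Lorentzian.ConvergenceTransport

/-!
# Disproof of `TameCensorship` — findings (cdisprove seat; crux RE-TYPED as `stmt-FinalStateConjecture-17431`
(rev ≥ 15, TAME genericity) — cycle 4 (2026-08-17); formerly `stmt-FinalStateConjecture-10047` — cycles 1–3,
route `PhotonSphereChannels`, rank 4)

## CYCLE 4 (2026-08-17) — first cycle on the RE-TYPED crux `stmt-17431` (read this block first)

**Verdict: the re-typed crux RESISTS; no refutation. One natural strengthening newly refuted ON THE
CRUX'S OWN CLASS AND NOTION (§12): TAME Christodoulou genericity is not closed under conjunction on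
`admissibleVacuumData ℝ³`.** What changed at rev 15: the bundled property `Q` (= `tameSet`, §1) is
byte-identical; only the genericity notion became `IsTameChristodoulouGeneric … 1` (witness curve tame on
ONE fixed sole end — DR rates, continuous mass, `wDist`-continuous at `0` — and immersed at `0`).
Consequences, all kernel-checked in this file (rc 0; the only `sorry` is the documented §5 near-miss):
* §1 `tameCensorship_iff` (re-typed read-back, `Iff.rfl`: no junk between text and `Prop`) and
  `tameCensorship_imp_topologyFree`: NEW ⇒ OLD body, so EVERY negative-side lemma of cycles 1–3 (§2–§11,
  the landed `Negative/*` files) transfers to stmt-17431 by contraposition; the converse fails (burial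
  families are not tame), which kills the old cheap PROOF routes, not any refutation route.
* §2 `not_tameCensorship_iff` (re-typed): a refutation must exhibit an admissible EXCEPTIONAL datum all of
  whose tame immersed injective admissible curves re-enter the exceptional set. Fewer curves to defeat
  than before — but an exceptional datum still needs an MGHD in hand: the MGHD barrier of §3/§5 is
  unchanged and is THE reason the crux resists (no instance of `Q`, positive or negative, is decidable in
  the tree; `IsExtremal` demands `0 < M`, so the `M = a = 0` "flat remnant" junk is excluded; `IsLateChart`
  has no orientation clause, which only over-strengthens (i), cf. §6).
  The maximality trick does not help either: from a hypothetical MGHD `𝒟` of `trivialData` one embeds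
  `Minkowski.vacuumCauchyDevelopment` INTO `𝒟` (maximality of `𝒟`, not of Minkowski), but Minkowski
  space violates none of the three clauses, so no contradiction with `Q(trivialData)` arises; for the
  other members of a witness curve nothing at all is known.
* §8 `tameCensorship_codimZero` (re-typed, via `isTameDataFamily_const` on the datum's own end): codim `0`
  is still a tautology; content enters at `m = 1` (§3: `exists_isMaximal_of_tameCensorship`).
* §12 (NEW, the cycle's landing): `Tame.isTameChristodoulouGeneric_PV/QH`,
  `Tame.not_hasCodimAtLeastIn_PV_and_QH`, `not_isTameChristodoulouGeneric_and_of_admissible`,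
  `isTameChristodoulouGeneric_and_fails_admissible` — two properties of admissible data on `ℝ³`, each
  TAME-generic (codim 1) relative to `admissibleVacuumData Minkowski.slice`, whose conjunction has
  codimension ZERO. Model entirely inside the admissible class: observable `h₁₁` at two chart points of
  the standard end, motions = the tree's BREATHING curves (isometric copies — admissible, tame on the
  datum's own end, immersed, injective), exceptional sets = concentric squares. So the planner's
  "(not closed under ∧)" caveat is now a theorem for the summit's notion on the crux's class: K3 does not
  follow from tame-generic WCC + tame-generic third law + tame-generic tameness; ONE curve must escape all
  exceptional sets at once. Landing: `Theorems/TameCensorship/Negative/TameBreathingObservable.lean`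
  (p134044, ACCEPTED d1a654b784ec) + `…/TameGenericityAndFails.lean` (p134333, ACCEPTED 9cd7f27d06c4);
  §12 is the self-contained inline copy (importers should use the landed modules).
* §13 (NEW): REFUTATION INTERFACE FOR CLAUSE (i) — `extremalChart_pushforward`,
  `not_mem_tameSet_of_extremal_lateChart`, `no_extremal_lateChart_of_mem_tameSet`: late charts with
  decaying deviation push forward along the development embeddings that maximality supplies
  (`Spacetime.deviation_comp`, tree), so ONE vacuum Cauchy development of the datum — maximal or not —
  with an extremal-Kerr late chart makes the datum exceptional; maximality/uniqueness is needed only on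
  the far side. Landed: `Theorems/TameCensorship/Negative/ExtremalChartPushforward.lean` (p134456,
  ACCEPTED 979b91f06591). What is still missing for an exceptional datum is a vacuum Cauchy development of a
  complete one-ended admissible datum containing an extremal Kerr late region (local well-posedness for
  glued data + Cauchy-surface property), and even then K3 would only be shown NON-VACUOUS, not false.
* Witness class of the re-typed notion: inhabited through EVERY admissible datum
  (`InitialDataSet.exists_tame_selfWitness`, tree) — but these self-witnesses are isometric copies
  (`d.comap` of compactly supported diffeomorphisms) and `Q` is a property of the isometry class of the
  datum (developments transport along `embed ∘ φ`), so they can never witness K3 at an exceptional datum;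
  a K3 witness curve must leave the gauge orbit. (Transport of `VacuumCauchyDevelopment`/`IsMaximal` along
  data isometries is not in the tree — flagged in `TameBreathingCurve.lean`'s docstring — so this is
  recorded as prose, not as a theorem.)
* Hypotheses of the tame witness notion, load-bearing status: `IsSoleEnd` — automatic for admissible
  data; `Continuous M` + `wDist → 0` — exclude burial/receding-mass families (the point of the re-type;
  they do NOT exclude receding small bumps riding on an immersed curve, which are physically inert);
  `IsImmersedAtZero` + `Injective` — exclude stalled/constant curves (§8 shows what happens without an
  escape requirement). None of them offers a refutation handle: dropping any of them makes K3 WEAKER.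
* Literature (cycle 4): unchanged from cycles 1–3 (Kehle–Unger extremal formation = codimension-1
  picture, arXiv:2402.10190 / 2410.16234; RSR naked singularities non-generic; no a-priori tameness
  mechanism in print). No counterexample family to a TAME-generic statement is known in any model.

The cycle-1–3 text below is kept verbatim (it concerns the same `tameSet`; read "IsChristodoulouGeneric"
there as the weaker consequence `tameCensorship_imp_topologyFree` of the present crux).

## Cycles 1–3 (stmt-10047, topology-free body)

**Verdict after cycle 3: the crux RESISTS; no refutation, no clause killed; the endpoint/`D⁺` junk found
in the LINE's objects (drefuter, 2026-08-16) does NOT reach the crux (§10); the lead's seven registered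
stubs are assessed in §11 (`-- Targets`): none is killed, two are conjectural/open (N′, R), and the
uniform-contraction hypothesis of N′ (and of Hawking's bound H) is PROVED load-bearing (§11c, kernel-checked:
the pointwise version of null terminality is false in Minkowski's vacuum Cauchy development — companion
workfile `NullTerminalityUniformity.lean`).**
(Cycle-2 wording, still valid:) **the crux RESISTS; no refutation, no clause killed.** It is an open problem
(weak cosmic censorship over the repaired carrier `VacuumCauchyDevelopment`, a dynamical third law
— two-sided in time, §6/§6b — and an a-priori tameness statement, bundled as ONE
Christodoulou-generic property, and, as typed, also read on hidden sectors, see "R1/R2" below), and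
the formalisation offers no junk handle in either direction: no instance of the tame property —
positive or negative — is decidable in the tree (§5), because the tree has no MGHD theory.

## What this file establishes (all `sorry`-free except the labelled near-miss §5; §11c is proved in the imported companion workfile)

LANDED in the tree (ACCEPTED; ideators/planners/provers may `import` them):
`Theorems/TameCensorship/Negative/ExistentialContent.lean` p69443 (§1–§3),
`…/Negative/GenericityModel.lean` p69520 + `…/Negative/GenericityAndFails.lean` p69855 (§4);
cycle 2 (all ACCEPTED 2026-08-16): `…/Negative/GenericityScale.lean` p73805 (§2b + §4b),
`…/Negative/TimeReversedRemnant.lean` p74602 (§6 + §6b), `…/Negative/BoostBlindness.lean` p74634 (§9);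
cycle 3 (proposed 2026-08-16, see NOTES of the g3 seat for the p-ids): `…/Negative/KillingAxisTimelike.lean`
(§11a) and `…/Negative/FaithfulDomainOfDependence.lean` (§10 + §11b).
§5, §7, §8 live only in this workfile; §11c lives in the companion workfile `NullTerminalityUniformity.lean` (landing proposed).

* §1 `tameCensorship_iff` — read-back: `TameCensorship ↔ ∀ Σ, HasCodimAtLeastIn 𝓓 {D ∈ 𝓓 | D ∉ tameSet Σ} 1`
  with `𝓓 = admissibleVacuumData Σ` and `tameSet Σ` the verbatim property (MGHD exists ∧ every MGHD has
  complete `𝓘⁺`, no extremal remnant, bounded `C³` geometry of the outer region at a uniform scale).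
* §2 transparency of curve-genericity (`IsChristodoulouGeneric … 1`): it is `True` on a property holding
  on all of `𝓓` (tree: `isChristodoulouGeneric_of_forall`) and `False` on a property failing on all of a
  NONEMPTY `𝓓` (`not_isChristodoulouGeneric_of_forall_not`); a refuter must therefore exhibit an admissible
  datum `D` failing the property such that EVERY smooth injective admissible curve through `D` meets the
  exceptional set again (`not_tameCensorship_iff`). Since `IsSmoothDataFamily` is joint smoothness in
  `(c, x)` with NO uniformity at infinity (masses may jump along a "smooth curve"), the supply of curves is
  huge and only an exceptional set that is all of `𝓓 Σ` (or traps every curve, §2b/§4) can refute — i.e. a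
  refutation of `TameCensorship` is essentially a disproof of weak cosmic censorship on some `Σ`.
* §2b (cycle 2) the SCALE and the NORMAL FORM: `hasCodimAtLeastIn_zero_iff` (codimension `≥ 0` inside `𝓓`
  is exactly `𝓔 ⊆ 𝓓`), `HasCodimAtLeastIn.of_succ` / `.mono_codim` (the scale is monotone in `m`:
  restrict to a coordinate subspace), `hasCodimAtLeastIn_of_local` / `hasCodimAtLeastIn_iff_local`
  (LOCAL ESCAPES SUFFICE: a family jointly smooth, injective, admissible and good merely for parameters
  in a ball `B(0, δ)` is globalised by the squash map `c ↦ δ c / √(1 + ‖c‖²)`; this is the honest normal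
  form of what a proof of the crux must build through each exceptional datum — note that `F c ≠ F 0`
  for `c ≠ 0` is automatic but INJECTIVITY is an extra demand of the architect's regularisation: a cure
  even in `c`, e.g. depending on `c²`, is not an admissible family), and the abstract LEVEL-SET TRAP
  `not_hasCodimAtLeastIn_of_trap` (a curve-continuous observable `f`, `f d = 0`, whose admissible zero
  set and whose admissible level sets `{|f| = ρ}` for arbitrarily small `ρ > 0` are exceptional, makes
  the exceptional set of codimension `0` — it fails `HasCodimAtLeastIn … m` for EVERY `m ≥ 1`; this is
  the exact shape of obstruction a refutation of the crux must exhibit).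
* §3 NON-VACUITY and EXISTENTIAL CONTENT: the admissible class of `Σ = ℝ³` is inhabited by the
  Minkowski data `(ℝ³, δ, 0)` (tree: `TrivialDataAdmissible.lean`, `trivialData_mem_admissibleVacuumData`;
  re-exported as `trivialData_admissible`), so the crux is not vacuously true; and
  `exists_mem_tameSet_of_tameCensorship` / `exists_isMaximal_of_tameCensorship` — `TameCensorship` IMPLIES
  that some admissible datum on `ℝ³` has a maximal vacuum Cauchy development with complete `𝓘⁺` (sojourn
  form), no extremal remnant and tame outer geometry. No MGHD-existence theorem is in the tree
  (`choquetBruhat_geroch_exists_mghd_cauchy` is an undischarged named fact; maximality of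
  `Minkowski.vacuumCauchyDevelopment` is unproved), so ANY proof of the crux must construct such an object:
  the crux has existential, not merely generic-bookkeeping, content ("load-bearing": MGHD theory).
* §4 REFUTED NATURAL STRENGTHENING / GLUE PRINCIPLE: `isChristodoulouGeneric_and_fails` —
  Christodoulou's curve-genericity is NOT closed under conjunction. On the data space of the Minkowski
  slice (all smooth `(h, k)`, class `univ`) there are properties `P`, `Q`, each generic with codimension
  `≥ 1` in curve form, whose conjunction is not generic (explicit model: the observable
  `Φ(D) = (k(0)(e,e), k(e)(e,e)) ∈ ℝ²`; exceptional sets = origin ∪ upper semicircles of radii `1/(n+1)`,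
  resp. lower semicircles; each is escaped by radial or parabolic curves, but their union contains whole
  circles shrinking to `Φ(trivialData) = 0`, which traps every smooth family through the trivial datum by
  the intermediate value theorem). CONSEQUENCE for the route's two-layer plan ("TameCensorship ⇐ WCC →
  generic third law → generic tameness, glued as one curve-generic statement"): the glue step is invalid as
  pure logic; a proof must produce ONE curve escaping all three exceptional sets simultaneously (or work
  with a stronger, intersection-stable genericity such as open-dense in a topology, which the summit does
  not use).
* §4b (cycle 2) `not_isChristodoulouGeneric_P_and_Q_codim`, `isChristodoulouGeneric_and_fails_all_codim`:
  the conjunction of §4 has codimension ZERO — its exceptional set fails `HasCodimAtLeastIn univ … m` for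
  every `m ≥ 1` (by the abstract trap of §2b). Raising the codimension bookkeeping cannot rescue the glue.
* §6 read-back remark: `timeReversal_mem_lorentzGroup` — `lorentzGroup` is the full `O(1,3)`, so the
  no-extremal-remnant clause quantifies over time-reversing motions too and is secretly TWO-SIDED in
  time; §6b (cycle 2) makes this concrete: for `Λ = T` the "late region" `{t* > τ₀}` of
  `boostedKerrBackground T c M a` is the coordinate PAST `{x⁰ < c⁰ − τ₀}` (`mem_lateRegion_T_iff`) and its
  slabs are `{x⁰ = c⁰ − τ}` (`mem_timeSlab_T_iff`), receding to `x⁰ → −∞` along the clause's limit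
  `τ → +∞`: the clause forbids past-asymptotic (white-hole) extremal Kerr exteriors of the two-sided MGHD.
* §7 vacuous instances: `not_compactSpace_of_afEnd`, `isChristodoulouGeneric_of_isEmpty_afEnd` — compact
  `Σ` carry no AF end, their admissible class is empty and their instance of the crux holds for want of
  data; the content is at non-compact `Σ` (e.g. `ℝ³`, §3).
* §8 (cycle 2) `tameCensorship_codimZero`: with codimension parameter `0` in place of `1` the crux holds
  trivially on every `Σ` — together with §3 this brackets where the content enters.
* §9 (cycle 2) `boost_mem_lorentzGroup`, `exists_lorentz_ball_disjoint_translate`: boosts of the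
  `(x⁰, x³)`-plane lie in `lorentzGroup`, and for every `ℓ, r₀ > 0` some boost `Λ` has
  `Λ w − Λ w' ≠ ℓ e₃` for all `w, w' ∈ B(0, r₀)` — the linear-algebra core of the BOOST-BLINDNESS of the
  tameness clause (iv) (read-back for K2's provers as much as for K3's: "bounded geometry at a uniform
  scale" as typed does not see short spacelike circles or null curvature; see R1 below).
* §5 near-miss (sorried, documented): `trivialData_mem_tameSet` — even the base point of the model,
  Minkowski data, cannot presently be shown non-exceptional (needs maximality/uniqueness of the MGHD of
  trivial data and null geodesic completeness bookkeeping over `IsMaximal`); this is why no "tightness"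
  instance of the crux is available either way.
* §10 (cycle 3) ENDPOINT-JUNK RE-AUDIT OF THE CRUX ITSELF, prompted by the drefuter's discovery
  (`DrefuteCrushJunk.lean`, `DrefuteStubCrush.md`, `DrefuteStubNullTerminality.md`: the vendored
  `LorentzianMetric.futureCauchyDevelopment` of a CLOSED set is the set itself, because the vendored
  `IsPastInextendible` counts every curve on a parameter set unbounded below as inextendible).
  `isPastInextendible_Iic` / `isFutureInextendible_Ici` (the one-line core of the defect: EVERY curve on a
  half-line is vendored-inextendible) versus `not_isPastEndless_const` (the faithful notion rejects a
  constant curve). VERDICT: `TameCensorship` (and K2) are IMMUNE — the crux's closure uses only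
  reparametrisation-proof notions: `IsCauchyHypersurface` (faithful, endless curves) inside
  `CauchyDevelopment`; `IsNormalisedNullRayFrom` = `IsMaximalGeodesicOn` (affine parameter, maximal open
  interval) with completeness `¬ BddAbove dom` and `sojournTime` (a Lebesgue measure) inside
  `HasCompleteNullInfinity` and `outer`; `causalFuture` / `chronologicalPast` (existence of SOME connecting
  curve — invariant under reparametrisation); `IsLateChart` / `truncDeviationCk` / `supCkENorm` (`ℝ≥0∞`
  suprema, `⊤` when unbounded); `IsMaximal` = `EmbedsInto`. Neither `futureCauchyDevelopment`,
  `IsPastInextendible`, `IsFutureInextendible` nor the old `IsCauchySurface` occurs. The defect was confined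
  to the line's `IsCrushable` / `NullTerminality`, repaired by the lead the same day with the faithful
  `futureDomainOfDependence` (past-ENDLESS curves).
* §11 (cycle 3) `-- Targets`: the seven REGISTERED stubs of the lead's reshaped skeleton
  (`Lines/crush-the-swallowed-interior.lean`, def-free, `D⁺` repaired) from the disprover's side —
  status table in the §11 docblock; checked content: §11a `exists_boostedKerr_killing_timelike` (with the
  exact axis formula `kerrBilin_e0_e0_axisPt : g_{M,a}(∂_t,∂_t)(t,0,0,R) = −(R² − 2MR + a²)/(R² + a²)` and
  `kerrBilin_e0_e0_axisPt_neg` for `R > max r₊ 0`): the timelike-Killing hypothesis of stubs O / P / R is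
  satisfiable in EVERY boosted Kerr–Schild exterior (all `Λ, c, M, a`) — in particular stub P keeps content
  at `E = ∅` (`stubP_exactness_empty`: its three exactness hypotheses hold vacuously there, so P ⊇ "a
  timelike-Killing point exists", discharged here for P's intended polar points); §11b `fdod` (= the lead's
  faithful `futureDomainOfDependence`, verbatim) with `subset_fdod`, `fdod_mono`,
  `fdod_subset_causalFuture` (`D⁺(S) ⊆ J⁺(S)`, via the tree's `exists_isEndlessTimelikeCurve_through`) and
  `fdod_empty` (`D⁺(∅) = ∅`: the REPAIRED N′ / C′ carry no junk at the empty hypersurface — the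
  degenerate-instance attack that voided the vendored versions now fails honestly), `causalFuture_empty'`,
  `chronologicalFuture_empty'` (`K = ∅`: (C1), (C2), R1a, R1b contentless there); §11c the LOAD-BEARING
  HYPOTHESIS of N′ and of Hawking's bound H: UNIFORM contraction — KERNEL-CHECKED (companion workfile
  `Cruxes/TameCensorship/NullTerminalityUniformity.lean`, ~950 lines, rc 0, 0 sorry, axioms
  propext/Classical.choice/Quot.sound; landing proposed as
  `Theorems/TameCensorship/Negative/NullTerminalityNeedsUniformity.lean`):
  `Uniformity.not_nullTerminalityPointwiseAnyDev` (UNCONDITIONAL: N′ with `∃ ε > 0, H ≤ −ε` weakened to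
  `H < 0` pointwise and ranging over ALL vacuum Cauchy developments is false) and
  `Uniformity.not_nullTerminalityPointwise_of_isMaximal` (the verbatim registered text of
  `stub_nullTerminality` with only the ε-clause weakened — statement diff checked mechanically — is false
  modulo maximality of the Minkowski development, the tree's MGHD gap of §5). Witness, all computed from the
  tree's own definitions: the entire graph `S″ = {x⁰ = −log(1 + e^{x¹})}` of Minkowski space — closed,
  achronal, a smooth spacelike immersion with future unit normal `ν = (1 − u'²)^{−1/2}(e₀ + u'e₁)`, mean
  curvature `H = u''/(1 − u'²)^{3/2} < 0` EVERYWHERE (`meanCurvature_fGraph`, from `secondFundamentalForm`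
  via the frame formula read in the flat development) but `→ 0⁻` as `x¹ → −∞` — whose faithful `D⁺`
  contains `{u(x¹) ≤ x⁰, x⁰ + x¹ < 0}` (`regionW_subset_fdod_graph`: past-endless causal curves have
  `t → −∞` and unit speed), hence the future half of the complete null LINE `(0,−1,0,0) + t(e₀ − e₁)`, a
  maximal geodesic on `ℝ`. ANY proof of N′ must use `ε > 0` quantitatively.

## Junk hunt (cycles 1–2; all negative — recorded so nobody repeats it)

`HasLeviCivita` is a `Fact` proved outright (`PseudoRiemannianMetric.hasLeviCivita`), so the
`∀ [HasLeviCivita]` clauses are not vacuous; `LorentzianManifold` demands `T2Space`,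
`SecondCountableTopology`, `ConnectedSpace`, and `TimeOrientation` is a `C^∞` timelike vector FIELD
(`LorentzianMetric.lean`), so neither non-Hausdorff / disconnected carriers nor locally time-flipped
copies of a development can spoil `IsMaximal` (a flipped copy is not a `Spacetime`);
`IsCauchyHypersurface` / `HasFutureEndpoint` / `IsFutureEndless` are the faithful endless-curve notions
(Minkowski slice proved Cauchy in the tree) and `IsMaximalGeodesicOn` asks for an open order-connected
domain maximal among geodesic extensions (`Geodesic.lean`), so `¬ BddAbove dom` is honest future
completeness; `TimeOrientation.IsFutureDirected v` needs `g(T, v) < 0`, and the normalisation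
`g(γ' 0, N) = -1` excludes degenerate rays, so `outer` and the sojourn form of complete `𝓘⁺` carry no
degenerate witnesses; `deviation` / `truncDeviationCk` are chart-INDEPENDENT numbers
`g(dΨ v, dΨ w) − g₀(v, w)` differentiated on the single flat chart of `Opens E4`, and `truncDeviationCk`
takes full `4`-dimensional `iteratedFDeriv`s at slab points, so the no-extremal-remnant clause is a
genuine curvature statement (flat or sub-extremal regions cannot fake an extremal Kerr near zone in
`C²`); the boosted extremal background has domain `{Λ⁻¹(x − c) ∈ Kerr.exterior M M}` with nonempty late
regions and slabs for every `τ` (no empty-`iSup` escape); for `Minkowski.backgroundOn (ball 0 r₀)` the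
late region after `-r₀` is the whole ball, so the tameness charts are honest coordinate balls;
`admissibleVacuumData` asks `IsSoleEnd` (compact complement of a far region) and completeness, which
EXCLUDE the one obvious non-tame candidate, extremal-Kerr throat data (one AF end + one infinite
cylindrical end), from `𝓓` — the exceptional set, if nonempty, consists of data whose non-tameness is a
statement about their MGHD, undecidable here (§5). In the other direction nothing makes the crux cheap:
`𝓓(ℝ³)` is a genuine infinite-dimensional class (not a point), and the property is not implied by
admissibility.

## R1 / R2: the two over-readings found by the ideation–triage round, assessed by the disprover

The crux as typed is STRONGER than what the assembly `closes` consumes (clause (iii) is applied there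
only to late charts into `exteriorOf ⊆ J⁺(ιΣ)`, clause (iv) only on the visible exterior):
* R2 (past): clause (iii) ranges over `Λ = T` (§6b), i.e. it also states a third law towards the PAST of
  the two-sided MGHD. Not a refutation handle: data time-reversal `(h, k) ↦ (h, −k)` preserves the
  admissible class and smooth injective families, so the past clause ALONE is exactly as generic as the
  future third law; what is at stake is only the CONJUNCTION future ∧ past (§4: not free), and a trap
  (§2b) would need whole level sets of a curve-continuous observable to consist of data forming extremal
  horizons — nothing of the kind is suggested by the Kehle–Unger codimension-one picture.
* R1 (hidden sectors): on `X = Y # ℝ³` (admissible: one AF end, the topology sits in a compact core) the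
  clauses read the hidden development of the `Y`-side: complete hidden null rays from `Σ` put the
  chronological past of an eternally expanding baby universe into `outer`, so (iv) demands bounded `C³`
  geometry at one uniform coordinate scale `r₀` along it forever, and (iii) forbids extremal remnants
  inside it. Thus K3 CONTAINS statements about generic vacuum cosmologies carrying a black hole —
  conjectured nowhere in print. But the disprover finds no refutation along R1 either, for a structural
  reason made precise in §9 (`exists_lorentz_ball_disjoint_translate`): clause (iv) is BOOST-BLIND — it
  asks at each point separately for SOME chart from the `r₀`-ball with `Ψ^* g` close to `η`, and exact
  `η`-isometries compose with such charts, so highly boosted "pancake" charts evade arbitrarily short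
  closed spacelike circles (§9: a Lorentz image of `B(0, r₀)` avoids its own translate by `ℓ e₃` for every
  `ℓ > 0`) and, boosting along the wave vector, hide null curvature of any strength (pp-waves). Hence the
  natural hidden-sector "pathology", Kasner-like expansion with a contracting circle direction (every
  non-flat Kasner exponent triple has a negative entry), does NOT violate (iv) at late times: curvature
  decays like `t⁻²`, and the rapidity needed to dodge the circle of length `L t^{p}` (`p < 0`) stretches
  the chart only to null extent `~ r₀² t^{|p|} / L ≪ t` (since `|p| < 1`), inside which the metric is
  `C³`-flat up to `O(t^{2|p|-2}) → 0`. Violating (iv) needs a frame-INDEPENDENT blow-up at scale `r₀`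
  along `outer` (curvature invariants → ∞, or the MGHD boundary within uniform reach in every frame), and
  eternal expansion gives decay instead; imprisoned hidden regions (Taub–NUT-like Cauchy horizons) carry no
  complete rays (totally imprisoned incompleteness) and are invisible to `outer`. What survives of R1 is its
  (iii)-part — no extremal black hole inside a generic baby universe — which is the third law again, for
  the same local dynamics. A refutation along R1 would need an OPEN set of hidden-sector data with a
  frame-independent pathology along complete rays (then every smooth family through the datum stays bad
  for small `c ≠ 0`: joint smoothness forces `C^∞`-convergence on the compact hidden part, which is
  causally isolated from the AF region once the neck traps); no candidate is known. [Literature check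
  DEGRADED this cycle: `lit search` rc 75 (searchd unavailable) — the expanding-direction asymptotics of
  `T³`-Gowdy (Ringström, CPAM 57 (2004)) and of Bianchi A vacuum models were to be page-cited here; from
  memory: radiation-dominated, no collapsing direction generically — NOT verified this session.]
* Recommendation (concurring with ideator 1 / triage r1): restate (iii) with charts into
  `causalFuture (range embed)` and (iv) with rays in causal contact with the AF end. The restated K3′ is
  implied by K3 and is all that `closes` uses; the disprover has nothing against K3′ beyond "open problem".

## Literature (cycle 1; unchanged)

The non-generic third law is FALSE (extremal horizons form in finite time: Kehle–Unger,
arXiv:2211.15742 / JEMS 2025; vacuum extremal Kerr formation conjectured, arXiv:2402.10190), its generic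
version is the conjectural codimension-one picture (Dafermos 2025 survey, §6; Angelopoulos–Kehle–Unger
arXiv:2410.16234 in spherical symmetry); naked singularities exist in vacuum (Rodnianski–Shlapentokh-Rothman,
Ann. Math. 198 (2023)) and their instability is open outside symmetry — none of this is formalisable as a
counterexample to a GENERIC statement.
-/

set_option linter.dupNamespace false

noncomputable section

open Bundle TopologicalSpace Manifold Set
open scoped ContDiff Topology InnerProductSpace RealInnerProductSpace

namespace Summit.FinalStateConjecture.FinalStateConjecture.Cruxes.TameCensorship.Disproof

open Literature.Geometry.Lorentzian
open Summit.FinalStateConjecture.FinalStateConjecture.Theses.PhotonSphereChannels (TameCensorship)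

/-! ## §1 Read-back: the tame property as a set of data, and the crux unfolded -/

/-- The property bundled by `TameCensorship`, verbatim, as a set of initial data sets on `X`:
an MGHD exists, and every MGHD has complete `𝓘⁺` (sojourn form), no extremal-Kerr remnant (no late
chart from a boosted extremal Kerr exterior with truncated `C²` deviation `→ 0` for every `R`) and
bounded `C³` geometry of the outer region `J⁺(Σ) ∩ ⋃ I⁻(future-complete normalised null rays)` at a
uniform coordinate scale `r₀` (`C⁰` deviation `≤ 1/2`, `C³` deviation `≤ Λ`). -/
def tameSet (X : Type) [TopologicalSpace X] [ChartedSpace E3 X]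
    [IsManifold (modelWithCornersSelf ℝ E3) ((⊤ : ℕ∞) : WithTop ℕ∞) X] [ConnectedSpace X] :
    Set (InitialDataSet (modelWithCornersSelf ℝ E3) X) :=
  {D | (∃ 𝒟 : VacuumCauchyDevelopment D, 𝒟.IsMaximal) ∧
    ∀ 𝒟 : VacuumCauchyDevelopment D, 𝒟.IsMaximal →
      _root_.Summit.FinalStateConjecture.HasCompleteNullInfinity 𝒟.toCauchyDevelopment ∧
      ((∀ (Λ : lorentzGroup) (c : E4) (M a : ℝ), Kerr.IsExtremal M a →
        ¬ ∃ (τ₀ : ℝ) (Ψ : (boostedKerrBackground Λ c M a).domain → 𝒟.carrier),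
          𝒟.toSpacetime.IsLateChart (boostedKerrBackground Λ c M a) Set.univ τ₀ Ψ ∧
          ∀ R : ℝ, Filter.Tendsto
            (fun τ => 𝒟.toSpacetime.truncDeviationCk (boostedKerrBackground Λ c M a) Ψ 2 R τ)
            Filter.atTop (nhds 0)) ∧
      ∀ [𝒟.metric.HasLeviCivita],
        let outer : Set 𝒟.carrier :=
          𝒟.metric.causalFuture 𝒟.timeOrientation (Set.range 𝒟.embed) ∩
            {q | ∃ (p : X) (γ : ℝ → 𝒟.carrier) (dom : Set ℝ),
              𝒟.metric.IsNormalisedNullRayFrom 𝒟.timeOrientation 𝒟.embed 𝒟.normal p γ dom ∧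
              ¬ BddAbove dom ∧
              q ∈ 𝒟.metric.chronologicalPast 𝒟.timeOrientation (γ '' (dom ∩ Set.Ici 0))}
        ∃ r₀ : ℝ, 0 < r₀ ∧ ∃ Λ : NNReal, ∀ q ∈ outer,
          let U : TopologicalSpace.Opens E4 := ⟨Metric.ball (0 : E4) r₀, Metric.isOpen_ball⟩
          ∃ Ψ : U → 𝒟.carrier,
            𝒟.toSpacetime.IsLateChart (Minkowski.backgroundOn U) Set.univ (-r₀) Ψ ∧
            (∃ x : U, (x : E4) = 0 ∧ Ψ x = q) ∧
            supCkENorm (U : Set E4) 3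
              (𝒟.toSpacetime.deviationExtend (Minkowski.backgroundOn U) Ψ) ≤ (Λ : ENNReal) ∧
            supCkENorm (U : Set E4) 0
              (𝒟.toSpacetime.deviationExtend (Minkowski.backgroundOn U) Ψ) ≤ 1 / 2)}

/-- **Read-back of the RE-TYPED crux (rev ≥ 15, stmt-17431; cycle 4).** `TameCensorship` is, for every
connected Hausdorff second countable `3`-manifold `Σ`, TAME Christodoulou-genericity (codimension `≥ 1`,
curve form, relative to the admissible class, witness curve tame on ONE fixed end and immersed at `0`)
of membership in `tameSet Σ` — the bundled property is byte-identical to the old body's. By `Iff.rfl`: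
the statement is typed as intended (no coercion or junk operator intervenes). -/
theorem tameCensorship_iff :
    TameCensorship ↔ ∀ (X : Type) [TopologicalSpace X] [ChartedSpace E3 X]
      [IsManifold (modelWithCornersSelf ℝ E3) ((⊤ : ℕ∞) : WithTop ℕ∞) X] [T2Space X]
      [SecondCountableTopology X] [ConnectedSpace X],
      InitialDataSet.IsTameChristodoulouGeneric (admissibleVacuumData X) (· ∈ tameSet X) 1 :=
  Iff.rfl

/-- **The re-typed crux implies the old (rev ≤ 14, stmt-10047) topology-free body** (tame ⇒
topology-free genericity, `IsTameChristodoulouGeneric.isChristodoulouGeneric`): every negative-side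
lemma of cycles 1–3 about the old body transfers to the new one by contraposition. The converse is NOT
available (burial families are not tame). -/
theorem tameCensorship_imp_topologyFree (h : TameCensorship) (X : Type) [TopologicalSpace X]
    [ChartedSpace E3 X] [IsManifold (modelWithCornersSelf ℝ E3) ((⊤ : ℕ∞) : WithTop ℕ∞) X] [T2Space X]
    [SecondCountableTopology X] [ConnectedSpace X] :
    InitialDataSet.IsChristodoulouGeneric (admissibleVacuumData X) (· ∈ tameSet X) 1 :=
  (tameCensorship_iff.1 h X).isChristodoulouGeneric

/-! ## §2 Transparency of curve-genericity: what a proof and what a refutation must do -/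

section Transparency

variable {E : Type*} [NormedAddCommGroup E] [NormedSpace ℝ E] {H : Type*} [TopologicalSpace H]
  {I : ModelWithCorners ℝ E H} {X : Type*} [TopologicalSpace X] [ChartedSpace H X]
  [IsManifold I ∞ X]

/-- A nonzero parameter exists in `ℝ¹`. -/
theorem euclideanSpace_one_exists_ne_zero : ∃ c : EuclideanSpace ℝ (Fin 1), c ≠ 0 :=
  ⟨EuclideanSpace.single 0 1, fun h ↦ by simpa using congrArg (fun c : EuclideanSpace ℝ (Fin 1) ↦ c 0) h⟩

/-- **What a refutation amounts to.** If the property fails on ALL of a nonempty admissible class,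
it is not Christodoulou-generic: every admissible curve through an exceptional datum consists of
exceptional data. (Dual of the tree's `isChristodoulouGeneric_of_forall`.) -/
theorem not_isChristodoulouGeneric_of_forall_not {𝓓 : Set (InitialDataSet I X)}
    {P : InitialDataSet I X → Prop} (hne : 𝓓.Nonempty) (hP : ∀ d ∈ 𝓓, ¬ P d) (m : ℕ)
    (hm : m ≠ 0) : ¬ InitialDataSet.IsChristodoulouGeneric 𝓓 P m := by
  intro h
  obtain ⟨d, hd⟩ := hne
  obtain ⟨F, -, -, -, hadm, hexc⟩ := h d ⟨hd, hP d hd⟩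
  have : ∃ c : EuclideanSpace ℝ (Fin m), c ≠ 0 := by
    obtain ⟨i⟩ : Nonempty (Fin m) := ⟨⟨0, Nat.pos_of_ne_zero hm⟩⟩
    exact ⟨EuclideanSpace.single i 1, fun h ↦ by
      simpa using congrArg (fun c : EuclideanSpace ℝ (Fin m) ↦ c i) h⟩
  obtain ⟨c, hc⟩ := this
  exact hexc c hc ⟨hadm c, hP _ (hadm c)⟩

/-- **What a proof yields at least.** A Christodoulou-generic property (codimension `m ≥ 1`) on a
nonempty admissible class holds for SOME admissible datum. -/
theorem exists_of_isChristodoulouGeneric {𝓓 : Set (InitialDataSet I X)}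
    {P : InitialDataSet I X → Prop} {m : ℕ} (hm : m ≠ 0)
    (h : InitialDataSet.IsChristodoulouGeneric 𝓓 P m) (hne : 𝓓.Nonempty) : ∃ d ∈ 𝓓, P d := by
  by_contra hno
  push Not at hno
  exact not_isChristodoulouGeneric_of_forall_not hne hno m hm h


/-! ## §2b The scale and the normal form of Christodoulou-genericity (cycle 2)

Four structural facts about `HasCodimAtLeastIn 𝓓 𝓔 m` (all elementary, all used below or by the
provers): codimension `0` is no condition; the scale is monotone in `m`; a LOCAL escape (family
injective / admissible / good only for parameters in a small ball, jointly smooth only there)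
already gives the global family of the definition (squash reparametrisation of `ℝᵐ` onto the ball)
— this is the honest normal form of what a proof of the crux must construct through each
exceptional datum; and the abstract LEVEL-SET TRAP — the exact shape of obstruction a refutation
must exhibit: a curve-continuous observable `f` with `f(d) = 0` whose admissible zero set and whose
admissible level sets `{|f| = ρ}` for arbitrarily small `ρ > 0` are entirely exceptional; then the
exceptional set has codimension `0` (fails `HasCodimAtLeastIn … m` for every `m ≥ 1`). -/

/-! ### Codimension `0` is no condition -/

/-- In Christodoulou's scale, codimension `≥ 0` inside `𝓓` is exactly the inclusion `𝓔 ⊆ 𝓓`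
(the constant `0`-parameter family through `d`). -/
theorem hasCodimAtLeastIn_zero_iff (𝓓 𝓔 : Set (InitialDataSet I X)) :
    InitialDataSet.HasCodimAtLeastIn 𝓓 𝓔 0 ↔ 𝓔 ⊆ 𝓓 := by
  refine ⟨InitialDataSet.HasCodimAtLeastIn.subset, fun h d hd ↦ ?_⟩
  refine ⟨fun _ ↦ d, InitialDataSet.isSmoothDataFamily_const 0 d, rfl, ?_, fun _ ↦ h hd, ?_⟩
  · intro a b _
    exact Subsingleton.elim a b
  · intro c hc
    exact absurd (Subsingleton.elim c 0) hc

/-- With codimension parameter `0` EVERY property is Christodoulou-generic. -/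
theorem isChristodoulouGeneric_zero (𝓓 : Set (InitialDataSet I X)) (P : InitialDataSet I X → Prop) :
    InitialDataSet.IsChristodoulouGeneric 𝓓 P 0 :=
  (hasCodimAtLeastIn_zero_iff 𝓓 _).2 fun _ hd ↦ hd.1

/-! ### Monotonicity of the scale: codimension `≥ m + 1` implies codimension `≥ m` -/

/-- The coordinate inclusion `ℝᵐ ↪ ℝᵐ⁺¹`, `c ↦ (c, 0)`. -/
def padZero (m : ℕ) (c : EuclideanSpace ℝ (Fin m)) : EuclideanSpace ℝ (Fin (m + 1)) :=
  ∑ i : Fin m, c i • EuclideanSpace.single (Fin.castSucc i) (1 : ℝ)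

theorem padZero_apply_castSucc (m : ℕ) (c : EuclideanSpace ℝ (Fin m)) (j : Fin m) :
    padZero m c (Fin.castSucc j) = c j := by
  simp [padZero, Finset.sum_apply, Pi.single_apply, Fin.castSucc_inj, mul_ite]

theorem padZero_injective (m : ℕ) : Function.Injective (padZero m) := by
  intro c c' h
  ext j
  have := congrArg (fun v ↦ v (Fin.castSucc j)) h
  simpa [padZero_apply_castSucc] using this

theorem padZero_zero (m : ℕ) : padZero m 0 = 0 := by
  simp [padZero]

theorem contDiff_padZero (m : ℕ) : ContDiff ℝ ∞ (padZero m) := by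
  unfold padZero
  refine ContDiff.sum fun i _ ↦ ?_
  have h0 : ContDiff ℝ ∞ (fun c : EuclideanSpace ℝ (Fin m) ↦ c i) :=
    contDiff_piLp_apply (p := 2) (i := i)
  exact h0.smul contDiff_const

/-- **Christodoulou's scale is monotone**: an exceptional set of codimension `≥ m + 1` has
codimension `≥ m` (restrict the `(m+1)`-parameter family to the coordinate subspace `ℝᵐ`). -/
theorem HasCodimAtLeastIn.of_succ {𝓓 𝓔 : Set (InitialDataSet I X)} {m : ℕ}
    (h : InitialDataSet.HasCodimAtLeastIn 𝓓 𝓔 (m + 1)) :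
    InitialDataSet.HasCodimAtLeastIn 𝓓 𝓔 m := by
  intro d hd
  obtain ⟨F, hF, h0, hinj, hadm, hexc⟩ := h d hd
  have hsm : ContMDiff (𝓘(ℝ, EuclideanSpace ℝ (Fin m)).prod I)
      (𝓘(ℝ, EuclideanSpace ℝ (Fin (m + 1))).prod I) ∞
      (fun p : EuclideanSpace ℝ (Fin m) × X ↦ (padZero m p.1, p.2)) :=
    ((contDiff_padZero m).contMDiff.comp contMDiff_fst).prodMk contMDiff_snd
  refine ⟨F ∘ padZero m, ⟨hF.1.comp hsm, hF.2.comp hsm⟩, ?_, hinj.comp (padZero_injective m),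
    fun c ↦ hadm _, fun c hc ↦ hexc _ ?_⟩
  · simp [padZero_zero, h0]
  · intro h'
    exact hc (padZero_injective m (by rw [h', padZero_zero]))

/-- Iterated monotonicity: codimension `≥ n` implies codimension `≥ m` for `m ≤ n`. -/
theorem HasCodimAtLeastIn.mono_codim {𝓓 𝓔 : Set (InitialDataSet I X)} {m n : ℕ} (hmn : m ≤ n)
    (h : InitialDataSet.HasCodimAtLeastIn 𝓓 𝓔 n) : InitialDataSet.HasCodimAtLeastIn 𝓓 𝓔 m := by
  obtain ⟨k, rfl⟩ := Nat.exists_eq_add_of_le hmn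
  induction k with
  | zero => exact h
  | succ k ih => exact ih (Nat.le_add_right m k) (HasCodimAtLeastIn.of_succ h)

/-! ### Local escape suffices: the normal form of a codimension-`m` escape -/

/-- The squash diffeomorphism `ℝᵐ → B(0, δ)`, `c ↦ δ c / √(1 + ‖c‖²)`. -/
def squash (m : ℕ) (δ : ℝ) (c : EuclideanSpace ℝ (Fin m)) : EuclideanSpace ℝ (Fin m) :=
  (δ / Real.sqrt (1 + ‖c‖ ^ 2)) • c

theorem one_add_norm_sq_pos {m : ℕ} (c : EuclideanSpace ℝ (Fin m)) : 0 < 1 + ‖c‖ ^ 2 := by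
  positivity

theorem squash_zero (m : ℕ) (δ : ℝ) : squash m δ 0 = 0 := by simp [squash]

theorem norm_squash_lt {m : ℕ} {δ : ℝ} (hδ : 0 < δ) (c : EuclideanSpace ℝ (Fin m)) :
    ‖squash m δ c‖ < δ := by
  have hs : 0 < Real.sqrt (1 + ‖c‖ ^ 2) := Real.sqrt_pos.2 (one_add_norm_sq_pos c)
  have hlt : ‖c‖ < Real.sqrt (1 + ‖c‖ ^ 2) := by
    rw [Real.lt_sqrt (norm_nonneg _)]
    linarith
  rw [squash, norm_smul, Real.norm_eq_abs, abs_of_pos (div_pos hδ hs), div_mul_eq_mul_div,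
    div_lt_iff₀ hs]
  exact mul_lt_mul_of_pos_left hlt hδ

theorem squash_eq_zero_iff {m : ℕ} {δ : ℝ} (hδ : 0 < δ) (c : EuclideanSpace ℝ (Fin m)) :
    squash m δ c = 0 ↔ c = 0 := by
  have hs : 0 < Real.sqrt (1 + ‖c‖ ^ 2) := Real.sqrt_pos.2 (one_add_norm_sq_pos c)
  rw [squash, smul_eq_zero, or_iff_right]
  exact (div_pos hδ hs).ne'

theorem squash_injective {m : ℕ} {δ : ℝ} (hδ : 0 < δ) : Function.Injective (squash m δ) := by
  intro c c' h
  have hs : 0 < Real.sqrt (1 + ‖c‖ ^ 2) := Real.sqrt_pos.2 (one_add_norm_sq_pos c)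
  have hs' : 0 < Real.sqrt (1 + ‖c'‖ ^ 2) := Real.sqrt_pos.2 (one_add_norm_sq_pos c')
  -- compare norms
  have hn := congrArg (fun v ↦ ‖v‖ ^ 2) h
  simp only [squash, norm_smul, Real.norm_eq_abs, abs_of_pos (div_pos hδ hs),
    abs_of_pos (div_pos hδ hs'), mul_pow, div_pow, Real.sq_sqrt (one_add_norm_sq_pos c).le,
    Real.sq_sqrt (one_add_norm_sq_pos c').le] at hn
  have hnorm : ‖c‖ ^ 2 = ‖c'‖ ^ 2 := by
    have hδ2 : (0 : ℝ) < δ ^ 2 := by positivity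
    field_simp at hn
    nlinarith [hn, norm_nonneg c, norm_nonneg c', hδ2]
  have hcoef : δ / Real.sqrt (1 + ‖c‖ ^ 2) = δ / Real.sqrt (1 + ‖c'‖ ^ 2) := by rw [hnorm]
  rw [squash, squash, hcoef] at h
  exact smul_right_injective _ (div_pos hδ hs').ne' h

theorem contDiff_squash (m : ℕ) (δ : ℝ) : ContDiff ℝ ∞ (squash m δ) := by
  have h1 : ContDiff ℝ ∞ (fun c : EuclideanSpace ℝ (Fin m) ↦ 1 + ‖c‖ ^ 2) :=
    contDiff_const.add (contDiff_norm_sq ℝ)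
  have h2 : ContDiff ℝ ∞ (fun c : EuclideanSpace ℝ (Fin m) ↦ Real.sqrt (1 + ‖c‖ ^ 2)) :=
    h1.sqrt fun c ↦ (one_add_norm_sq_pos c).ne'
  have h3 : ContDiff ℝ ∞ (fun c : EuclideanSpace ℝ (Fin m) ↦ δ / Real.sqrt (1 + ‖c‖ ^ 2)) :=
    contDiff_const.div h2 fun c ↦ (Real.sqrt_pos.2 (one_add_norm_sq_pos c)).ne'
  exact h3.smul contDiff_id

/-- Precomposing a family that is jointly smooth for parameters in the ball `B(0, δ)` with the
squash map gives a globally smooth family (`IsSmoothDataFamily`). -/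
theorem isSmoothDataFamily_comp_squash {m : ℕ} {δ : ℝ} (hδ : 0 < δ)
    {F : EuclideanSpace ℝ (Fin m) → InitialDataSet I X}
    (hh : ContMDiffOn (𝓘(ℝ, EuclideanSpace ℝ (Fin m)).prod I) (I.prod 𝓘(ℝ, E →L[ℝ] E →L[ℝ] ℝ)) ∞
      (fun p : EuclideanSpace ℝ (Fin m) × X ↦
        TotalSpace.mk' (F := E →L[ℝ] E →L[ℝ] ℝ)
          (E := fun x : X ↦ TangentSpace I x →L[ℝ] TangentSpace I x →L[ℝ] ℝ) p.2
          ((F p.1).h.inner p.2)) (Metric.ball 0 δ ×ˢ univ))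
    (hk : ContMDiffOn (𝓘(ℝ, EuclideanSpace ℝ (Fin m)).prod I) (I.prod 𝓘(ℝ, E →L[ℝ] E →L[ℝ] ℝ)) ∞
      (fun p : EuclideanSpace ℝ (Fin m) × X ↦
        TotalSpace.mk' (F := E →L[ℝ] E →L[ℝ] ℝ)
          (E := fun x : X ↦ TangentSpace I x →L[ℝ] TangentSpace I x →L[ℝ] ℝ) p.2 ((F p.1).k p.2))
      (Metric.ball 0 δ ×ˢ univ)) :
    InitialDataSet.IsSmoothDataFamily m (F ∘ squash m δ) := by
  have hsm : ContMDiff (𝓘(ℝ, EuclideanSpace ℝ (Fin m)).prod I)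
      (𝓘(ℝ, EuclideanSpace ℝ (Fin m)).prod I) ∞
      (fun p : EuclideanSpace ℝ (Fin m) × X ↦ (squash m δ p.1, p.2)) :=
    ((contDiff_squash m δ).contMDiff.comp contMDiff_fst).prodMk contMDiff_snd
  have hmaps : ∀ p : EuclideanSpace ℝ (Fin m) × X,
      (squash m δ p.1, p.2) ∈ (Metric.ball (0 : EuclideanSpace ℝ (Fin m)) δ) ×ˢ (univ : Set X) :=
    fun p ↦ ⟨by simpa using norm_squash_lt hδ p.1, trivial⟩
  exact ⟨hh.comp_contMDiff hsm hmaps, hk.comp_contMDiff hsm hmaps⟩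

/-- **Local escape suffices (normal form of Christodoulou-genericity).** To show that `𝓔` has
codimension `≥ m` in `𝓓` it is enough to find, through every `d ∈ 𝓔`, a family which is jointly
smooth, injective, admissible and non-exceptional merely for parameters in some ball `B(0, δ)`
(joint smoothness being asked only on `B(0, δ) × X`); the global family demanded by
`HasCodimAtLeastIn` is obtained by the squash reparametrisation `c ↦ δ c / √(1 + ‖c‖²)` of `ℝᵐ`
onto the ball. Conversely a global escape restricts to a local one, so this is an equivalent
formulation of `HasCodimAtLeastIn`. -/
theorem hasCodimAtLeastIn_of_local {𝓓 𝓔 : Set (InitialDataSet I X)} {m : ℕ}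
    (h : ∀ d ∈ 𝓔, ∃ (F : EuclideanSpace ℝ (Fin m) → InitialDataSet I X) (δ : ℝ), 0 < δ ∧
      ContMDiffOn (𝓘(ℝ, EuclideanSpace ℝ (Fin m)).prod I) (I.prod 𝓘(ℝ, E →L[ℝ] E →L[ℝ] ℝ)) ∞
        (fun p : EuclideanSpace ℝ (Fin m) × X ↦
          TotalSpace.mk' (F := E →L[ℝ] E →L[ℝ] ℝ)
            (E := fun x : X ↦ TangentSpace I x →L[ℝ] TangentSpace I x →L[ℝ] ℝ) p.2
            ((F p.1).h.inner p.2)) (Metric.ball 0 δ ×ˢ univ) ∧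
      ContMDiffOn (𝓘(ℝ, EuclideanSpace ℝ (Fin m)).prod I) (I.prod 𝓘(ℝ, E →L[ℝ] E →L[ℝ] ℝ)) ∞
        (fun p : EuclideanSpace ℝ (Fin m) × X ↦
          TotalSpace.mk' (F := E →L[ℝ] E →L[ℝ] ℝ)
            (E := fun x : X ↦ TangentSpace I x →L[ℝ] TangentSpace I x →L[ℝ] ℝ) p.2 ((F p.1).k p.2))
        (Metric.ball 0 δ ×ˢ univ) ∧
      F 0 = d ∧ Set.InjOn F (Metric.ball 0 δ) ∧
      (∀ c ∈ Metric.ball (0 : EuclideanSpace ℝ (Fin m)) δ, F c ∈ 𝓓) ∧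
      ∀ c ∈ Metric.ball (0 : EuclideanSpace ℝ (Fin m)) δ, c ≠ 0 → F c ∉ 𝓔) :
    InitialDataSet.HasCodimAtLeastIn 𝓓 𝓔 m := by
  intro d hd
  obtain ⟨F, δ, hδ, hh, hk, h0, hinj, hadm, hexc⟩ := h d hd
  have hball : ∀ c, squash m δ c ∈ Metric.ball (0 : EuclideanSpace ℝ (Fin m)) δ := fun c ↦ by
    simpa using norm_squash_lt hδ c
  refine ⟨F ∘ squash m δ, isSmoothDataFamily_comp_squash hδ hh hk, by simp [squash_zero, h0],
    fun c c' hcc' ↦ squash_injective hδ (hinj (hball c) (hball c') hcc'), fun c ↦ hadm _ (hball c),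
    fun c hc ↦ hexc _ (hball c) fun h' ↦ hc ((squash_eq_zero_iff hδ c).1 h')⟩

/-- **Local escape with a globally smooth family.** The frequent special case of
`hasCodimAtLeastIn_of_local` in which the family is already jointly smooth on all of `ℝᵐ × X`
(e.g. affine in the parameter) and only injectivity, admissibility and goodness are known near
`0`. -/
theorem hasCodimAtLeastIn_of_local' {𝓓 𝓔 : Set (InitialDataSet I X)} {m : ℕ}
    (h : ∀ d ∈ 𝓔, ∃ (F : EuclideanSpace ℝ (Fin m) → InitialDataSet I X) (δ : ℝ), 0 < δ ∧
      InitialDataSet.IsSmoothDataFamily m F ∧ F 0 = d ∧ Set.InjOn F (Metric.ball 0 δ) ∧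
      (∀ c ∈ Metric.ball (0 : EuclideanSpace ℝ (Fin m)) δ, F c ∈ 𝓓) ∧
      ∀ c ∈ Metric.ball (0 : EuclideanSpace ℝ (Fin m)) δ, c ≠ 0 → F c ∉ 𝓔) :
    InitialDataSet.HasCodimAtLeastIn 𝓓 𝓔 m := by
  refine hasCodimAtLeastIn_of_local fun d hd ↦ ?_
  obtain ⟨F, δ, hδ, hF, h0, hinj, hadm, hexc⟩ := h d hd
  exact ⟨F, δ, hδ, hF.1.contMDiffOn, hF.2.contMDiffOn, h0, hinj, hadm, hexc⟩

/-- The converse restriction: a global escape is in particular a local one (`δ = 1`), so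
`hasCodimAtLeastIn_of_local'` is an equivalent formulation. -/
theorem hasCodimAtLeastIn_iff_local {𝓓 𝓔 : Set (InitialDataSet I X)} {m : ℕ} :
    InitialDataSet.HasCodimAtLeastIn 𝓓 𝓔 m ↔
    ∀ d ∈ 𝓔, ∃ (F : EuclideanSpace ℝ (Fin m) → InitialDataSet I X) (δ : ℝ), 0 < δ ∧
      InitialDataSet.IsSmoothDataFamily m F ∧ F 0 = d ∧ Set.InjOn F (Metric.ball 0 δ) ∧
      (∀ c ∈ Metric.ball (0 : EuclideanSpace ℝ (Fin m)) δ, F c ∈ 𝓓) ∧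
      ∀ c ∈ Metric.ball (0 : EuclideanSpace ℝ (Fin m)) δ, c ≠ 0 → F c ∉ 𝓔 := by
  refine ⟨fun h d hd ↦ ?_, hasCodimAtLeastIn_of_local'⟩
  obtain ⟨F, hF, h0, hinj, hadm, hexc⟩ := h d hd
  exact ⟨F, 1, one_pos, hF, h0, hinj.injOn, fun c _ ↦ hadm c, fun c _ hc ↦ hexc c hc⟩

/-! ### The abstract level-set trap: what a refuter must exhibit -/

/-- **The level-set trap.** Let `f` be a curve-continuous observable (continuous along every smooth
parameter curve of every smooth `m`-parameter family), `d ∈ 𝓔` with `f d = 0`, and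
suppose the exceptional set `𝓔` contains the admissible zero set `{f = 0} ∩ 𝓓` and, for
arbitrarily small `ρ > 0`, the whole admissible level sets `{|f| = ρ} ∩ 𝓓`. Then `𝓔` has
codimension `0` in Christodoulou's scale: `HasCodimAtLeastIn 𝓓 𝓔 m` fails for EVERY `m ≥ 1`
(intermediate value theorem along the coordinate line of any candidate family). This is the exact
shape of obstruction a refutation of a curve-generic statement must produce. -/
theorem not_hasCodimAtLeastIn_of_trap {𝓓 𝓔 : Set (InitialDataSet I X)} {m : ℕ} (hm : m ≠ 0)
    {f : InitialDataSet I X → ℝ}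
    (hf : ∀ F : EuclideanSpace ℝ (Fin m) → InitialDataSet I X, InitialDataSet.IsSmoothDataFamily m F →
      ∀ γ : ℝ → EuclideanSpace ℝ (Fin m), ContMDiff 𝓘(ℝ, ℝ) 𝓘(ℝ, EuclideanSpace ℝ (Fin m)) ∞ γ →
        Continuous fun t ↦ f (F (γ t)))
    {d : InitialDataSet I X}
    (hd : d ∈ 𝓔) (hfd : f d = 0) (hzero : ∀ d' ∈ 𝓓, f d' = 0 → d' ∈ 𝓔)
    (hlevel : ∀ ε > 0, ∃ ρ, 0 < ρ ∧ ρ < ε ∧ ∀ d' ∈ 𝓓, |f d'| = ρ → d' ∈ 𝓔) :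
    ¬ InitialDataSet.HasCodimAtLeastIn 𝓓 𝓔 m := by
  intro h
  obtain ⟨F, hF, hF0, -, hadm, hexc⟩ := h d hd
  obtain ⟨i⟩ : Nonempty (Fin m) := ⟨⟨0, Nat.pos_of_ne_zero hm⟩⟩
  set e₁ : EuclideanSpace ℝ (Fin m) := EuclideanSpace.single i 1 with he₁
  set ι : ℝ → EuclideanSpace ℝ (Fin m) := fun t ↦ t • e₁ with hι
  have hιi : ∀ t, ι t i = t := fun t ↦ by simp [hι, he₁]
  have hιne : ∀ t ≠ 0, ι t ≠ 0 := fun t ht h ↦ ht (by rw [← hιi t, h]; rfl)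
  have hιz : ι 0 = 0 := by simp [hι]
  have hιs : ContMDiff 𝓘(ℝ, ℝ) 𝓘(ℝ, EuclideanSpace ℝ (Fin m)) ∞ ι :=
    (contDiff_id.smul contDiff_const).contMDiff
  set g : ℝ → ℝ := fun t ↦ |f (F (ι t))| with hg
  have hgc : Continuous g := (hf F hF ι hιs).abs
  have hg0 : g 0 = 0 := by simp [hg, hιz, hF0, hfd]
  have hg1 : g 1 ≠ 0 := by
    intro h1
    have h1' : f (F (ι 1)) = 0 := by simpa [hg] using h1
    exact hexc (ι 1) (hιne 1 one_ne_zero) (hzero _ (hadm _) h1')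
  have hg1pos : 0 < g 1 := lt_of_le_of_ne (abs_nonneg _) (Ne.symm hg1)
  obtain ⟨ρ, hρ, hρlt, hρlevel⟩ := hlevel (g 1) hg1pos
  obtain ⟨t, ht, hgt⟩ :=
    intermediate_value_Icc zero_le_one hgc.continuousOn ⟨by rw [hg0]; exact hρ.le, hρlt.le⟩
  have ht0 : t ≠ 0 := by
    rintro rfl
    rw [hg0] at hgt
    exact hρ.ne hgt
  exact hexc (ι t) (hιne t ht0) (hρlevel _ (hadm _) hgt)

end Transparency

/-- **The shape of `¬ TameCensorship`** (pure unfolding, RE-TYPED crux): some `Σ` and some admissible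
exceptional datum `D` on it such that every TAME (on some end), immersed, injective, admissible
one-parameter family through `D` contains another exceptional member. Compared with the old body the
universal quantifier now ranges over FEWER curves (tame ones), so `¬ TameCensorship` is formally EASIER
than before — but it still needs an exceptional datum, i.e. an MGHD in hand (§5). -/
theorem not_tameCensorship_iff :
    ¬ TameCensorship ↔ ∃ (X : Type) (_ : TopologicalSpace X) (_ : ChartedSpace E3 X)
      (_ : IsManifold (modelWithCornersSelf ℝ E3) ((⊤ : ℕ∞) : WithTop ℕ∞) X) (_ : T2Space X)
      (_ : SecondCountableTopology X) (_ : ConnectedSpace X),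
      ∃ D ∈ admissibleVacuumData X, D ∉ tameSet X ∧
        ∀ (e : AFEnd X) (F : EuclideanSpace ℝ (Fin 1) → InitialDataSet (modelWithCornersSelf ℝ E3) X),
          InitialDataSet.IsTameDataFamily e 1 F → InitialDataSet.IsImmersedAtZero 1 F → F 0 = D →
          Function.Injective F → (∀ c, F c ∈ admissibleVacuumData X) →
          ∃ c ≠ 0, F c ∉ tameSet X := by
  rw [tameCensorship_iff]
  constructor
  · intro h
    by_contra hcon
    apply h
    intro X _ _ _ _ _ _ D hD
    by_contra hF
    apply hcon
    refine ⟨X, ‹_›, ‹_›, ‹_›, ‹_›, ‹_›, ‹_›, D, hD.1, hD.2, fun e F h1 h1' h2 h3 h4 ↦ ?_⟩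
    by_contra hc
    push Not at hc
    exact hF ⟨e, F, h1, h1', h2, h3, h4, fun c hc0 hmem ↦ hmem.2 (hc c hc0)⟩
  · rintro ⟨X, _, _, _, _, _, _, D, hD, hnot, hall⟩ h
    obtain ⟨e, F, h1, h1', h2, h3, h4, h5⟩ := h X D ⟨hD, hnot⟩
    obtain ⟨c, hc, hcn⟩ := hall e F h1 h1' h2 h3 h4
    exact h5 c hc ⟨h4 c, hcn⟩

/-! ## §3 Non-vacuity of the admissible class on `ℝ³`, and the existential content of the crux -/

/-- **Non-vacuity of the crux's domain** (tree: `Literature.Geometry.Lorentzian.TrivialDataAdmissible`,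
`trivialData_mem_admissibleVacuumData`, re-exported here under the crux namespace for the provers'
convenience). The Minkowski data `(ℝ³, δ, 0)` belong to Christodoulou's admissible class on
`Σ = ℝ³`, so `TameCensorship` is NOT provable for lack of admissible data. -/
theorem trivialData_admissible : trivialData ∈ admissibleVacuumData Minkowski.slice :=
  trivialData_mem_admissibleVacuumData

/-- **Existential content of the crux.** `TameCensorship` implies that SOME admissible datum on
`ℝ³` is tame: it has a maximal vacuum Cauchy development, and all its MGHDs have complete `𝓘⁺`, no
extremal remnant and bounded outer geometry. (Either the Minkowski datum is tame, or the generic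
curve through it supplies a tame admissible datum.) -/
theorem exists_mem_tameSet_of_tameCensorship (h : TameCensorship) :
    ∃ D ∈ admissibleVacuumData Minkowski.slice, D ∈ tameSet Minkowski.slice :=
  exists_of_isChristodoulouGeneric one_ne_zero (tameCensorship_imp_topologyFree h Minkowski.slice)
    admissibleVacuumData_slice_nonempty

/-- **Corollary (load-bearing: MGHD theory).** `TameCensorship` implies the existence, for some
admissible datum on `ℝ³`, of a MAXIMAL vacuum Cauchy development with complete future null infinity
(sojourn form). Neither maximality of any development nor the Choquet-Bruhat–Geroch theorem is
proved in the tree, so no proof of the crux can avoid constructing (or importing) an MGHD. -/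
theorem exists_isMaximal_of_tameCensorship (h : TameCensorship) :
    ∃ D ∈ admissibleVacuumData Minkowski.slice, ∃ 𝒟 : VacuumCauchyDevelopment D,
      𝒟.IsMaximal ∧ _root_.Summit.FinalStateConjecture.HasCompleteNullInfinity 𝒟.toCauchyDevelopment := by
  obtain ⟨D, hD, ⟨𝒟, hmax⟩, hall⟩ := exists_mem_tameSet_of_tameCensorship h
  exact ⟨D, hD, 𝒟, hmax, (hall 𝒟 hmax).1⟩

/-! ## §4 Curve-genericity is not closed under conjunction (the glue principle is false)

The model: initial data sets on the Minkowski slice `ℝ³` (all smooth `(h, k)`; admissible class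
`univ`), the observable `Φ(D) = (k(0)(e, e), k(e)(e, e)) ∈ ℝ²` and the concentric circles of radii
`1/(n+1)`. Everything below is elementary but has to negotiate the bundle formalism of
`InitialDataSet`/`IsSmoothDataFamily`; the plumbing lemmas reduce bundle smoothness over an open
subset of a normed space to plain smoothness. -/


section Plumbing

variable {F : Type*} [NormedAddCommGroup F] [NormedSpace ℝ F]

/-- Over an open subset `U` of a normed space the preferred trivialization of the bundle of
bilinear forms on `T U` is the identity on fibres (extracted from the tree's
`OpensSection.contMDiff_bilinSection`). -/
theorem trivializationAt_bilin_snd (U : Opens F) (x₀ y : U) (b : F →L[ℝ] F →L[ℝ] ℝ) :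
    ((trivializationAt (F →L[ℝ] F →L[ℝ] ℝ)
      (fun x : U ↦ TangentSpace 𝓘(ℝ, F) x →L[ℝ] TangentSpace 𝓘(ℝ, F) x →L[ℝ] ℝ) x₀)
        ⟨y, b⟩).2 = b := by
  ext v w
  rw [hom_trivializationAt_apply]
  simp only [ContinuousLinearMap.inCoordinates, ContinuousLinearMap.comp_apply]
  rw [OpensSection.symmL_apply, Trivialization.continuousLinearMapAt_apply,
    Trivialization.linearMapAt_apply,
    if_pos (by simpa [hom_trivializationAt_baseSet] using OpensSection.mem_chartAt_source U x₀ y)]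
  change ((trivializationAt (F →L[ℝ] ℝ)
    (fun x : U ↦ TangentSpace 𝓘(ℝ, F) x →L[ℝ] Bundle.Trivial U ℝ x) x₀) ⟨y, b v⟩).2 w = b v w
  rw [hom_trivializationAt_apply]
  simp only [ContinuousLinearMap.inCoordinates, ContinuousLinearMap.comp_apply]
  rw [OpensSection.symmL_apply]
  simp
  rfl

/-- Maps into the total space of the bundle of bilinear forms on `T U` (`U` open in a normed
space) are `C^n` iff base and fibre components are (the trivializations being the identity). -/
theorem contMDiffAt_totalSpace_bilin_iff {EN : Type*} [NormedAddCommGroup EN] [NormedSpace ℝ EN]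
    {HN : Type*} [TopologicalSpace HN] {J : ModelWithCorners ℝ EN HN} {N : Type*}
    [TopologicalSpace N] [ChartedSpace HN N] (U : Opens F) {n : ℕ∞ω}
    (g : N → U) (s : N → F →L[ℝ] F →L[ℝ] ℝ) (z₀ : N) :
    ContMDiffAt J (𝓘(ℝ, F).prod 𝓘(ℝ, F →L[ℝ] F →L[ℝ] ℝ)) n
      (fun z : N ↦ TotalSpace.mk' (F →L[ℝ] F →L[ℝ] ℝ)
        (E := fun x : U ↦ TangentSpace 𝓘(ℝ, F) x →L[ℝ] TangentSpace 𝓘(ℝ, F) x →L[ℝ] ℝ)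
        (g z) (s z)) z₀ ↔
    ContMDiffAt J 𝓘(ℝ, F) n g z₀ ∧ ContMDiffAt J 𝓘(ℝ, F →L[ℝ] F →L[ℝ] ℝ) n s z₀ := by
  rw [contMDiffAt_totalSpace]
  simp only [trivializationAt_bilin_snd]

end Plumbing

/-! ### A model data space: data on the Minkowski slice `ℝ³`, varying the tensor `k` -/

/-- Initial data sets on the Minkowski slice `ℝ³`. -/
abbrev SliceData : Type := InitialDataSet 𝓘(ℝ, E3) Minkowski.slice

/-- The bilinear-form type of the fibres. -/
abbrev Bil : Type := E3 →L[ℝ] E3 →L[ℝ] ℝ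

/-- A fibre bilinear form on `T_x slice = E3` viewed in `Bil` (identity). -/
def toBil {x : Minkowski.slice}
    (b : TangentSpace 𝓘(ℝ, E3) x →L[ℝ] TangentSpace 𝓘(ℝ, E3) x →L[ℝ] ℝ) : Bil := b

/-- An element of `Bil` viewed as a fibre bilinear form on `T_x slice` (identity). -/
def ofBil (x : Minkowski.slice) (b : Bil) :
    TangentSpace 𝓘(ℝ, E3) x →L[ℝ] TangentSpace 𝓘(ℝ, E3) x →L[ℝ] ℝ := b

@[simp] theorem toBil_apply {x : Minkowski.slice}
    (b : TangentSpace 𝓘(ℝ, E3) x →L[ℝ] TangentSpace 𝓘(ℝ, E3) x →L[ℝ] ℝ) (v w : E3) :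
    toBil b v w = b v w := rfl

@[simp] theorem ofBil_apply (x : Minkowski.slice) (b : Bil) (v w : E3) :
    ofBil x b v w = b v w := rfl

/-- The tensor `k` of a data set as a plain map `slice → Bil`. -/
def kBil (D : SliceData) : Minkowski.slice → Bil := fun x ↦ toBil (D.k x)

@[simp] theorem kBil_apply (D : SliceData) (x : Minkowski.slice) (v w : E3) :
    kBil D x v w = D.k x v w := rfl

theorem sliceData_ext {D D' : SliceData} (hh : D.h = D'.h) (hk : D.k = D'.k) : D = D' := by
  cases D; cases D'; cases hh; cases hk; rfl

/-- Over the slice, bundle smoothness of a bilinear section is plain smoothness. -/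
theorem contMDiff_section_iff (k : Minkowski.slice → Bil) :
    ContMDiff 𝓘(ℝ, E3) (𝓘(ℝ, E3).prod 𝓘(ℝ, Bil)) ∞
      (fun x : Minkowski.slice ↦ TotalSpace.mk' Bil
        (E := fun y : Minkowski.slice ↦
          TangentSpace 𝓘(ℝ, E3) y →L[ℝ] TangentSpace 𝓘(ℝ, E3) y →L[ℝ] ℝ) x (k x)) ↔
    ContMDiff 𝓘(ℝ, E3) 𝓘(ℝ, Bil) ∞ k := by
  constructor
  · intro h x
    exact ((contMDiffAt_totalSpace_bilin_iff Minkowski.slice id k x).1 (h x)).2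
  · intro h x
    exact (contMDiffAt_totalSpace_bilin_iff Minkowski.slice id k x).2 ⟨contMDiffAt_id, h x⟩

/-- The tensor `k` of a data set on the slice is smooth as a plain map. -/
theorem contMDiff_kBil (D : SliceData) : ContMDiff 𝓘(ℝ, E3) 𝓘(ℝ, Bil) ∞ (kBil D) :=
  (contMDiff_section_iff _).1 D.contMDiff_k

/-- Add a smooth symmetric bilinear section `β` to the tensor `k` of a data set. -/
def addK (D : SliceData) (β : Minkowski.slice → Bil) (hβs : ∀ x v w, β x v w = β x w v)
    (hβ : ContMDiff 𝓘(ℝ, E3) 𝓘(ℝ, Bil) ∞ β) : SliceData where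
  h := D.h
  k x := ofBil x (kBil D x + β x)
  k_symm x v w := by
    show D.k x v w + β x v w = D.k x w v + β x w v
    rw [D.k_symm x v w, hβs x v w]
  contMDiff_k := (contMDiff_section_iff (fun x ↦ kBil D x + β x)).2 ((contMDiff_kBil D).add hβ)

@[simp] theorem addK_h (D : SliceData) (β : Minkowski.slice → Bil) (hβs hβ) :
    (addK D β hβs hβ).h = D.h := rfl

@[simp] theorem addK_k_apply (D : SliceData) (β : Minkowski.slice → Bil) (hβs hβ)
    (y : Minkowski.slice) (v w : E3) :
    (addK D β hβs hβ).k y v w = D.k y v w + β y v w := rfl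

/-- The unit vector `e = e₀ ∈ ℝ³`. -/
def e : E3 := EuclideanSpace.single (0 : Fin 3) (1 : ℝ)

theorem norm_e : ‖e‖ = 1 := by simp [e]

theorem inner_e_e : ⟪e, e⟫ = 1 := by
  rw [real_inner_self_eq_norm_sq, norm_e]; norm_num

/-- The two evaluation points `0, e` of the slice. -/
def p₀ : Minkowski.slice := ⟨0, Minkowski.mem_slice _⟩

/-- The second evaluation point `e`. -/
def p₁ : Minkowski.slice := ⟨e, Minkowski.mem_slice _⟩

@[simp] theorem coe_p₀ : (p₀ : E3) = 0 := rfl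
@[simp] theorem coe_p₁ : (p₁ : E3) = e := rfl

/-- The scalar profile `a (1 - ⟪x, e⟫) + b ⟪x, e⟫`, worth `a` at `0` and `b` at `e`. -/
def βfun (a b : ℝ) (x : E3) : ℝ := a * (1 - ⟪x, e⟫) + b * ⟪x, e⟫

/-- The ambient section `x ↦ βfun a b x • δ` (`δ = innerSL`, the Euclidean form). -/
def βamb (a b : ℝ) (x : E3) : Bil :=
  βfun a b x • (innerSL ℝ (E := E3) : Bil)

theorem βamb_apply (a b : ℝ) (x v w : E3) :
    βamb a b x v w = (a * (1 - ⟪x, e⟫) + b * ⟪x, e⟫) * ⟪v, w⟫ := rfl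

theorem βamb_symm (a b : ℝ) (x v w : E3) : βamb a b x v w = βamb a b x w v := by
  rw [βamb_apply, βamb_apply, real_inner_comm v w]

/-- Joint smoothness of `(a, b, x) ↦ βamb a b x` (via the tree's `contDiffOn_smul_const'`,
stated for a generic normed target so that no instance diamond on `Bil` arises). -/
theorem contDiff_βamb : ContDiff ℝ ∞ (fun q : (ℝ × ℝ) × E3 ↦ βamb q.1.1 q.1.2 q.2) := by
  have hi : ContDiff ℝ ∞ (fun q : (ℝ × ℝ) × E3 ↦ ⟪q.2, e⟫) := contDiff_snd.inner ℝ contDiff_const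
  have hs : ContDiff ℝ ∞ (fun q : (ℝ × ℝ) × E3 ↦ βfun q.1.1 q.1.2 q.2) :=
    ((contDiff_fst.comp contDiff_fst).mul (contDiff_const.sub hi)).add
      ((contDiff_snd.comp contDiff_fst).mul hi)
  exact contDiffOn_univ.1 (contDiffOn_smul_const' hs.contDiffOn (innerSL ℝ (E := E3) : Bil))

theorem contMDiff_βamb_slice (a b : ℝ) :
    ContMDiff 𝓘(ℝ, E3) 𝓘(ℝ, Bil) ∞ (fun x : Minkowski.slice ↦ βamb a b x) :=
  ((contDiff_βamb.comp ((contDiff_const (c := (a, b))).prodMk contDiff_id)).contMDiff).comp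
    contMDiff_subtype_val

/-- The observable `Φ(D) = (k(0)(e,e), k(e)(e,e)) ∈ ℝ²`. -/
def Φ (D : SliceData) : ℝ × ℝ := (D.k p₀ e e, D.k p₁ e e)

/-- The one-parameter family `k_c = k + βamb (a c₀) (b c₀)`. -/
def fam (D : SliceData) (a b : ℝ → ℝ) (c : EuclideanSpace ℝ (Fin 1)) : SliceData :=
  addK D (fun x ↦ βamb (a (c 0)) (b (c 0)) x) (fun x v w ↦ βamb_symm _ _ x v w)
    (contMDiff_βamb_slice _ _)

@[simp] theorem fam_h (D : SliceData) (a b : ℝ → ℝ) (c : EuclideanSpace ℝ (Fin 1)) :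
    (fam D a b c).h = D.h := rfl

theorem fam_k_apply (D : SliceData) (a b : ℝ → ℝ) (c : EuclideanSpace ℝ (Fin 1))
    (x : Minkowski.slice) (v w : E3) :
    (fam D a b c).k x v w = D.k x v w + βamb (a (c 0)) (b (c 0)) x v w := rfl

/-- Recover the parameter from the family. -/
theorem fam_k_p₀ (D : SliceData) (a b : ℝ → ℝ) (c : EuclideanSpace ℝ (Fin 1)) :
    (fam D a b c).k p₀ e e = D.k p₀ e e + a (c 0) := by
  rw [fam_k_apply, βamb_apply, coe_p₀, inner_zero_left, inner_e_e]; ring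

theorem fam_k_p₁ (D : SliceData) (a b : ℝ → ℝ) (c : EuclideanSpace ℝ (Fin 1)) :
    (fam D a b c).k p₁ e e = D.k p₁ e e + b (c 0) := by
  rw [fam_k_apply, βamb_apply, coe_p₁, inner_e_e]; ring

theorem Φ_fam (D : SliceData) (a b : ℝ → ℝ) (c : EuclideanSpace ℝ (Fin 1)) :
    Φ (fam D a b c) = ((Φ D).1 + a (c 0), (Φ D).2 + b (c 0)) := by
  simp only [Φ, fam_k_p₀, fam_k_p₁]

theorem fam_zero (D : SliceData) (a b : ℝ → ℝ) (ha : a 0 = 0) (hb : b 0 = 0) :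
    fam D a b 0 = D := by
  refine sliceData_ext rfl (funext fun x ↦ ?_)
  ext v w
  rw [fam_k_apply, βamb_apply]
  simp [ha, hb]

theorem euclid1_ext {c c' : EuclideanSpace ℝ (Fin 1)} (h : c 0 = c' 0) : c = c' := by
  ext i
  fin_cases i
  exact h

theorem euclid1_ne_zero {c : EuclideanSpace ℝ (Fin 1)} (h : c ≠ 0) : c 0 ≠ 0 := by
  intro h0
  exact h (euclid1_ext (by simpa using h0))

/-- The family is jointly smooth (`IsSmoothDataFamily 1`). -/
theorem isSmoothDataFamily_fam (D : SliceData) {a b : ℝ → ℝ} (ha : ContDiff ℝ ∞ a)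
    (hb : ContDiff ℝ ∞ b) : InitialDataSet.IsSmoothDataFamily 1 (fam D a b) := by
  refine ⟨?_, ?_⟩
  · exact D.h.contMDiff.comp contMDiff_snd
  intro q
  refine (contMDiffAt_totalSpace_bilin_iff Minkowski.slice Prod.snd
    (fun q : EuclideanSpace ℝ (Fin 1) × Minkowski.slice ↦
      kBil D q.2 + βamb (a (q.1 0)) (b (q.1 0)) (q.2 : E3)) q).2 ⟨contMDiffAt_snd, ?_⟩
  have h0 : ContDiff ℝ ∞ (fun c : EuclideanSpace ℝ (Fin 1) ↦ c 0) :=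
    contDiff_piLp_apply (p := 2) (i := (0 : Fin 1))
  have h1 : ContDiff ℝ ∞ (fun q : EuclideanSpace ℝ (Fin 1) × E3 ↦
      βamb (a (q.1 0)) (b (q.1 0)) q.2) :=
    contDiff_βamb.comp (((ha.comp (h0.comp contDiff_fst)).prodMk
      (hb.comp (h0.comp contDiff_fst))).prodMk contDiff_snd)
  have h2 : ContMDiff (𝓘(ℝ, EuclideanSpace ℝ (Fin 1)).prod 𝓘(ℝ, E3))
      𝓘(ℝ, EuclideanSpace ℝ (Fin 1) × E3) ∞
      (fun q : EuclideanSpace ℝ (Fin 1) × Minkowski.slice ↦ (q.1, (q.2 : E3))) :=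
    contMDiff_fst.prodMk_space (contMDiff_subtype_val.comp contMDiff_snd)
  exact (((contMDiff_kBil D).comp contMDiff_snd) q).add ((h1.comp_contMDiff h2) q)

/-- Continuity of `t ↦ k_{γ(t)}(p)(v, w)` along a smooth parameter curve `γ` for a smooth family. -/
theorem continuous_k_apply {F : EuclideanSpace ℝ (Fin 1) → SliceData}
    (hF : InitialDataSet.IsSmoothDataFamily 1 F) {γ : ℝ → EuclideanSpace ℝ (Fin 1)}
    (hγ : ContMDiff 𝓘(ℝ, ℝ) 𝓘(ℝ, EuclideanSpace ℝ (Fin 1)) ∞ γ) (p : Minkowski.slice)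
    (v w : E3) : Continuous fun t ↦ (F (γ t)).k p v w := by
  have h1 : ContMDiff 𝓘(ℝ, ℝ) ((𝓘(ℝ, EuclideanSpace ℝ (Fin 1))).prod 𝓘(ℝ, E3)) ∞
      (fun t ↦ (γ t, p)) := hγ.prodMk contMDiff_const
  have h2 : ContMDiff 𝓘(ℝ, ℝ) (𝓘(ℝ, E3).prod 𝓘(ℝ, Bil)) ∞
      (fun t ↦ TotalSpace.mk' Bil
        (E := fun y : Minkowski.slice ↦
          TangentSpace 𝓘(ℝ, E3) y →L[ℝ] TangentSpace 𝓘(ℝ, E3) y →L[ℝ] ℝ) p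
            (kBil (F (γ t)) p)) :=
    hF.2.comp h1
  have h3 : ContMDiff 𝓘(ℝ, ℝ) 𝓘(ℝ, Bil) ∞ (fun t ↦ kBil (F (γ t)) p) := fun t ↦
    ((contMDiffAt_totalSpace_bilin_iff Minkowski.slice (fun _ ↦ p)
      (fun t ↦ kBil (F (γ t)) p) t).1 (h2 t)).2
  exact (h3.continuous.clm_apply continuous_const).clm_apply continuous_const


/-! ### The trap: concentric circles in the observable plane -/

/-- Radius `1/(n+1)` of the `n`-th circle. -/
def rad (n : ℕ) : ℝ := 1 / ((n : ℝ) + 1)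

theorem rad_pos (n : ℕ) : 0 < rad n := by unfold rad; positivity

theorem rad_le_one (n : ℕ) : rad n ≤ 1 := by
  unfold rad
  rw [div_le_one (by positivity)]
  linarith [n.cast_nonneg (α := ℝ)]

/-- The `n`-th circle `{u² + v² = rad n ²}` in the observable plane. -/
def circle (n : ℕ) : Set (ℝ × ℝ) := {q | q.1 ^ 2 + q.2 ^ 2 = rad n ^ 2}

theorem mem_circle {n : ℕ} {q : ℝ × ℝ} : q ∈ circle n ↔ q.1 ^ 2 + q.2 ^ 2 = rad n ^ 2 := Iff.rfl

/-- Exceptional set of `P`: the origin and the closed upper semicircles. -/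
def setA : Set (ℝ × ℝ) := {q | q = 0 ∨ ∃ n, q ∈ circle n ∧ 0 ≤ q.2}

/-- Exceptional set of `Q`: the open lower semicircles. -/
def setB : Set (ℝ × ℝ) := {q | ∃ n, q ∈ circle n ∧ q.2 < 0}

/-- The good set of `P`: the observable avoids the origin and the upper semicircles. -/
def goodP : Set SliceData := {D | Φ D ∉ setA}

/-- The good set of `Q`: the observable avoids the lower semicircles. -/
def goodQ : Set SliceData := {D | Φ D ∉ setB}

theorem mem_goodP {D : SliceData} : D ∈ goodP ↔ Φ D ∉ setA := Iff.rfl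

theorem mem_goodQ {D : SliceData} : D ∈ goodQ ↔ Φ D ∉ setB := Iff.rfl

/-- Key arithmetic: a nonzero relative rescaling by less than half the relative gap never lands
on another circle. -/
theorem no_circle_rescale {n m : ℕ} {θ : ℝ} (hθ : |θ| < 1 / (2 * ((n : ℝ) + 2)))
    (hθ0 : θ ≠ 0) : ((m : ℝ) + 1) * (1 + θ) ≠ (n : ℝ) + 1 := by
  intro h
  have hn : (0 : ℝ) ≤ n := n.cast_nonneg
  have hq : 0 < 2 * ((n : ℝ) + 2) := by positivity
  have hθ' : |θ| * (2 * ((n : ℝ) + 2)) < 1 := (lt_div_iff₀ hq).1 hθ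
  have habs : 0 ≤ |θ| := abs_nonneg θ
  have e0 : |θ| * (2 * ((n : ℝ) + 2)) = (n : ℝ) * |θ| * 2 + 4 * |θ| := by ring
  have hnθ : (n : ℝ) * |θ| * 2 < 1 := by nlinarith
  have hθ4 : 4 * |θ| < 1 := by nlinarith
  have hθle : θ ≤ |θ| := le_abs_self θ
  have hθge : -|θ| ≤ θ := neg_abs_le θ
  have hpos : 0 ≤ 1 + θ := by linarith
  rcases lt_trichotomy m n with hm | heq | hm
  · have hm' : (m : ℝ) + 1 ≤ n := by exact_mod_cast (show m + 1 ≤ n from hm)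
    have h1 : ((m : ℝ) + 1) * (1 + θ) ≤ n * (1 + θ) := mul_le_mul_of_nonneg_right hm' hpos
    have e1 : (n : ℝ) * (1 + θ) = n + n * θ := by ring
    have h2 : (n : ℝ) * θ ≤ n * |θ| := mul_le_mul_of_nonneg_left hθle hn
    linarith
  · subst heq
    have e2 : ((m : ℝ) + 1) * (1 + θ) = (m + 1) + (m + 1) * θ := by ring
    have h3 : ((m : ℝ) + 1) * θ = 0 := by linarith
    rcases mul_eq_zero.1 h3 with h4 | h4
    · have : (0 : ℝ) < (m : ℝ) + 1 := by positivity
      linarith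
    · exact hθ0 h4
  · have hm' : (n : ℝ) + 2 ≤ (m : ℝ) + 1 := by exact_mod_cast (show n + 2 ≤ m + 1 by omega)
    have h1 : ((n : ℝ) + 2) * (1 + θ) ≤ ((m : ℝ) + 1) * (1 + θ) :=
      mul_le_mul_of_nonneg_right hm' hpos
    have e3 : ((n : ℝ) + 2) * (1 + θ) = n + 2 + (n + 2) * θ := by ring
    have h4 : ((n : ℝ) + 2) * (-|θ|) ≤ (n + 2) * θ :=
      mul_le_mul_of_nonneg_left hθge (by positivity)
    have e4 : ((n : ℝ) + 2) * (-|θ|) = -((n : ℝ) * |θ|) - 2 * |θ| := by ring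
    linarith

/-- The bounded, injective, smooth reparametrisation `θ_n(t) = arctan t / (4 (n + 2))`. -/
def θf (n : ℕ) (t : ℝ) : ℝ := Real.arctan t / (4 * ((n : ℝ) + 2))

theorem θf_zero (n : ℕ) : θf n 0 = 0 := by simp [θf]

theorem abs_θf_lt (n : ℕ) (t : ℝ) : |θf n t| < 1 / (2 * ((n : ℝ) + 2)) := by
  have h4 : 0 < 4 * ((n : ℝ) + 2) := by positivity
  have ha : |Real.arctan t| < 2 := by
    rw [abs_lt]
    constructor
    · linarith [Real.neg_pi_div_two_lt_arctan t, Real.pi_lt_four]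
    · linarith [Real.arctan_lt_pi_div_two t, Real.pi_lt_four]
  rw [θf, abs_div, abs_of_pos h4, div_lt_div_iff₀ h4 (by positivity)]
  nlinarith

theorem θf_eq_zero_iff (n : ℕ) (t : ℝ) : θf n t = 0 ↔ t = 0 := by
  have h4 : (4 * ((n : ℝ) + 2)) ≠ 0 := by positivity
  rw [θf, div_eq_zero_iff, or_iff_left h4, Real.arctan_eq_zero_iff]

theorem θf_injective (n : ℕ) : Function.Injective (θf n) := by
  intro s t h
  have h4 : (4 * ((n : ℝ) + 2)) ≠ 0 := by positivity
  have : Real.arctan s = Real.arctan t := by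
    simpa [θf, div_left_inj' h4] using h
  exact Real.arctan_injective this

theorem contDiff_θf (n : ℕ) : ContDiff ℝ ∞ (θf n) :=
  Real.contDiff_arctan.div_const _

theorem one_add_θf_pos (n : ℕ) (t : ℝ) : 0 < 1 + θf n t := by
  have h := (abs_lt.1 (abs_θf_lt n t)).1
  have : 1 / (2 * ((n : ℝ) + 2)) ≤ 1 / 4 := by
    rw [div_le_div_iff₀ (by positivity) (by norm_num)]
    linarith [n.cast_nonneg (α := ℝ)]
  linarith

/-- **Radial escape.** Through a datum whose observable lies on the `n`-th circle passes a
smooth injective family whose other members avoid the origin and every circle. -/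
theorem radial_escape (D : SliceData) {n : ℕ} (hn : Φ D ∈ circle n) :
    ∃ F : EuclideanSpace ℝ (Fin 1) → SliceData, InitialDataSet.IsSmoothDataFamily 1 F ∧
      F 0 = D ∧ Function.Injective F ∧ ∀ c ≠ 0, F c ∈ goodP ∧ F c ∈ goodQ := by
  set u := (Φ D).1 with hu
  set v := (Φ D).2 with hv
  have hrad : u ^ 2 + v ^ 2 = rad n ^ 2 := hn
  have huv : u ≠ 0 ∨ v ≠ 0 := by
    by_contra h
    push Not at h
    rw [h.1, h.2] at hrad
    have := rad_pos n
    nlinarith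
  refine ⟨fam D (fun t ↦ u * θf n t) (fun t ↦ v * θf n t),
    isSmoothDataFamily_fam D (contDiff_const.mul (contDiff_θf n))
      (contDiff_const.mul (contDiff_θf n)),
    fam_zero D _ _ (by rw [θf_zero, mul_zero]) (by rw [θf_zero, mul_zero]), ?_, ?_⟩
  · intro c c' h
    have h₀ := congrArg (fun D : SliceData ↦ D.k p₀ e e) h
    have h₁ := congrArg (fun D : SliceData ↦ D.k p₁ e e) h
    simp only [fam_k_p₀, fam_k_p₁, add_right_inj] at h₀ h₁
    apply euclid1_ext
    apply θf_injective n
    rcases huv with hne | hne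
    · exact mul_left_cancel₀ hne h₀
    · exact mul_left_cancel₀ hne h₁
  · intro c hc
    have hc0 : c 0 ≠ 0 := euclid1_ne_zero hc
    have hθ0 : θf n (c 0) ≠ 0 := fun h ↦ hc0 ((θf_eq_zero_iff n _).1 h)
    have hpos := one_add_θf_pos n (c 0)
    have hΦ : Φ (fam D (fun t ↦ u * θf n t) (fun t ↦ v * θf n t) c) =
        (u * (1 + θf n (c 0)), v * (1 + θf n (c 0))) := by
      rw [Φ_fam, ← hu, ← hv]; ext <;> ring
    -- not the origin
    have hne : Φ (fam D (fun t ↦ u * θf n t) (fun t ↦ v * θf n t) c) ≠ 0 := by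
      rw [hΦ]
      intro h
      have h1 : u * (1 + θf n (c 0)) = 0 := congrArg Prod.fst h
      have h2 : v * (1 + θf n (c 0)) = 0 := congrArg Prod.snd h
      rcases huv with hne | hne
      · exact hne (by simpa [hpos.ne'] using h1)
      · exact hne (by simpa [hpos.ne'] using h2)
    -- on no circle
    have hnc : ∀ m, Φ (fam D (fun t ↦ u * θf n t) (fun t ↦ v * θf n t) c) ∉ circle m := by
      intro m hm
      rw [hΦ, mem_circle] at hm
      simp only at hm
      have hsq : ((1 + θf n (c 0)) * rad n) ^ 2 = rad m ^ 2 := by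
        rw [← hm, mul_pow, ← hrad]; ring
      have heq : (1 + θf n (c 0)) * rad n = rad m := by
        have := (sq_eq_sq₀ (mul_nonneg hpos.le (rad_pos n).le)
          (rad_pos m).le).1 hsq
        exact this
      apply no_circle_rescale (m := m) (abs_θf_lt n (c 0)) hθ0
      unfold rad at heq
      field_simp at heq
      linarith
    exact ⟨fun h ↦ h.elim hne fun ⟨m, hm, _⟩ ↦ hnc m hm, fun ⟨m, hm, _⟩ ↦ hnc m hm⟩

/-- **Escape from the origin along the parabola `(t, -t²)`**, which meets no upper semicircle. -/
theorem origin_escape (D : SliceData) (h0 : Φ D = 0) :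
    ∃ F : EuclideanSpace ℝ (Fin 1) → SliceData, InitialDataSet.IsSmoothDataFamily 1 F ∧
      F 0 = D ∧ Function.Injective F ∧ ∀ c ≠ 0, F c ∈ goodP := by
  refine ⟨fam D (fun t ↦ t) (fun t ↦ -(t * t)),
    isSmoothDataFamily_fam D contDiff_id (contDiff_id.mul contDiff_id).neg,
    fam_zero D _ _ rfl (by norm_num), ?_, ?_⟩
  · intro c c' h
    have h₀ := congrArg (fun D : SliceData ↦ D.k p₀ e e) h
    simp only [fam_k_p₀, add_right_inj] at h₀
    exact euclid1_ext h₀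
  · intro c hc
    have hc0 : c 0 ≠ 0 := euclid1_ne_zero hc
    have hΦ : Φ (fam D (fun t ↦ t) (fun t ↦ -(t * t)) c) = (c 0, -(c 0 * c 0)) := by
      rw [Φ_fam, h0]; simp
    intro hA
    rw [hΦ] at hA
    rcases hA with h | ⟨m, -, hm⟩
    · exact hc0 (congrArg Prod.fst h)
    · simp only at hm
      have : 0 < c 0 * c 0 := mul_self_pos.2 hc0
      linarith

/-- `P` is Christodoulou-generic (codimension `≥ 1`, curve form) in all slice data. -/
theorem isChristodoulouGeneric_P :
    InitialDataSet.IsChristodoulouGeneric (Set.univ : Set SliceData) (· ∈ goodP) 1 := by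
  rintro D ⟨-, hD⟩
  simp only [mem_goodP, not_not] at hD
  rcases hD with h0 | ⟨n, hn, -⟩
  · obtain ⟨F, hF, h0', hinj, hgood⟩ := origin_escape D h0
    exact ⟨F, hF, h0', hinj, fun _ ↦ trivial, fun c hc hmem ↦ hmem.2 (hgood c hc)⟩
  · obtain ⟨F, hF, h0', hinj, hgood⟩ := radial_escape D hn
    exact ⟨F, hF, h0', hinj, fun _ ↦ trivial, fun c hc hmem ↦ hmem.2 (hgood c hc).1⟩

/-- `Q` is Christodoulou-generic (codimension `≥ 1`, curve form) in all slice data. -/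
theorem isChristodoulouGeneric_Q :
    InitialDataSet.IsChristodoulouGeneric (Set.univ : Set SliceData) (· ∈ goodQ) 1 := by
  rintro D ⟨-, hD⟩
  simp only [mem_goodQ, not_not] at hD
  obtain ⟨n, hn, -⟩ := hD
  obtain ⟨F, hF, h0', hinj, hgood⟩ := radial_escape D hn
  exact ⟨F, hF, h0', hinj, fun _ ↦ trivial, fun c hc hmem ↦ hmem.2 (hgood c hc).2⟩

theorem Φ_trivialData : Φ trivialData = 0 := by
  simp [Φ]

/-- **The trap.** `P ∧ Q` is NOT Christodoulou-generic: every smooth injective family through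
the trivial datum (observable at the origin) meets a circle at a nonzero parameter, by the
intermediate value theorem applied to the squared radius of the observable. -/
theorem not_isChristodoulouGeneric_P_and_Q :
    ¬ InitialDataSet.IsChristodoulouGeneric (Set.univ : Set SliceData)
      (fun D ↦ D ∈ goodP ∧ D ∈ goodQ) 1 := by
  intro hgen
  have hex : trivialData ∈ {d ∈ (Set.univ : Set SliceData) | ¬ (d ∈ goodP ∧ d ∈ goodQ)} :=
    ⟨trivial, fun h ↦ h.1 (Or.inl Φ_trivialData)⟩
  obtain ⟨F, hF, hF0, -, -, hexc⟩ := hgen trivialData hex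
  -- the good members avoid `A ∪ B`
  have hgood : ∀ c ≠ 0, Φ (F c) ∉ setA ∧ Φ (F c) ∉ setB := fun c hc ↦ by
    have h := hexc c hc
    simp only [Set.mem_setOf_eq, Set.mem_univ, true_and, not_not] at h
    exact h
  -- the straight parameter curve `t ↦ t e₁`
  set e₁ : EuclideanSpace ℝ (Fin 1) := EuclideanSpace.single 0 1 with he₁
  set ι : ℝ → EuclideanSpace ℝ (Fin 1) := fun t ↦ t • e₁ with hι
  have hι0 : ∀ t, ι t 0 = t := fun t ↦ by simp [hι, he₁]
  have hιne : ∀ t ≠ 0, ι t ≠ 0 := fun t ht h ↦ ht (by rw [← hι0 t, h]; rfl)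
  have hιz : ι 0 = 0 := by simp [hι]
  have hιs : ContMDiff 𝓘(ℝ, ℝ) 𝓘(ℝ, EuclideanSpace ℝ (Fin 1)) ∞ ι :=
    (contDiff_id.smul contDiff_const).contMDiff
  -- squared radius of the observable along the curve
  set f : ℝ → ℝ := fun t ↦ ((F (ι t)).k p₀ e e) ^ 2 + ((F (ι t)).k p₁ e e) ^ 2 with hf
  have hfc : Continuous f :=
    ((continuous_k_apply hF hιs p₀ e e).pow 2).add ((continuous_k_apply hF hιs p₁ e e).pow 2)
  have hf0 : f 0 = 0 := by
    simp only [hf, hιz, hF0]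
    simp
  have hf1 : 0 < f 1 := by
    have hA := (hgood (ι 1) (hιne 1 one_ne_zero)).1
    have hne : Φ (F (ι 1)) ≠ 0 := fun h ↦ hA (Or.inl h)
    have : (Φ (F (ι 1))).1 ≠ 0 ∨ (Φ (F (ι 1))).2 ≠ 0 := by
      by_contra h
      push Not at h
      exact hne (Prod.ext h.1 h.2)
    simp only [hf, Φ] at this ⊢
    rcases this with h | h
    · have := pow_pos (abs_pos.2 h) 2; rw [pow_abs] at this  -- hmm
      positivity
    · positivity
  obtain ⟨n, hn⟩ := exists_nat_one_div_lt hf1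
  have hn' : rad n ^ 2 ≤ f 1 := by
    have h1 : rad n ^ 2 ≤ rad n := by
      rw [sq]; exact mul_le_of_le_one_left (rad_pos n).le (rad_le_one n)
    exact h1.trans (le_of_lt hn)
  obtain ⟨t, ht, hft⟩ :=
    intermediate_value_Icc zero_le_one hfc.continuousOn ⟨by rw [hf0]; positivity, hn'⟩
  have ht0 : t ≠ 0 := by
    rintro rfl
    rw [hf0] at hft
    exact (pow_pos (rad_pos n) 2).ne hft
  have hcirc : Φ (F (ι t)) ∈ circle n := hft
  rcases le_or_gt 0 (Φ (F (ι t))).2 with h | h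
  · exact (hgood (ι t) (hιne t ht0)).1 (Or.inr ⟨n, hcirc, h⟩)
  · exact (hgood (ι t) (hιne t ht0)).2 ⟨n, hcirc, h⟩

/-- **Christodoulou's curve-genericity (`IsChristodoulouGeneric … 1`) is not closed under
conjunction**: on the data space of the Minkowski slice there are properties `P`, `Q`, each
generic in the admissible class `univ`, whose conjunction is not. -/
theorem isChristodoulouGeneric_and_fails :
    ∃ (P Q : SliceData → Prop),
      InitialDataSet.IsChristodoulouGeneric Set.univ P 1 ∧
      InitialDataSet.IsChristodoulouGeneric Set.univ Q 1 ∧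
      ¬ InitialDataSet.IsChristodoulouGeneric Set.univ (fun D ↦ P D ∧ Q D) 1 :=
  ⟨(· ∈ goodP), (· ∈ goodQ), isChristodoulouGeneric_P, isChristodoulouGeneric_Q,
    not_isChristodoulouGeneric_P_and_Q⟩



/-! ## §4b The conjunction has codimension ZERO: no number of parameters rescues the glue (cycle 2)

Refinement of §4 by the abstract trap of §2b: the exceptional set of `P ∧ Q` fails
`HasCodimAtLeastIn univ … m` for EVERY `m ≥ 1` (not merely for `m = 1`), while `P`, `Q` have
codimension `≥ 1`. In Christodoulou's scale the conjunction of two codimension-`≥ 1` properties can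
have codimension exactly `0`. -/


/-- Continuity of `t ↦ k_{γ(t)}(p)(v, w)` along a smooth parameter curve `γ` in `ℝᵐ` for a smooth
`m`-parameter family of slice data (the case `m = 1` is `continuous_k_apply`). -/
theorem continuous_k_apply_fin {m : ℕ} {F : EuclideanSpace ℝ (Fin m) → SliceData}
    (hF : InitialDataSet.IsSmoothDataFamily m F) {γ : ℝ → EuclideanSpace ℝ (Fin m)}
    (hγ : ContMDiff 𝓘(ℝ, ℝ) 𝓘(ℝ, EuclideanSpace ℝ (Fin m)) ∞ γ) (p : Minkowski.slice)
    (v w : E3) : Continuous fun t ↦ (F (γ t)).k p v w := by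
  have h1 : ContMDiff 𝓘(ℝ, ℝ) ((𝓘(ℝ, EuclideanSpace ℝ (Fin m))).prod 𝓘(ℝ, E3)) ∞
      (fun t ↦ (γ t, p)) := hγ.prodMk contMDiff_const
  have h2 : ContMDiff 𝓘(ℝ, ℝ) (𝓘(ℝ, E3).prod 𝓘(ℝ, Bil)) ∞
      (fun t ↦ TotalSpace.mk' Bil
        (E := fun y : Minkowski.slice ↦
          TangentSpace 𝓘(ℝ, E3) y →L[ℝ] TangentSpace 𝓘(ℝ, E3) y →L[ℝ] ℝ) p
            (kBil (F (γ t)) p)) :=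
    hF.2.comp h1
  have h3 : ContMDiff 𝓘(ℝ, ℝ) 𝓘(ℝ, Bil) ∞ (fun t ↦ kBil (F (γ t)) p) := fun t ↦
    ((contMDiffAt_totalSpace_bilin_iff Minkowski.slice (fun _ ↦ p)
      (fun t ↦ kBil (F (γ t)) p) t).1 (h2 t)).2
  exact (h3.continuous.clm_apply continuous_const).clm_apply continuous_const

/-- The squared radius of the observable is curve-continuous for every `m`. -/
theorem continuous_radiusSq {m : ℕ} (F : EuclideanSpace ℝ (Fin m) → SliceData)
    (hF : InitialDataSet.IsSmoothDataFamily m F) (γ : ℝ → EuclideanSpace ℝ (Fin m))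
    (hγ : ContMDiff 𝓘(ℝ, ℝ) 𝓘(ℝ, EuclideanSpace ℝ (Fin m)) ∞ γ) :
    Continuous fun t ↦ (Φ (F (γ t))).1 ^ 2 + (Φ (F (γ t))).2 ^ 2 :=
  ((continuous_k_apply_fin hF hγ p₀ e e).pow 2).add ((continuous_k_apply_fin hF hγ p₁ e e).pow 2)

/-- **The conjunction `P ∧ Q` of `GenericityAndFails` has codimension `0`**: its exceptional set has
codimension `≥ m` for NO `m ≥ 1` (while `P`, `Q` separately have codimension `≥ 1`). No finite
number of parameters rescues the glue principle. -/
theorem not_isChristodoulouGeneric_P_and_Q_codim {m : ℕ} (hm : m ≠ 0) :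
    ¬ InitialDataSet.IsChristodoulouGeneric (Set.univ : Set SliceData)
      (fun D ↦ D ∈ goodP ∧ D ∈ goodQ) m := by
  refine not_hasCodimAtLeastIn_of_trap hm (f := fun D : SliceData ↦ (Φ D).1 ^ 2 + (Φ D).2 ^ 2)
    continuous_radiusSq (d := trivialData)
    ⟨trivial, fun h ↦ h.1 (Or.inl Φ_trivialData)⟩ (by simp [Φ_trivialData]) ?_ ?_
  · -- the zero set: `Φ D = 0` is exceptional for `P`
    intro D _ hD
    refine ⟨trivial, fun h ↦ h.1 (Or.inl ?_)⟩
    have h1 : (Φ D).1 = 0 := by nlinarith [sq_nonneg (Φ D).1, sq_nonneg (Φ D).2]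
    have h2 : (Φ D).2 = 0 := by nlinarith [sq_nonneg (Φ D).1, sq_nonneg (Φ D).2]
    exact Prod.ext h1 h2
  · -- whole small circles are exceptional
    intro ε hε
    obtain ⟨n, hn⟩ := exists_nat_one_div_lt hε
    refine ⟨rad n ^ 2, pow_pos (rad_pos n) 2, ?_, fun D _ hD ↦ ?_⟩
    · have h1 : rad n ^ 2 ≤ rad n := by
        rw [sq]; exact mul_le_of_le_one_left (rad_pos n).le (rad_le_one n)
      exact lt_of_le_of_lt h1 hn
    · rw [abs_of_nonneg (by positivity)] at hD
      have hcirc : Φ D ∈ circle n := hD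
      refine ⟨trivial, fun h ↦ ?_⟩
      rcases le_or_gt 0 (Φ D).2 with h2 | h2
      · exact h.1 (Or.inr ⟨n, hcirc, h2⟩)
      · exact h.2 ⟨n, hcirc, h2⟩

/-- Summary: `P`, `Q` Christodoulou-generic with codimension `≥ 1`, but `P ∧ Q` generic for no
positive codimension. -/
theorem isChristodoulouGeneric_and_fails_all_codim :
    ∃ (P Q : SliceData → Prop),
      InitialDataSet.IsChristodoulouGeneric Set.univ P 1 ∧
      InitialDataSet.IsChristodoulouGeneric Set.univ Q 1 ∧
      ∀ m ≠ 0, ¬ InitialDataSet.IsChristodoulouGeneric Set.univ (fun D ↦ P D ∧ Q D) m :=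
  ⟨(· ∈ goodP), (· ∈ goodQ), isChristodoulouGeneric_P, isChristodoulouGeneric_Q,
    fun _ hm ↦ not_isChristodoulouGeneric_P_and_Q_codim hm⟩


/-! ## §5 Near-miss (documented `sorry`): the base point of the model is out of reach -/

/-- **Near-miss.** The Minkowski datum should be tame (non-exceptional): its MGHD is Minkowski space,
which is null geodesically complete (so `HasCompleteNullInfinity` by
`hasCompleteFutureNullInfinity_of_isNullGeodesicallyComplete`), flat (so no late chart can converge in
`C²` to the curved extremal Kerr near zones) and trivially of bounded geometry (translated identity
charts, deviation `0`). OBSTRUCTION: the property quantifies over ALL maximal developments and asserts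
existence of one; the tree has `Minkowski.vacuumCauchyDevelopment : VacuumCauchyDevelopment trivialData`
but neither its maximality (`IsMaximal` = every vacuum Cauchy development of the trivial data embeds —
the Choquet-Bruhat–Geroch/Sbierski theorem together with inextendibility of Minkowski space among
globally hyperbolic developments) nor the transport of the three clauses along `IsIsometricTo`
(`hasCompleteFutureNullInfinity_iff_of_isIsometricTo` is an undischarged named fact, stated over the
defective `Development`). Tried: nothing cheaper than MGHD uniqueness gives `∀ 𝒟 maximal`; the `∃`
conjunct alone already needs maximality of the Minkowski development. Consequence: no instance of the
crux's property — positive or negative — is currently decidable in the tree; the crux can neither be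
shown tight at the trivial datum nor refuted there. -/
theorem trivialData_mem_tameSet : trivialData ∈ tameSet Minkowski.slice := by
  sorry


/-! ## §6 Read-back remark for provers: the no-extremal-remnant clause is two-sided in time

`lorentzGroup` is the FULL group `O(1,3)` (all linear `η`-isometries), so the clause
`∀ (Λ : lorentzGroup) c M a, IsExtremal M a → ¬ ∃ τ₀ Ψ, IsLateChart (boostedKerrBackground Λ c M a) …`
also ranges over time-reversing motions `Λ ∋ T`: for such `Λ` the background's "late region"
`{(Λ⁻¹(x - c))⁰ > τ₀}` is late in the REVERSED time, i.e. the clause also forbids convergence to a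
(parity/time-reversed) extremal Kerr exterior towards the PAST of the two-sided maximal development.
This strengthens the generic claim but is equally plausible (the past development of generic data is
the time-reverse of the future development of the reversed data); recorded so that a prover does not
try to discharge the clause from future-asymptotic information alone. -/

/-- Time reversal `T(v) = v - 2 v⁰ e₀`, i.e. `(T v)⁰ = -v⁰`, `(T v)ⁱ = vⁱ`, as a continuous linear
self-map of `E4`. -/
def timeReversalCLM : E4 →L[ℝ] E4 :=
  ContinuousLinearMap.id ℝ E4 -
    (2 : ℝ) • (ContinuousLinearMap.smulRight (EuclideanSpace.proj (0 : Fin 4))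
      (EuclideanSpace.single (0 : Fin 4) (1 : ℝ)))

/-- Coordinates of the time reversal: the time coordinate flips sign. -/
@[simp] theorem timeReversalCLM_apply_zero (v : E4) : timeReversalCLM v 0 = -v 0 := by
  simp [timeReversalCLM]; ring

/-- Coordinates of the time reversal: spatial coordinates are fixed. -/
@[simp] theorem timeReversalCLM_apply_succ (v : E4) (i : Fin 3) :
    timeReversalCLM v i.succ = v i.succ := by
  simp [timeReversalCLM, Fin.succ_ne_zero]

/-- Time reversal is an involution. -/
theorem timeReversalCLM_involutive (v : E4) : timeReversalCLM (timeReversalCLM v) = v := by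
  ext j
  refine Fin.cases ?_ (fun i ↦ ?_) j
  · rw [timeReversalCLM_apply_zero, timeReversalCLM_apply_zero, neg_neg]
  · rw [timeReversalCLM_apply_succ, timeReversalCLM_apply_succ]

/-- Time reversal as a continuous linear automorphism of `E4`. -/
def timeReversal : E4 ≃L[ℝ] E4 :=
  ContinuousLinearEquiv.equivOfInverse timeReversalCLM timeReversalCLM
    timeReversalCLM_involutive timeReversalCLM_involutive

/-- **Time reversal is a Lorentz transformation of the prelude's `lorentzGroup = O(1,3)`**, hence an
admissible motion `Λ` in the no-extremal-remnant clause of `TameCensorship` (and in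
`FinalStateDecomposition.motion`). -/
theorem timeReversal_mem_lorentzGroup : timeReversal ∈ lorentzGroup := by
  rw [mem_lorentzGroup_iff]
  intro v w
  change Minkowski.bilin (timeReversalCLM v) (timeReversalCLM w) = Minkowski.bilin v w
  simp [Minkowski.bilin_apply]


/-! ## §6b The time-reversed extremal background: its "late" slabs recede into the coordinate past -/

/-- Time reversal as an element of the Lorentz group `O(1,3)` of the prelude. -/
def T : lorentzGroup := ⟨timeReversal, timeReversal_mem_lorentzGroup⟩

@[simp] theorem timeReversal_symm_apply (v : E4) : timeReversal.symm v = timeReversalCLM v := rfl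

@[simp] theorem timeReversal_apply (v : E4) : timeReversal v = timeReversalCLM v := rfl

/-- Rest-frame time of the time-reversed motion `(T, c)`: `t*(x) = (T⁻¹(x − c))⁰ = c⁰ − x⁰`. -/
theorem poincareInv_T_apply_zero (c x : E4) : poincareInv T c x 0 = c 0 - x 0 := by
  simp [poincareInv, T]
  ring

/-- **The late region of the time-reversed extremal background is a coordinate PAST.** For the
motion `Λ = T` (time reversal, an element of the full Lorentz group over which clause (iii) of
`TameCensorship` quantifies) the background's late region `{t* > τ₀}` is `{x⁰ < c⁰ − τ₀}`, and
its slabs `{t* = τ}` are the ambient slabs `{x⁰ = c⁰ − τ}`, receding to `x⁰ → −∞` as `τ → +∞`: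
the no-extremal-remnant clause also forbids PAST-asymptotic (white-hole) extremal Kerr exteriors
of the two-sided maximal development (R2 of the crux triage, now a checked statement). -/
theorem mem_lateRegion_T_iff {c : E4} {M a τ₀ : ℝ} (x : (boostedKerrBackground T c M a).domain) :
    x ∈ (boostedKerrBackground T c M a).lateRegion τ₀ ↔ x.1 0 < c 0 - τ₀ := by
  rw [ModelBackground.mem_lateRegion]
  change τ₀ < poincareInv T c x.1 0 ↔ _
  rw [poincareInv_T_apply_zero]
  constructor <;> intro h <;> linarith

/-- The slabs of the time-reversed background are the ambient coordinate slabs `{x⁰ = c⁰ − τ}`. -/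
theorem mem_timeSlab_T_iff {c : E4} {M a τ : ℝ} (x : (boostedKerrBackground T c M a).domain) :
    x ∈ (boostedKerrBackground T c M a).timeSlab τ ↔ x.1 0 = c 0 - τ := by
  rw [ModelBackground.mem_timeSlab]
  change poincareInv T c x.1 0 = τ ↔ _
  rw [poincareInv_T_apply_zero]
  constructor <;> intro h <;> linarith

/-- Along the clause's limit `τ → +∞` the ambient time coordinate of the time-reversed slabs tends
to `−∞`. -/
theorem tendsto_ambientTime_T (c : E4) :
    Filter.Tendsto (fun τ : ℝ ↦ c 0 - τ) Filter.atTop Filter.atBot :=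
  Filter.tendsto_atBot_add_const_left _ _ Filter.tendsto_neg_atTop_atBot |>.congr fun τ ↦ by ring


/-! ## §7 Vacuous instances: the `∀ Σ` of the crux ranges partly over manifolds with no admissible data

A compact `Σ` carries no asymptotically flat end (the far region of an end would be a compact
unbounded subset of `ℝ³`), so `admissibleVacuumData Σ = ∅` and the `Σ`-instance of `TameCensorship`
holds for want of data. The content of the crux sits at non-compact `Σ` such as `ℝ³` (§3). -/

section Vacuous

variable {X : Type} [TopologicalSpace X] [ChartedSpace E3 X]

omit [ChartedSpace E3 X] in
/-- The far set `{R + 1 ≤ ‖y‖}` of `ℝ³` is unbounded. -/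
theorem not_isBounded_far (R : ℝ) : ¬ Bornology.IsBounded {y : E3 | R + 1 ≤ ‖y‖} := by
  intro hb
  obtain ⟨r, hr⟩ := (Metric.isBounded_iff_subset_closedBall (0 : E3)).1 hb
  set t : ℝ := |R| + |r| + 1 with ht
  have ht0 : 0 ≤ t := by positivity
  have hv : ‖(t • e : E3)‖ = t := by
    rw [norm_smul, norm_e, mul_one, Real.norm_eq_abs, abs_of_nonneg ht0]
  have hmem : (t • e : E3) ∈ {y : E3 | R + 1 ≤ ‖y‖} := by
    show R + 1 ≤ ‖(t • e : E3)‖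
    rw [hv, ht]
    linarith [le_abs_self R, abs_nonneg r]
  have := hr hmem
  rw [Metric.mem_closedBall, dist_zero_right, hv, ht] at this
  linarith [le_abs_self r, abs_nonneg R]

/-- **An asymptotically flat end forces non-compactness of `Σ`.** -/
theorem not_compactSpace_of_afEnd (e : AFEnd X) : ¬ CompactSpace X := by
  intro hc
  have hS : IsCompact (((↑) : e.U → X) '' (e.chart ⁻¹' {x | e.R + 1 ≤ ‖(x : E3)‖})) :=
    (e.isClosed_far (e.R + 1) (by linarith)).isCompact
  have hA : IsCompact (e.chart ⁻¹' {x : exteriorRegion e.R | e.R + 1 ≤ ‖(x : E3)‖}) :=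
    Topology.IsEmbedding.subtypeVal.isCompact_iff.2 hS
  have hsurj : Function.Surjective e.chart := e.chart.toEquiv.surjective
  have hT : IsCompact ((Subtype.val : exteriorRegion e.R → E3) ''
      (e.chart '' (e.chart ⁻¹' {x : exteriorRegion e.R | e.R + 1 ≤ ‖(x : E3)‖}))) :=
    (hA.image e.chart.continuous).image continuous_subtype_val
  rw [Set.image_preimage_eq _ hsurj] at hT
  have hset : (Subtype.val : exteriorRegion e.R → E3) ''
      {x : exteriorRegion e.R | e.R + 1 ≤ ‖(x : E3)‖} = {y : E3 | e.R + 1 ≤ ‖y‖} := by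
    ext y
    constructor
    · rintro ⟨x, hx, rfl⟩
      exact hx
    · intro hy
      have hy' : e.R < ‖y‖ := lt_of_lt_of_le (by linarith) hy
      exact ⟨⟨y, by simpa using hy'⟩, hy, rfl⟩
  rw [hset] at hT
  exact not_isBounded_far e.R hT.isBounded

/-- On a compact `Σ` there are no asymptotically flat ends. -/
theorem isEmpty_afEnd [CompactSpace X] : IsEmpty (AFEnd X) :=
  ⟨fun e ↦ not_compactSpace_of_afEnd e ‹_›⟩

variable [IsManifold (modelWithCornersSelf ℝ E3) ((⊤ : ℕ∞) : WithTop ℕ∞) X]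

/-- Without ends the admissible class is empty. -/
theorem admissibleVacuumData_eq_empty_of_isEmpty [IsEmpty (AFEnd X)] :
    admissibleVacuumData X = ∅ := by
  ext D
  simp only [Set.mem_empty_iff_false, iff_false]
  rintro ⟨-, e, -⟩
  exact IsEmpty.false e

/-- **Vacuous instances of the crux.** On a manifold without asymptotically flat ends (e.g. any
compact `Σ`, `isEmpty_afEnd`) the `Σ`-instance of `TameCensorship` holds trivially, for every
property whatsoever. -/
theorem isChristodoulouGeneric_of_isEmpty_afEnd [IsEmpty (AFEnd X)]
    (P : InitialDataSet (modelWithCornersSelf ℝ E3) X → Prop) (m : ℕ) :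
    InitialDataSet.IsChristodoulouGeneric (admissibleVacuumData X) P m := by
  rw [admissibleVacuumData_eq_empty_of_isEmpty]
  rintro D ⟨hD, -⟩
  exact hD.elim

end Vacuous


/-! ## §8 The codimension parameter is load-bearing in the weakest sense: at `m = 0` the crux is a
tautology (cycle 2) -/

/-- **`TameCensorship` with codimension parameter `0` instead of `1` holds trivially** (RE-TYPED crux:
for every `Σ`, the constant `0`-parameter family through an exceptional admissible datum, read on the
datum's own sole flat end, is a tame (`isTameDataFamily_const`), vacuously immersed, injective
escape). Together with §3 (at `m = 1` the crux has existential MGHD content) this brackets where the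
content enters; the topology-free version is `isChristodoulouGeneric_zero`. -/
theorem tameCensorship_codimZero (X : Type) [TopologicalSpace X] [ChartedSpace E3 X]
    [IsManifold (modelWithCornersSelf ℝ E3) ((⊤ : ℕ∞) : WithTop ℕ∞) X] [T2Space X]
    [SecondCountableTopology X] [ConnectedSpace X] :
    InitialDataSet.IsTameChristodoulouGeneric (admissibleVacuumData X) (· ∈ tameSet X) 0 := by
  intro d hd
  obtain ⟨-, e, M, hsole, hSAF⟩ := hd.1
  refine ⟨e, fun _ ↦ d, InitialDataSet.isTameDataFamily_const hsole 0 hSAF, ?_, rfl, ?_,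
    fun _ ↦ hd.1, ?_⟩
  · intro v hv
    exact absurd (Subsingleton.elim v 0) hv
  · intro a b _
    exact Subsingleton.elim a b
  · intro c hc
    exact absurd (Subsingleton.elim c 0) hc

/-! ## §9 Boost-blindness of the chart clause (iv): an `η`-isometric image of the `r₀`-ball avoids
its own translate by an arbitrarily short spacelike vector (cycle 2) -/

/-- The boost of rapidity `χ` in the `(x⁰, x³)`-plane, as a continuous linear self-map of `E4`:
`(Bv)⁰ = cosh χ v⁰ + sinh χ v³`, `(Bv)³ = sinh χ v⁰ + cosh χ v³`, `(Bv)¹ = v¹`, `(Bv)² = v²`. -/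
def boostCLM (χ : ℝ) : E4 →L[ℝ] E4 :=
  ContinuousLinearMap.id ℝ E4
    + (Real.cosh χ - 1) • ContinuousLinearMap.smulRight (EuclideanSpace.proj (0 : Fin 4))
        (EuclideanSpace.single (0 : Fin 4) (1 : ℝ))
    + Real.sinh χ • ContinuousLinearMap.smulRight (EuclideanSpace.proj (3 : Fin 4))
        (EuclideanSpace.single (0 : Fin 4) (1 : ℝ))
    + Real.sinh χ • ContinuousLinearMap.smulRight (EuclideanSpace.proj (0 : Fin 4))
        (EuclideanSpace.single (3 : Fin 4) (1 : ℝ))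
    + (Real.cosh χ - 1) • ContinuousLinearMap.smulRight (EuclideanSpace.proj (3 : Fin 4))
        (EuclideanSpace.single (3 : Fin 4) (1 : ℝ))

@[simp] theorem boostCLM_apply_zero (χ : ℝ) (v : E4) :
    boostCLM χ v 0 = Real.cosh χ * v 0 + Real.sinh χ * v 3 := by
  simp [boostCLM]; ring

@[simp] theorem boostCLM_apply_three (χ : ℝ) (v : E4) :
    boostCLM χ v 3 = Real.sinh χ * v 0 + Real.cosh χ * v 3 := by
  simp [boostCLM]; ring

@[simp] theorem boostCLM_apply_one (χ : ℝ) (v : E4) : boostCLM χ v 1 = v 1 := by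
  simp [boostCLM]

@[simp] theorem boostCLM_apply_two (χ : ℝ) (v : E4) : boostCLM χ v 2 = v 2 := by
  simp [boostCLM]

/-- `B(−χ) ∘ B(χ) = id` (`cosh² − sinh² = 1`). -/
theorem boostCLM_neg_apply_apply (χ : ℝ) (v : E4) : boostCLM (-χ) (boostCLM χ v) = v := by
  have h := Real.cosh_sq χ
  ext j
  fin_cases j
  · simp [Real.cosh_neg, Real.sinh_neg]
    linear_combination (v 0) * h
  · simp
  · simp
  · simp [Real.cosh_neg, Real.sinh_neg]
    linear_combination (v 3) * h

/-- The boost as a continuous linear automorphism of `E4`. -/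
def boost (χ : ℝ) : E4 ≃L[ℝ] E4 :=
  ContinuousLinearEquiv.equivOfInverse (boostCLM χ) (boostCLM (-χ))
    (boostCLM_neg_apply_apply χ) (fun v ↦ by simpa using boostCLM_neg_apply_apply (-χ) v)

@[simp] theorem boost_apply (χ : ℝ) (v : E4) : boost χ v = boostCLM χ v := rfl

/-- **Boosts are Lorentz transformations** of the prelude's `lorentzGroup = O(1,3)`. -/
theorem boost_mem_lorentzGroup (χ : ℝ) : boost χ ∈ lorentzGroup := by
  rw [mem_lorentzGroup_iff]
  intro v w
  have h := Real.cosh_sq χ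
  change Minkowski.bilin (boostCLM χ v) (boostCLM χ w) = Minkowski.bilin v w
  have e1 : ((1 : Fin 3).succ : Fin 4) = 2 := rfl
  have e2 : ((2 : Fin 3).succ : Fin 4) = 3 := rfl
  have e0 : ((0 : Fin 3).succ : Fin 4) = 1 := rfl
  simp only [Minkowski.bilin_apply, Fin.sum_univ_three, e0, e1, e2, boostCLM_apply_zero,
    boostCLM_apply_one, boostCLM_apply_two, boostCLM_apply_three]
  linear_combination (v 3 * w 3 - v 0 * w 0) * h

/-- A coordinate of a vector of `E4` is bounded by its norm. -/
theorem abs_apply_le_norm (v : E4) (i : Fin 4) : |v i| ≤ ‖v‖ := by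
  rw [EuclideanSpace.norm_eq]
  apply Real.abs_le_sqrt
  have := Finset.single_le_sum (f := fun j : Fin 4 ↦ ‖v j‖ ^ 2) (fun j _ ↦ sq_nonneg _)
    (Finset.mem_univ i)
  simpa [Real.norm_eq_abs, sq_abs] using this

/-- **Boost-blindness of the chart clause.** For every `ℓ > 0` and `r₀ > 0` there is a Lorentz
transformation `Λ ∈ O(1,3)` such that the `η`-ISOMETRIC linear image `Λ(B(0, r₀))` of the coordinate
`r₀`-ball is disjoint from its translate by the short spacelike vector `ℓ e₃`:
`Λ w − Λ w' ≠ ℓ e₃` for all `w, w' ∈ B(0, r₀)` (take the boost of rapidity `χ = 2 r₀ / ℓ` in the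
`(x⁰, x³)`-plane: a difference `Λ(w − w') = ℓ e₃` forces `|(w − w')⁰| = ℓ sinh χ ≥ 2 r₀`).
READ-BACK CONSEQUENCE for clause (iv) of `TameCensorship` (and hypothesis (ii) of
`ChannelsResolveTameDevelopments`): the clause asks, at each point separately, for SOME chart from the
`r₀`-ball with `Ψ^* g` `C⁰`-close to `η`, and an exact `η`-isometry composed with such a chart is again
such a chart; so in the flat Lorentzian cylinder `E4 ⧸ ℤ ℓ e₃` the boosted charts `x ↦ [Λ x + q]` are
injective isometric `r₀`-ball charts at every point although the closed spacelike geodesics have length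
`ℓ ≪ r₀`. "Bounded geometry at a uniform scale" as typed therefore does NOT see short closed spacelike
circles (e.g. the contracting circle of a Kasner-like expanding hidden sector, triage R1), nor — boosting
along the wave vector — null curvature of any strength (pp-waves); violating (iv) requires a
frame-INDEPENDENT blow-up at scale `r₀` along `outer` (curvature invariants, or the boundary of the MGHD
within uniform reach in every frame). This weakens (iv) as a hypothesis (K2's burden) and strengthens the
case that K3's clause (iv) is hard to violate generically. -/
theorem exists_lorentz_ball_disjoint_translate {ℓ r₀ : ℝ} (hℓ : 0 < ℓ) (hr : 0 < r₀) :
    ∃ Λ : E4 ≃L[ℝ] E4, Λ ∈ lorentzGroup ∧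
      ∀ w ∈ Metric.ball (0 : E4) r₀, ∀ w' ∈ Metric.ball (0 : E4) r₀,
        Λ w - Λ w' ≠ ℓ • EuclideanSpace.single (3 : Fin 4) (1 : ℝ) := by
  set χ : ℝ := 2 * r₀ / ℓ with hχ
  have hχ0 : 0 ≤ χ := by positivity
  refine ⟨boost χ, boost_mem_lorentzGroup χ, fun w hw w' hw' h ↦ ?_⟩
  rw [Metric.mem_ball, dist_zero_right] at hw hw'
  set u : E4 := w - w' with hu
  have hBu : boost χ u = ℓ • EuclideanSpace.single (3 : Fin 4) (1 : ℝ) := by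
    rw [hu, map_sub]; exact h
  have h0 := congrArg (fun v : E4 ↦ v 0) hBu
  have h3 := congrArg (fun v : E4 ↦ v 3) hBu
  simp at h0 h3
  -- solve the 2×2 system: u 0 = -ℓ sinh χ
  have hcs := Real.cosh_sq χ
  have hu0 : u 0 = -(ℓ * Real.sinh χ) := by
    linear_combination Real.cosh χ * h0 - Real.sinh χ * h3 - (u 0) * hcs
  -- |u 0| ≥ ℓ χ = 2 r₀
  have hsinh : χ ≤ Real.sinh χ := Real.self_le_sinh_iff.2 hχ0
  have hge : 2 * r₀ ≤ |u 0| := by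
    rw [hu0, abs_neg, abs_of_nonneg (by positivity)]
    calc 2 * r₀ = ℓ * χ := by rw [hχ]; field_simp
      _ ≤ ℓ * Real.sinh χ := mul_le_mul_of_nonneg_left hsinh hℓ.le
  -- but |u 0| ≤ ‖u‖ < 2 r₀
  have hlt : |u 0| < 2 * r₀ :=
    calc |u 0| ≤ ‖u‖ := abs_apply_le_norm u 0
      _ ≤ ‖w‖ + ‖w'‖ := norm_sub_le w w'
      _ < 2 * r₀ := by linarith
  linarith


/-! ## §10 Endpoint-junk re-audit of the crux itself (cycle 3)

The drefuter of line `crush-the-swallowed-interior` found (2026-08-16, `DrefuteCrushJunk.lean`: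
`LorentzianMetric.futureCauchyDevelopment_eq_self_of_isClosed`) that the vendored future Cauchy
development of a CLOSED set is the set itself, because the vendored `IsPastInextendible γ s :=
s.Nonempty ∧ (¬ BddBelow s ∨ …)` declares every curve on a parameter set unbounded below
past-inextendible (a short timelike segment reparametrised over `Iic 0` then "escapes" any closed `S`).
The two lemmas below are the one-line core of that defect and its faithful contrast. The crux
`TameCensorship` is IMMUNE: reading its closure symbol by symbol (module docstring, bullet §10), no
notion built on `IsPastInextendible` / `IsFutureInextendible` / `futureCauchyDevelopment` /
`IsCauchySurface` (old) occurs — `CauchyDevelopment` uses the faithful `IsCauchyHypersurface`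
(endless curves), complete `𝓘⁺` and `outer` use maximal affinely parametrised geodesics
(`IsNormalisedNullRayFrom`, `¬ BddAbove dom`, `sojournTime`), `J⁺`/`I⁻` are reparametrisation-invariant,
the chart clauses are `ℝ≥0∞` suprema, `IsMaximal` is `EmbedsInto`. The same holds for K2
(`ChannelsResolveTameDevelopments`), whose hypotheses (i)–(ii) are the crux's clauses verbatim. -/

section EndpointJunk

variable {M' : Type*} [TopologicalSpace M']

/-- **The vendored inextendibility is decided by the parameter set alone**: EVERY curve on a left
half-line `(-∞, t₀]` is `IsPastInextendible` (first disjunct), whatever its behaviour — in particular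
a constant curve, or a short segment reparametrised over `Iic t₀` (the drefuter's escape curve). -/
theorem isPastInextendible_Iic (γ : ℝ → M') (t₀ : ℝ) : IsPastInextendible γ (Iic t₀) :=
  ⟨nonempty_Iic, Or.inl (not_bddBelow_Iic t₀)⟩

/-- Time dual: every curve on `[t₀, ∞)` is vendored-future-inextendible. -/
theorem isFutureInextendible_Ici (γ : ℝ → M') (t₀ : ℝ) : IsFutureInextendible γ (Ici t₀) :=
  ⟨nonempty_Ici, Or.inl (not_bddAbove_Ici t₀)⟩

/-- The faithful notion sees endpoints: a constant curve has its value as past endpoint on every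
parameter set … -/
theorem hasPastEndpoint_const (p : M') (s : Set ℝ) : HasPastEndpoint (fun _ : ℝ ↦ p) s p :=
  tendsto_const_nhds

/-- … hence is never past-ENDLESS (`IsPastEndless`, the notion the lead's repaired `D⁺` uses). -/
theorem not_isPastEndless_const (p : M') (s : Set ℝ) : ¬ IsPastEndless (fun _ : ℝ ↦ p) s :=
  fun h ↦ h.2 p (hasPastEndpoint_const p s)

end EndpointJunk


/-! ## §11 `-- Targets` (cycle 3): the seven registered stubs of line `crush-the-swallowed-interior`

Skeleton: `Cruxes/TameCensorship/Lines/crush-the-swallowed-interior.lean` (lead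
prover-line-stmt-FinalStateConjecture-10047-0, reshaped DEF-FREE, `D⁺` repaired 2026-08-16). The
lead's HANDOFF `STUCK` list handed to this seat was EMPTY (`payload.targets = []`), so the whole stub
set was attacked with the cheap arsenal (degenerate instances, junk models, hypothesis mutation,
literature). STATUS (disprover's reading; "true" = no counterexample and a proof route visible):

* B `stub_exactKerrBookkeeping` — bookkeeping over `SubdataDevelopmentsEmbed` (stmt-10053) and the
  Kerr–Schild causal API; needs a Kerr-shielded ADMISSIBLE datum and a MAXIMAL development as
  hypotheses, so no instance is constructible here either way. One reading caveat for its prover: in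
  (B3) the map `χ` of (B1) is only a local isometry INTO `Kerr.spacetime M a r₋` (hence a local
  diffeomorphism, `g` being non-degenerate); the finite hole diameter must come from the INTENDED `χ`
  (inverse of the embedded Kerr domain of dependence), which (B1)'s `∃ χ` lets the prover choose. TRUE
  in print; XL in the tree.
* O `stub_immortalObservers` — semantically TRUE with no junk found: the orbit `x₀ + sΛe₀` stays in the
  domain (lead's `orbit_mem_domain`) and enters the late region, `truncDeviationCk … 2 (r x₀) (t x₀ + s)
  → 0` controls `Ψ^* g` in `C⁰` AT the orbit points (`R := r(x₀)`), so `g(γ', γ') → g_B(x₀)(Λe₀, Λe₀)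
  < 0`; the sign of `g(T, γ')` is eventually constant by continuity (this is exactly the future/past
  disjunction); future case: infinite length + local finiteness of `d` ⇒ future-endless ⇒ (Cauchy
  hypersurface `ιX`, with the tree's gluing/extension lemmas for the merely differentiable curve class)
  eventually in `J⁺(ιX)`, and `arcLength_le_lorentzDist`. Backgrounds with `M ≤ 0` or `|a| > M` are
  admitted by the stub but harmless: for `M < 0` the "exterior" is the whole chart incl. the ring, where
  `Kerr.bilin` blows up, so `truncDeviationCk = ⊤` on every truncated slab and the hypothesis fails; for
  `M = 0` the background is flat and the conclusion holds for the same reason as in general. At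
  Minkowski's development (the only one in the tree) every hypothesis-satisfying chart is an almost
  isometry of flat late slabs, and the conclusion is true — no Lean kill available or expected.
  NON-VACUITY of the hypothesis `g_B(x₀)(Λe₀, Λe₀) < 0`: §11a below (every axis point beyond `r₊`).
* P `stub_phaseRigidity` — semantically TRUE: `χ^* g_K = g` on `E` with `g` non-degenerate makes `χ` a
  local diffeomorphism, so the type-D invariant `Ψ₂ = −3J/I` of `g` on `E` is that of Kerr `(M, a)` at
  `χ(·)` (`r ≥ r₊ > |a|`: phase in `[180° − 3α, 180° + 3α]`, `α = arctan(|a|/r₊) < 45°`), while along the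
  pushed orbit of the polar point `r' = (1 + η)M'` of the extremal background it tends (continuity of
  `I, J` in the `C²` topology; `I ≈ 3Ψ₂² ≠ 0`) to `−M'/(r' − iM')³`, phase `−45° + O(η) ∉` that closed
  arc. DEGENERATE INSTANCE `E = ∅`: the three exactness hypotheses hold for every `χ`
  (`stubP_exactness_empty`) and the conclusion reduces to the existence of a timelike-Killing point of
  the boosted extremal exterior — so P ⊇ that existence statement; it is discharged in §11a for the axis
  points P's proof uses anyway (`g'(∂_t, ∂_t)(t, 0, 0, r') = −(r' − M')²/(r'² + M'²) < 0`).
* C′ `stub_crush` (repaired: faithful `D⁺`, Hawking's bound H and N′ as explicit hypotheses) — TRUE in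
  print given H and N′ ((C1): `d(m, q) ≤ diam_d(C) + 3/ε`; (C2): non-imprisonment + N′). Degenerate
  instances: `K = ∅` makes both conclusions contentless (`causalFuture_empty'`); the EMPTY crush
  hypersurface still inhabits the hypotheses exactly when `J⁺(ιK)` is relatively compact (drefuter's side
  remark; with the faithful `D⁺`, `J⁺(∅) = ∅ ⊆ D⁺(∅) = ∅`, `fdod_empty`), where (C1)/(C2) need only
  boundedness of `d` on compacts and non-imprisonment — both needed by the general proof anyway.
* H `stub_hawkingCrushBound` (= Literature named fact `HawkingCrushBound`, Wald 1984 Thm 9.5.1 in FUTURE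
  form) — checked against the source's conventions: Wald's theorem bounds PAST-directed curves by `3/|C|`
  when the trace `K` of the extrinsic curvature of the PAST-directed normal congruence is `≤ C < 0`; the
  tree's `meanCurvature` is `H = tr_{f^*g} K_ν = + div ν` for the CHOSEN normal (`Hypersurface.lean`,
  design note: `K_ν(v, w) = + g(D_v ν, df w)`), here the FUTURE unit normal, so `H ≤ −C` is the exact time
  reversal of Wald's hypothesis and the conclusion (future curves `≤ 3/C`) its time reversal: the sign
  convention is right. Tight at the Minkowski past hyperboloid `t = −√(ρ² + |x|²)` (`ν = −X/ρ`,
  `D_v ν = −v/ρ`, `H = −3/ρ`, lifetime exactly `ρ = 3/|H|`). Load-bearing hypothesis: UNIFORMITY (§11c: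
  with `H < 0` pointwise only, `D⁺` of the graph `t = −log(1 + e^{x₁})` contains timelike curves of
  infinite length, e.g. `x₁(t) = x₀¹ − (t − t₀) + η(t)`, `η' = 1/t²`). TRUE (a theorem in print); its
  in-tree discharge `HawkingCrushBound_holds` is XL (maximising geodesics, focal points).
* N′ `stub_nullTerminality` (repaired) — CONJECTURAL, no counterexample known. Reduction (drefuter,
  confirmed): Hawking's bound on `D⁺(S″)` leaves to exclude a future-COMPLETE null geodesic `γ` with
  `sup_s d(q, γ s) < ∞` for some `q ≪ γ`; explicit models all pass (Minkowski/Milne hyperboloids,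
  Schwarzschild membranes `r₀ < 3M/2`, Kerr region II incl. the co-rotating fine-tuned geodesics —
  `R(r) ≈ 2(M − r₋)(Q + (L − aE)²)(r − r₋)` has a simple root at `r₋`, finite Mino and affine time —,
  extremal inspirals, Kasner/Taub/Misner). THREAT CLASS (literature, this cycle): a compact DEGENERATE
  (`κ = 0`) Cauchy horizon `H⁺(S″)` above a contracting compact slice of a vacuum MGHD would carry
  complete spiralling null geodesics inside `int D⁺(S″)` (affine length `Σ e^{−κ n P} = ∞` iff `κ = 0`) and
  kill N′; its existence is the open degenerate half of the Isenberg–Moncrief conjecture — Moncrief–Isenberg,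
  CMP 89 (1983) 387–413 (analytic, closed generators: compact null hypersurfaces are Killing horizons;
  the degenerate `T³` ones are "plane-wave" spacetimes entirely foliated by compact null surfaces, hence
  never Cauchy horizons); Minguzzi, CMP 339 (2015) (arXiv:1406.5919), Thm 26 and p. 47: "in the empty case
  there is still the possibility that a compact Cauchy horizon could form … one would expect that this
  could occur only in very special (non generic) cases as in … Taub-NUT", smooth + closed generators +
  non-degenerate ⇒ Killing, "the problem of removing the condition on the closure of the geodesics remains
  open"; Minguzzi, arXiv:1406.5909, Thm 1.1: every compactly generated `H⁺(S)` has PAST complete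
  generators (dually) — the generators themselves live on the horizon, outside the MGHD, so they are no
  threat. So within compact hidden sectors N′ is at least as hard as (and implied there by) non-degeneracy
  of compact vacuum Cauchy horizons; no kill is available from print. [Searches for Reiris–Bustamante /
  Petersen–Rácz (smooth non-degenerate case) DEGRADED: `lit search` rc 75 all session; galaxy only.]
  LOAD-BEARING hypothesis found this cycle: UNIFORM contraction `ε > 0` (§11c, explicit Minkowski
  counterexample to the pointwise version). No junk at `N = ∅` after the repair (`fdod_empty`).
* R `stub_residue` (held by the lead) — OPEN-PROBLEM level by design (R2 = past third law for the
  reversed cored datum; R1 = tameness of uncrushable swallowed sectors). After the `D⁺` repair R1's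
  antecedent `¬ IsCrushable` is again a genuine restriction (before it was always true, drefuter). Nothing
  to attack formally (admissible shielded datum + MGHD as hypotheses); §6/§6b/§9 and R1/R2 of the module
  docstring remain this seat's assessment; the lockstep repair K3′/K2′ (charts into `J⁺(ιΣ)`, rays in
  causal contact with the end) makes both conjuncts vacuous and is still the recommendation. -/

/-! ### §11a Non-vacuity of the timelike-Killing hypothesis (stubs O / P / R): axis points -/

section KillingAxis

/-- The axis point `(t, 0, 0, R)` of the Kerr–Schild chart `E4`. -/
def axisPt (t R : ℝ) : E4 := t • E4.basisVector 0 + R • E4.basisVector 3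

@[simp] theorem axisPt_apply_zero (t R : ℝ) : axisPt t R 0 = t := by simp [axisPt]

@[simp] theorem axisPt_apply_one (t R : ℝ) : axisPt t R 1 = 0 := by simp [axisPt]

@[simp] theorem axisPt_apply_two (t R : ℝ) : axisPt t R 2 = 0 := by simp [axisPt]

@[simp] theorem axisPt_apply_three (t R : ℝ) : axisPt t R 3 = R := by simp [axisPt]

theorem spatialNorm_sq_axisPt (t R : ℝ) : E4.spatialNorm (axisPt t R) ^ 2 = R ^ 2 := by
  rw [E4.spatialNorm_sq]; simp

/-- On the axis the Kerr–Schild radius is `|z|`: `r(t, 0, 0, R) = R` for `R > 0` (the defining quartic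
degenerates to `R⁴ − (R² − a²)R² − a²R² = 0`). -/
theorem radius_axisPt (a t : ℝ) {R : ℝ} (hR : 0 < R) : Kerr.radius a (axisPt t R) = R := by
  apply Kerr.radius_eq_of_pos_of_quartic hR
  rw [spatialNorm_sq_axisPt, axisPt_apply_three]
  ring

/-- `g_{M,a}(∂_t, ∂_t) = −1 + 2H` in the ingoing Kerr–Schild chart (`ℓ(∂_t) = 1`). -/
theorem kerrBilin_e0_e0 (M a : ℝ) (x : E4) :
    Kerr.bilin M a x (E4.basisVector 0) (E4.basisVector 0) = -1 + 2 * Kerr.scalarH M a x := by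
  rw [Kerr.bilin_apply, Kerr.nullCovector_basisVector_zero, Minkowski.bilin_basisVector_zero]
  ring

/-- **Exact axis formula**: `g_{M,a}(∂_t, ∂_t)(t, 0, 0, R) = −(R² − 2MR + a²)/(R² + a²)`
(`= −Δ(R)/(R² + a²)`, the Boyer–Lindquist `g_{tt}` on the axis), for every `M, a` and `R > 0`. -/
theorem kerrBilin_e0_e0_axisPt (M a t : ℝ) {R : ℝ} (hR : 0 < R) :
    Kerr.bilin M a (axisPt t R) (E4.basisVector 0) (E4.basisVector 0) =
      -(R ^ 2 - 2 * M * R + a ^ 2) / (R ^ 2 + a ^ 2) := by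
  rw [kerrBilin_e0_e0, Kerr.scalarH, radius_axisPt a t hR, axisPt_apply_three]
  have h1 : R ^ 2 + a ^ 2 ≠ 0 := by positivity
  have h2 : R ^ 4 + a ^ 2 * R ^ 2 = R ^ 2 * (R ^ 2 + a ^ 2) := by ring
  rw [h2]
  field_simp
  ring

/-- `Δ(R) = R² − 2MR + a² > 0` beyond the outer horizon radius `r₊ = M + √(M² − a²)`, for ALL real
`M, a` (junk parameters included: for `a² > M²` the square root vanishes and `Δ > (R − M)² ≥ 0`). -/
theorem kerrDelta_pos_of_rPlus_lt {M a R : ℝ} (hR : Kerr.rPlus M a < R) :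
    0 < R ^ 2 - 2 * M * R + a ^ 2 := by
  unfold Kerr.rPlus at hR
  have hs : 0 ≤ √(M ^ 2 - a ^ 2) := Real.sqrt_nonneg _
  rcases le_or_gt 0 (M ^ 2 - a ^ 2) with h | h
  · have hsq : √(M ^ 2 - a ^ 2) ^ 2 = M ^ 2 - a ^ 2 := Real.sq_sqrt h
    nlinarith
  · nlinarith

/-- **The stationary Killing field `∂_t` is timelike at every axis point beyond the horizon**
(`R > max r₊ 0`), for every `M, a`: the ergoregion touches the axis only at the poles of the horizon. -/
theorem kerrBilin_e0_e0_axisPt_neg (M a t : ℝ) {R : ℝ} (hR : 0 < R) (hR' : Kerr.rPlus M a < R) :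
    Kerr.bilin M a (axisPt t R) (E4.basisVector 0) (E4.basisVector 0) < 0 := by
  rw [kerrBilin_e0_e0_axisPt M a t hR, neg_div]
  exact neg_neg_of_pos (div_pos (kerrDelta_pos_of_rPlus_lt hR') (by positivity))

/-- Axis points beyond `r₊` lie in the Kerr exterior `{r > max r₊ 0}`. -/
theorem axisPt_mem_exterior (M a t : ℝ) {R : ℝ} (hR : 0 < R) (hR' : Kerr.rPlus M a < R) :
    axisPt t R ∈ Kerr.exterior M a := by
  rw [Kerr.mem_exterior, radius_axisPt a t hR]
  exact max_lt hR' hR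

/-- **Non-vacuity of the timelike-Killing hypothesis of stubs O / P / R.** In EVERY boosted, translated
Kerr–Schild exterior (all `Λ ∈ O(1,3)`, `c`, `M`, `a`, junk parameters included) there is a point `x₀` at
which the stationary Killing direction `Λ e₀` is timelike for the background form — the boosted axis
point `Λ (0, 0, 0, R) + c` with `R = max r₊ 0 + 1` — so the orbit clauses of the three stubs are never
vacuously true, and stub P's `∃ x₀` can be met on the axis (its intended polar points `R ∈ (M', (1+η)M')`
of the extremal background are covered by `kerrBilin_e0_e0_axisPt_neg`, `r₊ = M'` there). Stated with
`EuclideanSpace.single 0 1` verbatim as in the registered (def-free) stubs. -/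
theorem exists_boostedKerr_killing_timelike (Λ : lorentzGroup) (c : E4) (M a : ℝ) :
    ∃ x₀ : (boostedKerrBackground Λ c M a).domain,
      (boostedKerrBackground Λ c M a).bilin x₀.1
        ((Λ : E4 ≃L[ℝ] E4) (EuclideanSpace.single (0 : Fin 4) (1 : ℝ)))
        ((Λ : E4 ≃L[ℝ] E4) (EuclideanSpace.single (0 : Fin 4) (1 : ℝ))) < 0 := by
  set R : ℝ := max (Kerr.rPlus M a) 0 + 1 with hRdef
  have hR : 0 < R := by rw [hRdef]; linarith [le_max_right (Kerr.rPlus M a) 0]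
  have hR' : Kerr.rPlus M a < R := by rw [hRdef]; linarith [le_max_left (Kerr.rPlus M a) 0]
  set y : E4 := axisPt 0 R with hy
  have hinv : poincareInv Λ c ((Λ : E4 ≃L[ℝ] E4) y + c) = y := by
    simp [poincareInv]
  have hmem : (Λ : E4 ≃L[ℝ] E4) y + c ∈ (boostedKerrBackground Λ c M a).domain := by
    change (Λ : E4 ≃L[ℝ] E4) y + c ∈ boostedKerrExterior Λ c M a
    rw [mem_boostedKerrExterior, hinv]
    exact axisPt_mem_exterior M a 0 hR hR'
  refine ⟨⟨_, hmem⟩, ?_⟩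
  change boostedKerrBilin Λ c M a ((Λ : E4 ≃L[ℝ] E4) y + c) _ _ < 0
  rw [boostedKerrBilin_apply, hinv, ContinuousLinearEquiv.symm_apply_apply]
  exact kerrBilin_e0_e0_axisPt_neg M a 0 hR hR'

/-- **Stub P keeps content at `E = ∅`**: its three exactness hypotheses (`IsOpen E`, `ContMDiffOn χ E`,
`χ^* g_{M,a} = g` on `E`) hold for `E = ∅` and EVERY `χ`, so P specialised there asserts — for every
spacetime admitting an extremal late chart with near-zone deviation `→ 0` — the existence of a
timelike-Killing point of the boosted extremal exterior (the rest of its conclusion is `¬ ∃ s₀, ∀ s ≥ s₀,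
γ s ∈ ∅ ∧ …`, trivially true). That existence is `exists_boostedKerr_killing_timelike`. -/
theorem stubP_exactness_empty [Kerr.Facts] (𝓢 : Spacetime.{0} 4) (M a : ℝ) (hM : 0 ≤ M)
    (χ : 𝓢.carrier → (Kerr.spacetime M a (Kerr.rMinus M a) hM).carrier) :
    IsOpen (∅ : Set 𝓢.carrier) ∧ ContMDiffOn (𝓡 4) (𝓡 4) ∞ χ ∅ ∧
      ∀ p ∈ (∅ : Set 𝓢.carrier), pullbackBilin (I := 𝓡 4) (I' := 𝓡 4) χ
        (Kerr.spacetime M a (Kerr.rMinus M a) hM).metric.val p = 𝓢.metric.val p :=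
  ⟨isOpen_empty, contMDiffOn_empty, fun _ h ↦ h.elim⟩

/-- The orbit-conclusion of stub P at `E = ∅` is trivially true for every curve. -/
theorem stubP_conclusion_empty {𝓢 : Spacetime.{0} 4} (γ : ℝ → 𝓢.carrier) (Q : ℝ → Prop) :
    ¬ ∃ s₀ : ℝ, ∀ s : ℝ, s₀ ≤ s → γ s ∈ (∅ : Set 𝓢.carrier) ∧ Q s :=
  fun ⟨s₀, h⟩ ↦ (h s₀ le_rfl).1

end KillingAxis

/-! ### §11b The faithful future domain of dependence: degenerate instances of C′ / N′ / R are contentless -/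

section Faithful

universe u

/-- The FAITHFUL future domain of dependence — verbatim the lead's `futureDomainOfDependence`
(`Lines/crush-the-swallowed-interior.lean`, repair of 2026-08-16; inlined as this set-builder in the
registered stubs C, N, R): every past-ENDLESS future-directed causal curve through `p` meets `S` at or
before `p`. -/
def fdod (𝓢 : Spacetime.{u} 4) (S : Set 𝓢.carrier) : Set 𝓢.carrier :=
  {p | ∀ (β : ℝ → 𝓢.carrier) (s : Set ℝ), s.OrdConnected →
    𝓢.metric.IsFutureCausalCurveOn 𝓢.timeOrientation β s → IsPastEndless β s →
    ∀ t₀ ∈ s, β t₀ = p → ∃ t ∈ s, t ≤ t₀ ∧ β t ∈ S}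

variable (𝓢 : Spacetime.{u} 4)

/-- `S ⊆ D⁺(S)`. -/
theorem subset_fdod (S : Set 𝓢.carrier) : S ⊆ fdod 𝓢 S :=
  fun _ hp _ _ _ _ _ t₀ ht₀ hγp ↦ ⟨t₀, ht₀, le_rfl, hγp ▸ hp⟩

/-- `D⁺` is monotone. -/
theorem fdod_mono {S S' : Set 𝓢.carrier} (h : S ⊆ S') : fdod 𝓢 S ⊆ fdod 𝓢 S' :=
  fun _ hp β s hs hβ he t₀ ht₀ hβp ↦
    let ⟨t, ht, htle, htS⟩ := hp β s hs hβ he t₀ ht₀ hβp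
    ⟨t, ht, htle, h htS⟩

/-- **`D⁺(S) ⊆ J⁺(S)`** for the faithful `D⁺` (the endless timelike curve through `p`, which the tree
constructs — `exists_isEndlessTimelikeCurve_through` —, meets `S` at or before `p`). -/
theorem fdod_subset_causalFuture (S : Set 𝓢.carrier) :
    fdod 𝓢 S ⊆ 𝓢.metric.causalFuture 𝓢.timeOrientation S := by
  intro p hp
  obtain ⟨Δ, D, hΔ, h0D, hΔ0⟩ :=
    LorentzianMetric.exists_isEndlessTimelikeCurve_through (g := 𝓢.metric) (τ := 𝓢.timeOrientation)
      (WithTop.coe_le_coe.mpr le_top : (2 : ℕ∞ω) ≤ ∞) p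
  obtain ⟨t, htD, ht0, htS⟩ := hp Δ D hΔ.1 hΔ.2.1.isFutureCausalCurveOn hΔ.2.2.2 0 h0D hΔ0
  rcases ht0.eq_or_lt with rfl | hlt
  · exact LorentzianMetric.subset_causalFuture (g := 𝓢.metric) (τ := 𝓢.timeOrientation) S (hΔ0 ▸ htS)
  · refine Or.inr ⟨Δ t, htS, Δ, t, 0, hlt, ?_, rfl, hΔ0⟩
    exact (hΔ.2.1.mono (hΔ.1.out htD h0D)).isFutureCausalCurveOn

/-- **`D⁺(∅) = ∅` for the faithful `D⁺`** (contrast: vendored `D⁺(S) = S` for closed `S`, drefuter). Hence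
the REPAIRED `NullTerminality` has an unsatisfiable hypothesis ("eventually in `D⁺(∅)`") at the empty
hypersurface — vacuous there and ONLY there —, and in the repaired `IsCrushable` the empty hypersurface
survives exactly when `J⁺(ιK)` is relatively compact (`J⁺(∅) = ∅ ⊆ D⁺(∅)`): the degenerate-instance
attack which voided the vendored objects fails honestly on the repaired ones. -/
theorem fdod_empty : fdod 𝓢 ∅ = ∅ :=
  Set.eq_empty_of_subset_empty <| (fdod_subset_causalFuture 𝓢 ∅).trans <| by
    rintro q (hq | ⟨p, hp, -⟩)
    · exact hq
    · exact hp.elim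

variable {E : Type*} [NormedAddCommGroup E] [NormedSpace ℝ E] {H : Type*} [TopologicalSpace H]
  {I : ModelWithCorners ℝ E H} {n : ℕ∞ω} {M' : Type*} [TopologicalSpace M'] [ChartedSpace H M']
  [IsManifold I ∞ M']

/-- `J⁺(∅) = ∅`: with `K = ∅` the swallowed region is empty and (C1), (C2), R1a, R1b say nothing. -/
theorem causalFuture_empty' (g : LorentzianMetric I n M') (τ : TimeOrientation g) :
    g.causalFuture τ ∅ = ∅ := by
  ext q; simp [LorentzianMetric.mem_causalFuture_iff]

/-- `I⁺(∅) = ∅` (so an empty crush hypersurface covers nothing: `J⁺(ιK) ⊆ C`). -/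
theorem chronologicalFuture_empty' (g : LorentzianMetric I n M') (τ : TimeOrientation g) :
    g.chronologicalFuture τ ∅ = ∅ := by
  ext q; simp [LorentzianMetric.mem_chronologicalFuture_iff]

end Faithful

/-! ### §11c Load-bearing hypothesis of N′ (and of Hawking's bound): UNIFORM contraction — PROVED

The development is the companion crux workfile `Cruxes/TameCensorship/NullTerminalityUniformity.lean`
(namespace `…Cruxes.TameCensorship.Disproof.Uniformity`, NOT imported here — see the section note; ~950 lines, rc 0, 0 sorry,
axioms `propext`/`Classical.choice`/`Quot.sound`; the same file is proposed for landing as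
`Theorems/TameCensorship/Negative/NullTerminalityNeedsUniformity.lean`). Summary of the witness (all in
`Minkowski.vacuumCauchyDevelopment`, carrier `E4`, metric `η`):

* profile `u(r) = −log(1 + eʳ)`: `u' = −eʳ/(1 + eʳ) ∈ (−1, 0)`, `u'' = −eʳ/(1 + eʳ)² < 0`;
* `S″ = {x⁰ = u(x¹)}` = range of the graph immersion `fGraph y = u(y⁰) e₀ + (0, y)` (`N = E3`): closed,
  achronal (a timelike curve between graph points would gain time `u(q¹) − u(p¹) < |q¹ − p¹| ≤ ‖q̲ − p̲‖`),
  spacelike (`η(df v, df v) = ‖v‖² − u'²(v⁰)² > 0`), smooth future unit normal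
  `ν = (1 − u'²)^{−1/2}(e₀ + u' e₁)`;
* `meanCurvature_fGraph : H = c u''/(1 − u'²) = u''/(1 − u'²)^{3/2}`, `meanCurvature_fGraph_neg : H < 0`
  — from the tree's `secondFundamentalForm` (`secondFundamentalForm_apply_holds` + the frame formula
  `normalDerivAlong_eq` read in the constant frame of the flat development: `D_v ν = D(Nf)_y v`,
  `K(v, w) = c u'' v⁰ w⁰`) and `trace_eq_sum_gram_inv` in the standard basis (Gram `diag(1 − u'², 1, 1)`);
  NOT uniform: `H → 0⁻` as `y⁰ → −∞`;
* the faithful `D⁺(S″)` contains `W = {u(x¹) ≤ x⁰, x⁰ + x¹ < 0}`: along a past-ENDLESS causal curve of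
  Minkowski space time is unbounded below (`not_bddBelow_time_of_isFutureCausalCurveOn`, causal twin of
  the tree's timelike lemma) and the spatial drift is at most the elapsed time, so
  `t − u(x¹) ≤ (p⁰ + p¹) + log(1 + e^{t − p⁰ − p¹})` becomes negative and the curve meets the graph (IVT);
* the null LINE `(0, −1, 0, 0) + t (e₀ − e₁)`: maximal geodesic of the flat Levi-Civita connection on `ℝ`
  (`ModelSpace.isGeodesic_line`), null, future-directed, in `W` for all `t ≥ 0`; domain `ℝ` unbounded.

Consequences. `NullTerminalityPointwiseAnyDev` (the registered `stub_nullTerminality` with `∃ ε > 0,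
H ≤ −ε` weakened to `H < 0` AND maximality of the development dropped) is false UNCONDITIONALLY;
`NullTerminalityPointwise` (ONLY the ε-clause weakened; statement diff against the registered stub
checked mechanically) is false modulo `Minkowski.vacuumCauchyDevelopment.IsMaximal` (§5 gap). The same
`D⁺` carries future timelike curves of infinite length (paper remark: `x¹(t) = x₀¹ − (t − t₀) + η(t)`,
`η' = t⁻²`), so Hawking's bound H needs uniformity too. ANY proof of N′ must use `ε > 0` quantitatively. -/

section Uniformity

/-! The theorems live in the companion workfile (not imported here so that this file does not wait for
the farm to build it): `Uniformity.not_nullTerminalityPointwiseAnyDev`,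
`Uniformity.not_nullTerminalityPointwise_of_isMaximal`, `Uniformity.meanCurvature_fGraph(_neg)`,
`Uniformity.regionW_subset_fdod_graph`, … in
`Summits.FinalStateConjecture.FinalStateConjecture.Cruxes.TameCensorship.NullTerminalityUniformity`
(commit 502abaff2cf7, rc 0, 0 sorry, axioms propext/Classical.choice/Quot.sound); landing as
`Theorems/TameCensorship/Negative/NullTerminalityUniformity{Profile,Graph}.lean` +
`…/NullTerminalityNeedsUniformity.lean` (p77361 = part 1, parts 2–3 follow). -/

end Uniformity


/-! ## §12 (cycle 4, RE-TYPED crux stmt-17431) TAME genericity is not closed under conjunction — on the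
crux's OWN admissible class `admissibleVacuumData ℝ³`

Cycle 1–2's §4/§4b refuted the glue principle for the topology-free notion on a MODEL class (`univ`,
non-decaying modifications of `k`). For the re-typed crux the relevant notion is the summit's TAME
genericity and the relevant class is the admissible one; both gaps are closed here (landing as
`Theorems/TameCensorship/Negative/TameBreathingObservable.lean` (p134044, review-queued: defs) +
`…/TameGenericityAndFails.lean` (p134333, ACCEPTED 9cd7f27d06c4; part 1 ACCEPTED d1a654b784ec); this section
is the inline, self-contained copy). MODEL: observable `u(D, z) = h₁₁(z)` in the chart of the standard end
`trivialAFEnd`, at `z₁ = 4e₀`, `z₂ = −4e₀`; motions = the tree's BREATHING CURVES (isometric copies of `D`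
under compactly supported ball dilations — ADMISSIBLE, jointly smooth, injective, immersed, and TAME on a
collar of the datum's own sole end); exceptional sets = concentric SQUARES `max |Φᵢ| = 1/(n+1)` about
`Φ(trivialData) = 0`, split into origin ∪ vertical sides (`goodV`ᶜ) and horizontal sides (`goodH`ᶜ).
RESULT: `Tame.isTameChristodoulouGeneric_PV`, `Tame.isTameChristodoulouGeneric_QH` (each tame-generic,
codim 1, relative to `admissibleVacuumData Minkowski.slice`), `Tame.not_hasCodimAtLeastIn_PV_and_QH`
(the conjunction's exceptional set has codimension ZERO: every jointly smooth admissible family through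
the trivial datum is trapped, §2b's `not_hasCodimAtLeastIn_of_trap`),
`not_isTameChristodoulouGeneric_and_of_admissible` (the glue principle is false for the summit's notion
on the crux's class), `isTameChristodoulouGeneric_and_fails_admissible` (witness form, all `m ≥ 1`).
CONSEQUENCE for K3: a proof must build ONE tame curve escaping the exceptional sets of MGHD-existence,
complete `𝓘⁺`, third law and outer tameness simultaneously; "WCC, then third law, then tameness" plans
need a genuinely new joining argument. -/

section TameGlue

open Metric Function Filter

namespace Tame

/-! ### Two breathing balls on the standard end of `ℝ³` and the observable -/

/-- The admissible class of the crux on `Σ = ℝ³` (the Minkowski slice). -/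
abbrev 𝓓 : Set (InitialDataSet (𝓡 3) Minkowski.slice) := admissibleVacuumData Minkowski.slice

/-- The unit vector `e₀ = (1, 0, 0)` of `ℝ³`. -/
def v : E3 := EuclideanSpace.single (0 : Fin 3) (1 : ℝ)

/-- `‖e₀‖ = 1`. -/
theorem norm_v : ‖v‖ = 1 := by simp [v]

/-- `e₀ ≠ 0`. -/
theorem v_ne_zero : v ≠ 0 := by
  rw [← norm_ne_zero_iff, norm_v]; exact one_ne_zero

/-- The first breathing centre `z₁ = 4 e₀`. -/
def z₁ : E3 := (4 : ℝ) • v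

/-- The second breathing centre `z₂ = −4 e₀`. -/
def z₂ : E3 := (-4 : ℝ) • v

/-- `‖z₁‖ = 4`. -/
theorem norm_z₁ : ‖z₁‖ = 4 := by rw [z₁, norm_smul, norm_v]; norm_num

/-- `‖z₂‖ = 4`. -/
theorem norm_z₂ : ‖z₂‖ = 4 := by rw [z₂, norm_smul, norm_v]; norm_num

/-- The centres are `8` apart. -/
theorem dist_z₁_z₂ : dist z₁ z₂ = 8 := by
  rw [dist_eq_norm, z₁, z₂, ← sub_smul, norm_smul, norm_v]; norm_num

/-- The centres are `8` apart. -/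
theorem dist_z₂_z₁ : dist z₂ z₁ = 8 := by rw [dist_comm, dist_z₁_z₂]

/-- Breathing data on the unit ball about `z₁` on the end `trivialAFEnd` (`R = 1 < 4 − 2`). -/
theorem B₁ : trivialAFEnd.BreathingData z₁ 1 :=
  ⟨one_pos, by rw [trivialAFEnd_R, norm_z₁]; norm_num⟩

/-- Breathing data on the unit ball about `z₂`. -/
theorem B₂ : trivialAFEnd.BreathingData z₂ 1 :=
  ⟨one_pos, by rw [trivialAFEnd_R, norm_z₂]; norm_num⟩

/-- `z₁` lies on the end. -/
theorem R_lt_z₁ : trivialAFEnd.R < ‖z₁‖ := B₁.R_lt_norm_center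

/-- `z₂` lies on the end. -/
theorem R_lt_z₂ : trivialAFEnd.R < ‖z₂‖ := B₂.R_lt_norm_center

/-- **The observable coordinate** `u(D, z) = h₁₁(z)`: the `(e₀, e₀)` chart component of the metric
of `D` at the coordinate point `z`, in the chart of the standard end of `ℝ³`. -/
def obs (D : InitialDataSet (𝓡 3) Minkowski.slice) (z : E3) : ℝ :=
  AFEnd.hCoeff trivialAFEnd D z v v

/-- On the end, `u(D, z) = h_D(Φₑ z)(dΦₑ e₀, dΦₑ e₀)` (`hCoeff_apply_eq_dataChartExt`). -/
theorem obs_eq (D : InitialDataSet (𝓡 3) Minkowski.slice) {z : E3} (hz : trivialAFEnd.R < ‖z‖) :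
    obs D z = D.h.inner (trivialAFEnd.dataChartExt z)
      (mfderiv 𝓘(ℝ, E3) (𝓡 3) trivialAFEnd.dataChartExt z v)
      (mfderiv 𝓘(ℝ, E3) (𝓡 3) trivialAFEnd.dataChartExt z v) :=
  trivialAFEnd.hCoeff_apply_eq_dataChartExt D hz v v

/-- The observable coordinate is positive on the end (`h` is Riemannian, the chart an immersion). -/
theorem obs_pos (D : InitialDataSet (𝓡 3) Minkowski.slice) {z : E3} (hz : trivialAFEnd.R < ‖z‖) :
    0 < obs D z := by
  rw [obs_eq D hz]
  refine D.h.pos _ _ fun h ↦ v_ne_zero ?_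
  exact trivialAFEnd.injective_mfderiv_dataChartExt hz
    (h.trans (map_zero (mfderiv 𝓘(ℝ, E3) (𝓡 3) trivialAFEnd.dataChartExt z)).symm)

/-- At the trivial datum the observable coordinate is `1` everywhere (`hCoeff = δ`). -/
theorem obs_trivialData (z : E3) : obs trivialData z = 1 := by
  rw [obs, hCoeff_trivialAFEnd, innerSL_apply_apply, real_inner_self_eq_norm_sq, norm_v, one_pow]

/-- **Centre law.** Breathing about `z` multiplies `u(·, z)` by `(1 + σ t)²`. -/
theorem obs_breatheFamily_center {z : E3} (B : trivialAFEnd.BreathingData z 1)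
    (D : InitialDataSet (𝓡 3) Minkowski.slice) (t : ℝ) :
    obs (AFEnd.breatheFamily B D t) z = (1 + AFEnd.squash B t) ^ 2 * obs D z := by
  rw [obs_eq _ B.R_lt_norm_center, obs_eq _ B.R_lt_norm_center]
  exact AFEnd.breatheFamily_h_inner_center B D t _ _

/-- A coordinate point at distance `> 3/4` from the breathing centre is not in the moved core. -/
theorem not_mem_breatheCore {z z' : E3} (B : trivialAFEnd.BreathingData z 1)
    (hz' : trivialAFEnd.R < ‖z'‖) (hfar : 3 / 4 < dist z' z) :
    trivialAFEnd.dataChartExt z' ∉ AFEnd.breatheCore trivialAFEnd z 1 := by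
  rintro ⟨w, hw, hweq⟩
  have hwR : trivialAFEnd.R < ‖w‖ :=
    B.R_lt_norm_of_mem_ball (closedBall_subset_ball (by norm_num) hw)
  have h := congrArg trivialAFEnd.coord hweq
  rw [trivialAFEnd.coord_dataChartExt_of_lt hwR, trivialAFEnd.coord_dataChartExt_of_lt hz'] at h
  subst h
  rw [mem_closedBall] at hw
  linarith

/-- **Off-centre law.** Breathing about `z` does not change `u(·, z')` for `z'` off the core. -/
theorem obs_breatheFamily_of_not_mem {z z' : E3} (B : trivialAFEnd.BreathingData z 1)
    (D : InitialDataSet (𝓡 3) Minkowski.slice) (t : ℝ)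
    (hz' : trivialAFEnd.R < ‖z'‖) (hfar : 3 / 4 < dist z' z) :
    obs (AFEnd.breatheFamily B D t) z' = obs D z' := by
  rw [obs_eq _ hz', obs_eq _ hz',
    (AFEnd.breatheFamily_eq_of_not_mem_core B D t (not_mem_breatheCore B hz' hfar)).1]

/-- `σ t ≠ 0` for `t ≠ 0`. -/
theorem squash_ne_zero {z : E3} (B : trivialAFEnd.BreathingData z 1) {t : ℝ} (ht : t ≠ 0) :
    AFEnd.squash B t ≠ 0 :=
  fun h ↦ ht (AFEnd.squash_injective B (by rw [h, AFEnd.squash_zero]))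

/-- **The observable** `Φ(D) = (u(D, z₁) − 1, u(D, z₂) − 1) ∈ ℝ²`; `Φ(trivialData) = 0`. -/
def obsPair (D : InitialDataSet (𝓡 3) Minkowski.slice) : ℝ × ℝ := (obs D z₁ - 1, obs D z₂ - 1)

/-- `Φ(trivialData) = 0`. -/
theorem obsPair_trivialData : obsPair trivialData = 0 := by
  simp [obsPair, obs_trivialData]

/-! ### The breathing curves as tame admissible witness curves (split ends) -/

/-- The breathing curve of `D` about the ball of `B`, parametrised by `ℝ¹`. -/
def curve {z : E3} (B : trivialAFEnd.BreathingData z 1) (D : InitialDataSet (𝓡 3) Minkowski.slice) :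
    EuclideanSpace ℝ (Fin 1) → InitialDataSet (𝓡 3) Minkowski.slice :=
  fun c ↦ AFEnd.breatheFamily B D (c 0)

/-- **Tameness with split ends.** The breathing curve (breathing in the chart of the STANDARD end) is
tame on a collar of ANY sole end `E` on which `D` is Dafermos–Rodnianski flat — in particular on the
datum's own admissible end: all members agree with `D` off the compact core. -/
theorem isTameDataFamily_curve {z : E3} (B : trivialAFEnd.BreathingData z 1)
    {D : InitialDataSet (𝓡 3) Minkowski.slice} {E : AFEnd Minkowski.slice} (hE : E.IsSoleEnd)
    {M : ℝ} (hSAF : E.IsStronglyAsymptoticallyFlatDR D M) {R₁ : ℝ} (hR₁ : E.R < R₁) :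
    InitialDataSet.IsTameDataFamily (E.restrict hR₁.le) 1 (curve B D) := by
  have h0 : AFEnd.breatheFamily B D ((0 : EuclideanSpace ℝ (Fin 1)) 0) = D :=
    AFEnd.breatheCurve_zero B D
  refine InitialDataSet.isTameDataFamily_restrict_of_agree_off_compact_one
    (AFEnd.isSmoothDataFamily_breatheCurve B D) hE (M := M) ?_ (AFEnd.isCompact_breatheCore B) ?_ hR₁
  · show E.IsStronglyAsymptoticallyFlatDR
      (AFEnd.breatheFamily B D ((0 : EuclideanSpace ℝ (Fin 1)) 0)) M
    rw [h0]
    exact hSAF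
  · intro c x hx
    show (AFEnd.breatheFamily B D (c 0)).h.inner x =
        (AFEnd.breatheFamily B D ((0 : EuclideanSpace ℝ (Fin 1)) 0)).h.inner x ∧
      (AFEnd.breatheFamily B D (c 0)).k x =
        (AFEnd.breatheFamily B D ((0 : EuclideanSpace ℝ (Fin 1)) 0)).k x
    rw [h0]
    exact AFEnd.breatheFamily_eq_of_not_mem_core B D (c 0) hx

/-- The witness data of a breathing curve through an admissible datum, in the shape consumed by
`isTameChristodoulouGeneric_of_local` (everything but the escape clause). -/
theorem curve_witness {z : E3} (B : trivialAFEnd.BreathingData z 1)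
    {D : InitialDataSet (𝓡 3) Minkowski.slice} (hD : D ∈ 𝓓) :
    ∃ E : AFEnd Minkowski.slice, InitialDataSet.IsTameDataFamily E 1 (curve B D) ∧
      InitialDataSet.IsImmersedAtZero 1 (curve B D) ∧ curve B D 0 = D ∧ Injective (curve B D) ∧
        ∀ c, curve B D c ∈ 𝓓 := by
  obtain ⟨-, E, M, hsole, hdecay⟩ := id hD
  have hR₁ : E.R < E.R + 1 := by linarith
  exact ⟨E.restrict hR₁.le, isTameDataFamily_curve B hsole hdecay hR₁,
    AFEnd.isImmersedAtZero_breatheCurve B D, AFEnd.breatheCurve_zero B D,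
    AFEnd.injective_breatheCurve B D, fun c ↦ AFEnd.breatheCurve_mem_admissibleVacuumData B D hD c⟩

/-- The observable along the curve about `z₁`: horizontal motion. -/
theorem obsPair_curve₁ (D : InitialDataSet (𝓡 3) Minkowski.slice) (c : EuclideanSpace ℝ (Fin 1)) :
    obsPair (curve B₁ D c) = ((1 + AFEnd.squash B₁ (c 0)) ^ 2 * obs D z₁ - 1, obs D z₂ - 1) := by
  show (obs (AFEnd.breatheFamily B₁ D (c 0)) z₁ - 1, obs (AFEnd.breatheFamily B₁ D (c 0)) z₂ - 1) = _
  rw [obs_breatheFamily_center B₁ D (c 0),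
    obs_breatheFamily_of_not_mem B₁ D (c 0) R_lt_z₂ (by rw [dist_z₂_z₁]; norm_num)]

/-- The observable along the curve about `z₂`: vertical motion. -/
theorem obsPair_curve₂ (D : InitialDataSet (𝓡 3) Minkowski.slice) (c : EuclideanSpace ℝ (Fin 1)) :
    obsPair (curve B₂ D c) = (obs D z₁ - 1, (1 + AFEnd.squash B₂ (c 0)) ^ 2 * obs D z₂ - 1) := by
  show (obs (AFEnd.breatheFamily B₂ D (c 0)) z₁ - 1, obs (AFEnd.breatheFamily B₂ D (c 0)) z₂ - 1) = _
  rw [obs_breatheFamily_center B₂ D (c 0),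
    obs_breatheFamily_of_not_mem B₂ D (c 0) R_lt_z₁ (by rw [dist_z₁_z₂]; norm_num)]

/-- The moved coordinate differs from the unmoved one when `c ≠ 0`. -/
theorem moved_ne {z : E3} (B : trivialAFEnd.BreathingData z 1) {u : ℝ} (hu : 0 < u)
    {c : EuclideanSpace ℝ (Fin 1)} (hc : c ≠ 0) :
    (1 + AFEnd.squash B (c 0)) ^ 2 * u - 1 ≠ u - 1 := by
  intro h
  have hs := squash_ne_zero B (euclid1_ne_zero hc)
  have h2 : 2 + AFEnd.squash B (c 0) ≠ 0 := by
    have := AFEnd.one_add_squash_pos B (c 0); intro h'; linarith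
  have key : AFEnd.squash B (c 0) * (2 + AFEnd.squash B (c 0)) * u = 0 := by linear_combination h
  exact mul_ne_zero (mul_ne_zero hs h2) hu.ne' key

/-- Continuity in the parameter of the moved coordinate, and its value at `0`. -/
theorem exists_delta_moved {z : E3} (B : trivialAFEnd.BreathingData z 1) (u : ℝ) {ε : ℝ} (hε : 0 < ε) :
    ∃ δ > (0 : ℝ), ∀ c : EuclideanSpace ℝ (Fin 1), ‖c‖ < δ →
      |((1 + AFEnd.squash B (c 0)) ^ 2 * u - 1) - (u - 1)| < ε := by
  let g : EuclideanSpace ℝ (Fin 1) → ℝ := fun c ↦ (1 + AFEnd.squash B (c 0)) ^ 2 * u - 1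
  have hgc : Continuous g := by
    have h1 : Continuous fun c : EuclideanSpace ℝ (Fin 1) ↦ c 0 :=
      (EuclideanSpace.proj (𝕜 := ℝ) (0 : Fin 1)).continuous
    have h2 : Continuous (AFEnd.squash B) := (AFEnd.contDiff_squash B (n := 0)).continuous
    exact (((continuous_const.add (h2.comp h1)).pow 2).mul continuous_const).sub continuous_const
  have h00 : ((0 : EuclideanSpace ℝ (Fin 1)) 0 : ℝ) = 0 := rfl
  have hg0 : g 0 = u - 1 := by
    show (1 + AFEnd.squash B ((0 : EuclideanSpace ℝ (Fin 1)) 0)) ^ 2 * u - 1 = u - 1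
    rw [h00, AFEnd.squash_zero]
    ring
  obtain ⟨δ, hδ, h⟩ := Metric.continuousAt_iff.mp (hgc.continuousAt (x := 0)) ε hε
  refine ⟨δ, hδ, fun c hc ↦ ?_⟩
  have hcd : dist c 0 < δ := by rwa [dist_zero_right]
  have h' : dist (g c) (g 0) < ε := h hcd
  rw [Real.dist_eq, hg0] at h'
  exact h'

/-- Continuity of the observable coordinate along any jointly smooth family (chart components of a
smooth family are jointly smooth on the end, `AFEnd.contDiffAt_hCoeff_family`). -/
theorem continuous_obs_family {m : ℕ}
    {F : EuclideanSpace ℝ (Fin m) → InitialDataSet (𝓡 3) Minkowski.slice}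
    (hF : InitialDataSet.IsSmoothDataFamily m F) {z : E3} (hz : trivialAFEnd.R < ‖z‖) :
    Continuous fun c ↦ obs (F c) z := by
  have hc : Continuous fun c ↦ AFEnd.hCoeff trivialAFEnd (F c) z := by
    refine continuous_iff_continuousAt.2 fun c ↦ ?_
    have h := (AFEnd.contDiffAt_hCoeff_family (e := trivialAFEnd) hF.1 c hz).continuousAt
    have h2 : ContinuousAt (fun c' : EuclideanSpace ℝ (Fin m) ↦ (c', z)) c :=
      continuousAt_id.prodMk continuousAt_const
    exact ContinuousAt.comp (f := fun c' : EuclideanSpace ℝ (Fin m) ↦ (c', z)) h h2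
  exact (hc.clm_apply continuous_const).clm_apply continuous_const


/-! ### Elementary real bookkeeping: the side lengths `rad n = 1/(n+1)` are isolated -/

/-- `rad n − rad (n+1) = 1/((n+1)(n+2))`. -/
theorem rad_sub_rad_succ (n : ℕ) :
    rad n - rad (n + 1) = 1 / (((n : ℝ) + 1) * ((n : ℝ) + 2)) := by
  unfold rad
  push_cast
  field_simp
  ring

/-- The gap between consecutive side lengths is positive. -/
theorem gap_pos (n : ℕ) : 0 < rad n - rad (n + 1) := by
  rw [rad_sub_rad_succ]; positivity

/-- `rad` is strictly decreasing. -/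
theorem rad_strictAnti : StrictAnti rad := by
  intro m n h
  unfold rad
  apply one_div_lt_one_div_of_lt
  · positivity
  · exact_mod_cast Nat.add_lt_add_right h 1

/-- The gaps are strictly decreasing. -/
theorem gap_strictAnti {m n : ℕ} (h : m < n) : rad n - rad (n + 1) < rad m - rad (m + 1) := by
  rw [rad_sub_rad_succ, rad_sub_rad_succ]
  apply one_div_lt_one_div_of_lt
  · positivity
  · have h' : (m : ℝ) + 1 ≤ (n : ℝ) := by exact_mod_cast Nat.succ_le_of_lt h
    nlinarith

/-- The gap is at most half the side length. -/
theorem gap_le_half (n : ℕ) : rad n - rad (n + 1) ≤ rad n / 2 := by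
  rw [rad_sub_rad_succ]
  unfold rad
  rw [div_div]
  apply one_div_le_one_div_of_le
  · positivity
  · nlinarith [(Nat.cast_nonneg n : (0 : ℝ) ≤ n), sq_nonneg ((n : ℝ) + 1)]

/-- **Escape lemma.** A number `a'` different from `a`, `|a| = rad n`, but closer to it than the gap
`rad n − rad (n+1)` is non-zero and its absolute value is no side length `rad m`. -/
theorem escape {n : ℕ} {a a' : ℝ} (ha : |a| = rad n) (hne : a' ≠ a)
    (hlt : |a' - a| < rad n - rad (n + 1)) : a' ≠ 0 ∧ ∀ m : ℕ, |a'| ≠ rad m := by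
  have hgap2 := gap_le_half n
  have hradn := rad_pos n
  have hlt' := abs_sub_lt_iff.mp hlt
  -- `a` and `a'` have the same sign, so `|a'| ≠ |a|` and `a' ≠ 0`
  have hsign : (0 < a ∧ 0 < a') ∨ (a < 0 ∧ a' < 0) := by
    rcases le_or_gt 0 a with ha0 | ha0
    · rw [abs_of_nonneg ha0] at ha
      left
      exact ⟨by linarith, by linarith⟩
    · rw [abs_of_neg ha0] at ha
      right
      exact ⟨ha0, by linarith⟩
  have hne' : |a'| ≠ |a| := by
    intro h
    rcases hsign with ⟨h1, h2⟩ | ⟨h1, h2⟩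
    · rw [abs_of_pos h2, abs_of_pos h1] at h
      exact hne h
    · rw [abs_of_neg h2, abs_of_neg h1] at h
      exact hne (neg_injective h)
  have ha'0 : a' ≠ 0 := by
    rcases hsign with ⟨-, h2⟩ | ⟨-, h2⟩
    · exact h2.ne'
    · exact h2.ne
  refine ⟨ha'0, fun m hm ↦ ?_⟩
  have habs : abs (|a'| - |a|) < rad n - rad (n + 1) :=
    lt_of_le_of_lt (abs_abs_sub_abs_le_abs_sub a' a) hlt
  rw [hm, ha] at habs
  rcases lt_trichotomy m n with hmn | rfl | hmn
  · -- `m < n`: `rad m − rad n ≥ rad m − rad (m+1) > rad n − rad (n+1)`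
    have h1 : rad n ≤ rad (m + 1) := rad_strictAnti.antitone (Nat.succ_le_of_lt hmn)
    have h2 := gap_strictAnti hmn
    have h3 : 0 < rad m - rad n := sub_pos.2 (rad_strictAnti hmn)
    rw [abs_of_pos h3] at habs
    linarith
  · exact hne' (by rw [hm, ha])
  · -- `n < m`: `rad n − rad m ≥ rad n − rad (n+1)`
    have h1 : rad m ≤ rad (n + 1) := rad_strictAnti.antitone (Nat.succ_le_of_lt hmn)
    have h3 : rad m - rad n < 0 := sub_neg.2 (rad_strictAnti hmn)
    rw [abs_of_neg h3] at habs
    linarith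

/-! ### The two properties and their tame genericity on the admissible class -/

/-- The origin and the vertical sides of the concentric squares of side lengths `rad n`. -/
def sideV : Set (ℝ × ℝ) := {q | q = 0 ∨ ∃ n : ℕ, |q.1| = rad n ∧ |q.2| ≤ rad n}

/-- The horizontal sides of the concentric squares. -/
def sideH : Set (ℝ × ℝ) := {q | ∃ n : ℕ, |q.2| = rad n ∧ |q.1| ≤ rad n}

/-- The good set of property `PV`: the observable avoids the origin and the vertical sides. -/
def goodV : Set (InitialDataSet (𝓡 3) Minkowski.slice) := {D | obsPair D ∉ sideV}

/-- The good set of property `QH`: the observable avoids the horizontal sides. -/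
def goodH : Set (InitialDataSet (𝓡 3) Minkowski.slice) := {D | obsPair D ∉ sideH}

/-- Membership in `goodV`. -/
theorem mem_goodV {D : InitialDataSet (𝓡 3) Minkowski.slice} : D ∈ goodV ↔ obsPair D ∉ sideV :=
  Iff.rfl

/-- Membership in `goodH`. -/
theorem mem_goodH {D : InitialDataSet (𝓡 3) Minkowski.slice} : D ∈ goodH ↔ obsPair D ∉ sideH :=
  Iff.rfl

/-- The trivial datum is exceptional for `PV` (so the genericity of `PV` below is not vacuous). -/
theorem trivialData_not_mem_goodV : trivialData ∉ goodV :=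
  fun h ↦ (mem_goodV.1 h) (Or.inl obsPair_trivialData)

/-- **`PV` is TAME-Christodoulou-generic (codimension `1`) on the admissible class of `ℝ³`.**
Through an admissible datum whose observable sits at the origin passes the vertical breathing curve
(about `z₂`), off the origin and off every vertical side for all `c ≠ 0`; through one whose observable
sits on a vertical side passes the horizontal breathing curve (about `z₁`), off `sideV` for small
`c ≠ 0` (`escape`); both are tame admissible injective immersed curves (`curve_witness`), and locality in
the parameter suffices (`isTameChristodoulouGeneric_of_local`). -/
theorem isTameChristodoulouGeneric_PV :
    InitialDataSet.IsTameChristodoulouGeneric 𝓓 (· ∈ goodV) 1 := by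
  refine InitialDataSet.isTameChristodoulouGeneric_of_local fun d hd hP ↦ ?_
  have hmem : obsPair d ∈ sideV := not_not.mp (fun h ↦ hP (mem_goodV.2 h))
  rcases hmem with h0 | ⟨n, ha, hb⟩
  · -- the origin: vertical escape, every `c ≠ 0`
    obtain ⟨E, htame, himm, hzero, hinj, hadm⟩ := curve_witness B₂ hd
    refine ⟨E, curve B₂ d, htame, himm, hzero, hinj, hadm, 1, one_pos, fun c hc _ ↦ ?_⟩
    have h1 : obs d z₁ - 1 = 0 := congrArg Prod.fst h0
    have h2 : obs d z₂ - 1 = 0 := congrArg Prod.snd h0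
    have hu : obs d z₂ = 1 := by linarith
    have hne := moved_ne B₂ (u := 1) one_pos hc
    show obsPair (curve B₂ d c) ∉ sideV
    rw [obsPair_curve₂, h1, hu]
    rintro (h | ⟨m, hm, -⟩)
    · exact hne (by simpa using congrArg Prod.snd h)
    · exact (rad_pos m).ne' (by simpa using hm.symm)
  · -- a vertical side: horizontal escape, small `c ≠ 0`
    obtain ⟨E, htame, himm, hzero, hinj, hadm⟩ := curve_witness B₁ hd
    obtain ⟨δ, hδ, hclose⟩ := exists_delta_moved B₁ (obs d z₁) (gap_pos n)
    refine ⟨E, curve B₁ d, htame, himm, hzero, hinj, hadm, δ, hδ, fun c hc hcδ ↦ ?_⟩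
    have hne := moved_ne B₁ (obs_pos d R_lt_z₁) hc
    obtain ⟨hne0, hrad⟩ := escape ha hne (hclose c hcδ)
    show obsPair (curve B₁ d c) ∉ sideV
    rw [obsPair_curve₁]
    rintro (h | ⟨m, hm, -⟩)
    · exact hne0 (by simpa using congrArg Prod.fst h)
    · exact hrad m hm

/-- **`QH` is TAME-Christodoulou-generic (codimension `1`) on the admissible class of `ℝ³`**
(horizontal sides are escaped by small vertical motions). -/
theorem isTameChristodoulouGeneric_QH :
    InitialDataSet.IsTameChristodoulouGeneric 𝓓 (· ∈ goodH) 1 := by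
  refine InitialDataSet.isTameChristodoulouGeneric_of_local fun d hd hQ ↦ ?_
  have hmem : obsPair d ∈ sideH := not_not.mp (fun h ↦ hQ (mem_goodH.2 h))
  obtain ⟨n, hb, ha⟩ := hmem
  obtain ⟨E, htame, himm, hzero, hinj, hadm⟩ := curve_witness B₂ hd
  obtain ⟨δ, hδ, hclose⟩ := exists_delta_moved B₂ (obs d z₂) (gap_pos n)
  refine ⟨E, curve B₂ d, htame, himm, hzero, hinj, hadm, δ, hδ, fun c hc hcδ ↦ ?_⟩
  have hne := moved_ne B₂ (obs_pos d R_lt_z₂) hc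
  obtain ⟨-, hrad⟩ := escape hb hne (hclose c hcδ)
  show obsPair (curve B₂ d c) ∉ sideH
  rw [obsPair_curve₂]
  rintro ⟨m, hm, -⟩
  exact hrad m hm
/-! ### The conjunction has codimension zero -/

/-- **The exceptional set of `PV ∧ QH` has codimension ZERO inside the admissible class**: it fails
`HasCodimAtLeastIn 𝓓 … m` for every `m ≥ 1` — every jointly smooth family of admissible data through
the trivial datum meets it again off `0` (level-set trap of `GenericityScale.lean` for the observable
`max |Φᵢ|`, whose zero set is the origin and whose level sets at `rad n` are the squares). -/
theorem not_hasCodimAtLeastIn_PV_and_QH {m : ℕ} (hm : m ≠ 0) :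
    ¬ InitialDataSet.HasCodimAtLeastIn 𝓓 {d ∈ 𝓓 | ¬ (d ∈ goodV ∧ d ∈ goodH)} m := by
  refine not_hasCodimAtLeastIn_of_trap hm (f := fun D ↦ max |obs D z₁ - 1| |obs D z₂ - 1|)
    ?_ (d := trivialData) ?_ ?_ ?_ ?_
  · intro F hF γ hγ
    have h1 := (continuous_obs_family hF R_lt_z₁).comp hγ.continuous
    have h2 := (continuous_obs_family hF R_lt_z₂).comp hγ.continuous
    exact ((h1.sub continuous_const).abs).max ((h2.sub continuous_const).abs)
  · exact ⟨trivialData_mem_admissibleVacuumData, fun h ↦ h.1 (Or.inl obsPair_trivialData)⟩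
  · simp [obs_trivialData]
  · intro d' hd' h0
    refine ⟨hd', fun h ↦ h.1 (Or.inl ?_)⟩
    have h1 : |obs d' z₁ - 1| ≤ 0 := h0 ▸ le_max_left _ _
    have h2 : |obs d' z₂ - 1| ≤ 0 := h0 ▸ le_max_right _ _
    have e1 : obs d' z₁ - 1 = 0 := abs_nonpos_iff.mp h1
    have e2 : obs d' z₂ - 1 = 0 := abs_nonpos_iff.mp h2
    show (obs d' z₁ - 1, obs d' z₂ - 1) = 0
    rw [e1, e2]
    rfl
  · intro ε hε
    obtain ⟨n, hn⟩ := exists_nat_one_div_lt hε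
    refine ⟨rad n, rad_pos n, hn, fun d' hd' hlev ↦ ⟨hd', fun h ↦ ?_⟩⟩
    rw [abs_of_nonneg (le_max_of_le_left (abs_nonneg _))] at hlev
    rcases le_total |obs d' z₂ - 1| |obs d' z₁ - 1| with hle | hle
    · rw [max_eq_left hle] at hlev
      exact h.1 (Or.inr ⟨n, hlev, hlev ▸ hle⟩)
    · rw [max_eq_right hle] at hlev
      exact h.2 ⟨n, hlev, hlev ▸ hle⟩

/-- **`PV ∧ QH` is not TAME-Christodoulou-generic, for any codimension parameter `m ≥ 1`** (nor
generic in the topology-free sense: the failure is of `HasCodimAtLeastIn` itself). -/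
theorem not_isTameChristodoulouGeneric_PV_and_QH {m : ℕ} (hm : m ≠ 0) :
    ¬ InitialDataSet.IsTameChristodoulouGeneric 𝓓 (fun D ↦ D ∈ goodV ∧ D ∈ goodH) m :=
  fun h ↦ not_hasCodimAtLeastIn_PV_and_QH hm h.isChristodoulouGeneric

end Tame


/-- **The glue principle is false for the summit's notion on the crux's class.** On
`admissibleVacuumData ℝ³` there are properties `P`, `Q` each TAME-Christodoulou-generic with
codimension `1` (`InitialDataSet.IsTameChristodoulouGeneric … 1`, the notion and the scale of
`FinalStateConjecture` and of `PhotonSphereChannels.TameCensorship`) whose conjunction is not.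
Consequence for the crux: `TameCensorship` bundles MGHD-existence, complete `𝓘⁺`, the third law and
outer tameness into ONE tame-generic property; it does not follow from the tame genericity of the four
conjuncts separately — a proof must build one tame curve escaping all exceptional sets at once. -/
theorem not_isTameChristodoulouGeneric_and_of_admissible :
    ¬ ∀ P Q : InitialDataSet (𝓡 3) Minkowski.slice → Prop,
        InitialDataSet.IsTameChristodoulouGeneric (admissibleVacuumData Minkowski.slice) P 1 →
        InitialDataSet.IsTameChristodoulouGeneric (admissibleVacuumData Minkowski.slice) Q 1 →
        InitialDataSet.IsTameChristodoulouGeneric (admissibleVacuumData Minkowski.slice)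
          (fun D ↦ P D ∧ Q D) 1 :=
  fun h ↦ Tame.not_isTameChristodoulouGeneric_PV_and_QH one_ne_zero
    (h _ _ Tame.isTameChristodoulouGeneric_PV Tame.isTameChristodoulouGeneric_QH)

/-- **Witness form, all codimensions.** Two TAME-generic (codimension `1`) properties of admissible
data on `ℝ³` whose conjunction fails `IsTameChristodoulouGeneric … m` AND the topology-free
`IsChristodoulouGeneric … m` for every `m ≥ 1` (its exceptional set has codimension zero); the
exceptional set of the first property is nonempty (it contains the trivial datum). -/
theorem isTameChristodoulouGeneric_and_fails_admissible :
    ∃ P Q : InitialDataSet (𝓡 3) Minkowski.slice → Prop,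
      InitialDataSet.IsTameChristodoulouGeneric (admissibleVacuumData Minkowski.slice) P 1 ∧
      InitialDataSet.IsTameChristodoulouGeneric (admissibleVacuumData Minkowski.slice) Q 1 ∧
      (trivialData ∈ admissibleVacuumData Minkowski.slice ∧ ¬ P trivialData) ∧
      ∀ m ≠ 0,
        ¬ InitialDataSet.IsTameChristodoulouGeneric (admissibleVacuumData Minkowski.slice)
            (fun D ↦ P D ∧ Q D) m ∧
        ¬ InitialDataSet.IsChristodoulouGeneric (admissibleVacuumData Minkowski.slice)
            (fun D ↦ P D ∧ Q D) m :=
  ⟨(· ∈ Tame.goodV), (· ∈ Tame.goodH), Tame.isTameChristodoulouGeneric_PV,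
    Tame.isTameChristodoulouGeneric_QH, ⟨trivialData_mem_admissibleVacuumData, Tame.trivialData_not_mem_goodV⟩,
    fun _ hm ↦ ⟨Tame.not_isTameChristodoulouGeneric_PV_and_QH hm,
      Tame.not_hasCodimAtLeastIn_PV_and_QH hm⟩⟩


end TameGlue

/-! ## §13 (cycle 4) The refutation interface for clause (i): an extremal remnant in ANY vacuum Cauchy
development of the datum — maximal or not — makes the datum exceptional

The MGHD barrier (§3/§5) is that no MAXIMAL development is constructible in the tree. For clause (i)
maximality is needed only on the far side: late charts PUSH FORWARD along the embedding
`𝒟' ↪ 𝒟` that maximality of a (hypothetical) MGHD `𝒟` provides for every vacuum Cauchy development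
`𝒟'` of the same datum, with the SAME deviation function (`Spacetime.deviation_comp`, tree), and
`IsLateChart` (smooth + open embedding on the late region + image in `univ`) composes. Hence
`not_mem_tameSet_of_extremal_lateChart`: to put an admissible datum into the exceptional set of K3 it
suffices to exhibit ONE vacuum Cauchy development of it (any globally hyperbolic vacuum development
with the datum as Cauchy surface) carrying a late chart from a boosted extremal Kerr exterior with
truncated `C²` deviation `→ 0` — no maximality, no MGHD uniqueness. (If the datum has no MGHD at all it
is exceptional anyway.) What is still missing for an actual exceptional datum: a vacuum Cauchy
development of a COMPLETE one-ended admissible datum containing an extremal Kerr late region — i.e.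
local well-posedness for glued data plus the Cauchy-surface property, neither in the tree; and even
then K3 would only be shown NON-VACUOUS (exceptional set `≠ ∅`), not false: near such a datum the
Kehle–Unger picture predicts codimension one, i.e. escapable. The other two clauses do NOT push
forward (an incomplete ray of `𝒟'` may extend in `𝒟`; `outer` grows), so they keep the full barrier. -/

section PushForward

open Filter

variable {X : Type} [TopologicalSpace X] [ChartedSpace E3 X]
  [IsManifold (modelWithCornersSelf ℝ E3) ((⊤ : ℕ∞) : WithTop ℕ∞) X] [ConnectedSpace X]
  {D : InitialDataSet (modelWithCornersSelf ℝ E3) X}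

/-- **Late charts with decaying deviation push forward along development embeddings** (same
background, same deviation numbers). -/
theorem extremalChart_pushforward {𝒟' 𝒟 : VacuumCauchyDevelopment D}
    (h : 𝒟'.toCauchyDevelopment.EmbedsInto 𝒟.toCauchyDevelopment) (B : ModelBackground) {τ₀ : ℝ}
    {Ψ : B.domain → 𝒟'.carrier} (hΨ : 𝒟'.toSpacetime.IsLateChart B Set.univ τ₀ Ψ)
    (hdev : ∀ R : ℝ, Tendsto (fun τ ↦ 𝒟'.toSpacetime.truncDeviationCk B Ψ 2 R τ) atTop (nhds 0)) :
    ∃ Ψ' : B.domain → 𝒟.carrier, 𝒟.toSpacetime.IsLateChart B Set.univ τ₀ Ψ' ∧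
      ∀ R : ℝ, Tendsto (fun τ ↦ 𝒟.toSpacetime.truncDeviationCk B Ψ' 2 R τ) atTop (nhds 0) := by
  obtain ⟨ψ, hψs, hψo, hψi, -, -⟩ := h
  refine ⟨ψ ∘ Ψ, ⟨hψs.comp hΨ.contMDiff, hψo.comp hΨ.isOpenEmbedding, Set.subset_univ _⟩, fun R ↦ ?_⟩
  have hcomp : 𝒟.toSpacetime.truncDeviationCk B (ψ ∘ Ψ) 2 R =
      𝒟'.toSpacetime.truncDeviationCk B Ψ 2 R := by
    funext τ
    unfold Spacetime.truncDeviationCk Spacetime.deviationExtend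
    rw [Spacetime.deviation_comp B (hψs.mdifferentiable (by simp)) hψi.2
      (hΨ.contMDiff.mdifferentiable (by simp))]
  rw [hcomp]
  exact hdev R

/-- **Refutation interface for clause (i).** If SOME vacuum Cauchy development `𝒟'` of the datum `D`
(not necessarily maximal) carries a late chart from a boosted extremal Kerr exterior with truncated `C²`
deviation `→ 0` for every radius, then `D` is exceptional for the K3 property: `D ∉ tameSet X`
(either `D` has no MGHD, or the chart pushes forward into the MGHD by maximality and violates (i)
there). No maximality or uniqueness of developments is used on the near side. -/
theorem not_mem_tameSet_of_extremal_lateChart (𝒟' : VacuumCauchyDevelopment D)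
    {Λ : lorentzGroup} {c : E4} {M a : ℝ} (hext : Kerr.IsExtremal M a) {τ₀ : ℝ}
    {Ψ : (boostedKerrBackground Λ c M a).domain → 𝒟'.carrier}
    (hΨ : 𝒟'.toSpacetime.IsLateChart (boostedKerrBackground Λ c M a) Set.univ τ₀ Ψ)
    (hdev : ∀ R : ℝ, Tendsto
      (fun τ ↦ 𝒟'.toSpacetime.truncDeviationCk (boostedKerrBackground Λ c M a) Ψ 2 R τ)
      atTop (nhds 0)) :
    D ∉ tameSet X := by
  rintro ⟨⟨𝒟, hmax⟩, hall⟩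
  obtain ⟨Ψ', hΨ', hdev'⟩ := extremalChart_pushforward (hmax 𝒟') (boostedKerrBackground Λ c M a) hΨ hdev
  exact (hall 𝒟 hmax).2.1 Λ c M a hext ⟨τ₀, Ψ', hΨ', hdev'⟩

/-- **Equivalently, for provers: under K3's property, NO vacuum Cauchy development of the datum has an
extremal remnant chart** — clause (i) for the MGHD is clause (i) for every globally hyperbolic vacuum
development (the form K2R-type resolutions may consume on sub-developments). -/
theorem no_extremal_lateChart_of_mem_tameSet (hD : D ∈ tameSet X) (𝒟' : VacuumCauchyDevelopment D)
    (Λ : lorentzGroup) (c : E4) (M a : ℝ) (hext : Kerr.IsExtremal M a) :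
    ¬ ∃ (τ₀ : ℝ) (Ψ : (boostedKerrBackground Λ c M a).domain → 𝒟'.carrier),
      𝒟'.toSpacetime.IsLateChart (boostedKerrBackground Λ c M a) Set.univ τ₀ Ψ ∧
      ∀ R : ℝ, Tendsto
        (fun τ ↦ 𝒟'.toSpacetime.truncDeviationCk (boostedKerrBackground Λ c M a) Ψ 2 R τ)
        atTop (nhds 0) := by
  rintro ⟨τ₀, Ψ, hΨ, hdev⟩
  exact not_mem_tameSet_of_extremal_lateChart 𝒟' hext hΨ hdev hD

end PushForward

end Summit.FinalStateConjecture.FinalStateConjecture.Cruxes.TameCensorship.Disproof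

end
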